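import Literature.Computability.Complexity.StackUnary
import Literature.Computability.Complexity.StackStrings
import Literature.ModelTheory.FiniteModelTheory.LFPArith
import HarnessLib

/-!
# The evaluator of a fixed sentence of FO(IFP) with order, as a polynomial-cost stack program

Topic `Literature/ModelTheory/FiniteModelTheory`; steps 1–2 of the discharge of the named fact
`Literature.ModelTheory.FiniteModelTheory.natModelClass_mem_P` (Gurevich 1984, §4 Theorem 3, (3) → (1): zero-ary
global predicates expressible in FO + IFP with order are PTIME — proved there from Claim 2, "the
iteration closes after at most `|S|^l` steps", and §3 Theorem 1, first-order global predicates
are PTIME; the easy half of Immerman–Vardi, Immerman 1999, Thm. 4.10), for the machine model of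
the tree's class `P`: the structured stack programs `Com` of `StackPrograms.lean`, whose
polynomial-cost runs compute `FP` functions (`Com.mem_FP`). The decision procedure proper
(parsing the code of the structure, `Com.mem_FP`, `mem_P_of_mem_FP`) is `LFPEvalProgram.lean`.

DATA. Elements of the universe `Fin N = {0, …, N-1}` (Gurevich's Proviso 2) are kept in UNARY,
`ones v = 1ᵛ`; a `k`-ary relation is its table, the bit string of length `N ^ k` indexed
little-endian by `finFunctionFinEquiv` (`tableOf`; the layout of the code, `SNP.lean`); truth
values are flags (`StackStrings.lean`).

GENERIC ROUTINES (section `Generic`, any register type `ι`, each with an exact-cost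
specification `runs_…`): `ltTest` (flag `|a| < |b|`), `lookupBit` (the bit `T[|I|]`),
`idxProg` (Horner in base `N` over digit registers, highest digit first = the little-endian
index, `hornerVal_eq_leVal`, `hornerVal_digits`), `powProg` (`1^{A·N^k}`), `mkOnes`,
`capHorner` (capped binary-to-unary conversion, `cappedVal_eq`, `msbVal_reverse`), `outProg`,
`tbitsProg` (`1^{Σ N^{aᵢ}}`).

THE EVALUATOR. Registers `ER A V W P`: input, result, `nn = 1ᴺ`, junk, scratch `s 0, …, s 7`,
the input tables `tbl i`, for every element-variable LEVEL `j < V` (de Bruijn levels: the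
variable of index `i : Fin n` of a `Formula (2 :: ar) rv n` is level `i`, so registers are
global) a value register `xv j` and a loop register `lp j`, for every relation-variable level
`m < W` (the variable of index `j` is level `|rv| - 1 - j`) the table `rvr m` of its current
stage, a working copy `rvc m`, the builder `rvb m` of the next stage and the stage counter
`rvo m`, and work flags `wk d i` per node depth `d < P`. The compiler `cmp ψ dp` (formulas of
`LFP.lean`, symbol `0` read as the natural order `<`, `withNatOrder`) leaves the truth value of
`ψ` as a flag in `wk dp 0`: order atoms by `ltTest`, input atoms and relation variables by
`idxProg` + `lookupBit`, connectives by flag plumbing, `∃` by a loop over the `N` values of the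
new level (`∀` is compiled as `¬∃¬`), and the inflationary fixed point `[IFP_{X,x̄} φ](t̄)` by
`N ^ k` STAGES (`rvo := 1^{N^k}`, `powProg`), each enumerating all `N ^ k` tuples in index
order (`enumLoops`), popping the old bit from the copy, evaluating the body, pushing
`old ∨ body` on the builder, then `rvr := reverse rvb`: the table of `X ∪ F(X)`.

CORRECTNESS (`Spec`, `spec_cmp`): from every register file satisfying the invariant `Inv` the
program RUNS (big-step semantics with cost, `fcost N ψ`) to the same file updated at `wk dp 0`
with the flag of `ψ.eval`; the fixed-point case (`spec_fp`) maintains `rvr = tableOf X_s`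
through the view `fpSt` (`runs_fpBody`, `runs_enum`, `runs_fpStage`, `runs_fpStages`) and
concludes with Claim 2, `ifpStages_pow_eq_ifp : X_{N^k} = IFP`. COST (`polyBd_fcost`):
`fcost N ψ ≤ C · (N + 1) ^ e` for constants depending on `ψ` only — the polynomial bound of
Theorem 3.

## References

* Y. Gurevich, *Toward logic tailored for computational complexity*, in: Computation and Proof
  Theory (Logic Colloquium '83), LNM 1104, Springer 1984, 175–216: §3 Theorem 1, §4 Claim 2 and
  Theorem 3 (printed pp. 195, 201–202).
* N. Immerman, *Descriptive Complexity*, Springer 1999, Thm. 4.10.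
* M. Y. Vardi, *The complexity of relational query languages*, STOC 1982, 137–146.
* T. Nipkow, G. Klein, *Concrete Semantics*, Springer 2014, Ch. 7 (big-step semantics with
  costs; the style of `StackPrograms.lean`).
-/

namespace Literature.ModelTheory.FiniteModelTheory

open _root_.Computability

namespace LFPEval

open Literature.Computability.Complexity.Com

section Generic

variable {ι : Type} [DecidableEq ι]

/-! ### Comparing unary registers -/

/-- `ltTest a b s1 s2 f t u`: `f := flag (|a| < |b|)`, `a`, `b` kept (scratch `s1 s2 t u`, and `f`,
empty). [folklore] -/
def ltTest (a b s1 s2 f t u : ι) : Literature.Computability.Complexity.Com ι :=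
  copy a s1 t u ;; copy b s2 t u ;; subFrom s2 s1 ;;
    pop s2 (clear s2 ;; push f true) (clear s2 ;; push f true) skip

/-- Specification of `ltTest`: `f` receives the flag `|a| < |b|`, `a` and `b` are kept, the scratch registers end empty; cost linear in `|a| + |b|`. [folklore] -/
theorem runs_ltTest {a b s1 s2 f t u : ι} (h1 : [a, s1, s2, f, t, u].Nodup) (h2 : [b, s1, s2, f, t, u].Nodup)
    (R : Literature.Computability.Complexity.Regs ι) (hs1 : R s1 = []) (hs2 : R s2 = []) (hf : R f = []) (ht : R t = []) (hu : R u = []) :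
    Runs (ltTest a b s1 s2 f t u) R (Function.update R f (Literature.Computability.Complexity.flag (decide ((R a).length < (R b).length))))
      (10 * (R a).length + 10 * (R b).length + 4 * (R a).length + 2 * (R b).length + 12) := by
  simp only [List.nodup_cons, List.mem_cons, not_or, List.not_mem_nil, not_false_eq_true,
    and_true, List.nodup_nil] at h1 h2
  obtain ⟨⟨has1, has2, haf, hat, hau⟩, ⟨hs12, hs1f, hs1t, hs1u⟩, ⟨hs2f, hs2t, hs2u⟩, ⟨hft, hfu⟩, htu⟩ := h1
  obtain ⟨⟨hbs1, hbs2, hbf, hbt, hbu⟩, -⟩ := h2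
  -- copy a
  have c1 := runs_copy has1 hat hau hs1t hs1u htu R ht hu
  rw [hs1, List.append_nil] at c1
  set R₁ := Function.update R s1 (R a) with hR₁
  have c2 := runs_copy hbs2 hbt hbu hs2t hs2u htu R₁ (by simp [hR₁, Ne.symm hs1t, ht]) (by simp [hR₁, Ne.symm hs1u, hu])
  have hR₁b : R₁ b = R b := by simp [hR₁, hbs1]
  have hR₁s2 : R₁ s2 = [] := by simp [hR₁, Ne.symm hs12, hs2]
  rw [hR₁b, hR₁s2, List.append_nil] at c2
  set R₂ := Function.update R₁ s2 (R b) with hR₂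
  have c3 := runs_subFrom (Ne.symm hs12) (R a) R₂ (by simp [hR₂, hs12, hR₁])
  have hR₂s2 : R₂ s2 = R b := by simp [hR₂]
  rw [hR₂s2] at c3
  set R₃ := Function.update (Function.update R₂ s1 []) s2 ((R b).drop (R a).length) with hR₃
  -- final pop
  have hgoal : Function.update R f (Literature.Computability.Complexity.flag (decide ((R a).length < (R b).length))) =
      Function.update (Function.update R₃ s2 []) f (Literature.Computability.Complexity.flag (decide ((R a).length < (R b).length))) := by
    ext i : 1
    simp only [hR₃, hR₂, hR₁, Function.update_apply]
    split_ifs <;> simp_all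
  have c4 : Runs (pop s2 (clear s2 ;; push f true) (clear s2 ;; push f true) skip) R₃
      (Function.update (Function.update R₃ s2 []) f (Literature.Computability.Complexity.flag (decide ((R a).length < (R b).length))))
      (2 * (R b).length + 4) := by
    have hR₃s2 : R₃ s2 = (R b).drop (R a).length := by simp [hR₃]
    have hR₃f : R₃ f = [] := by simp [hR₃, Ne.symm hs2f, Ne.symm hs1f, hR₂, hR₁, hf]
    rcases hd : (R b).drop (R a).length with _ | ⟨c, w⟩
    · have hlen : ¬ (R a).length < (R b).length := by
        intro hlt
        have : ((R b).drop (R a).length).length = (R b).length - (R a).length := List.length_drop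
        rw [hd] at this
        simp at this; omega
      rw [decide_eq_false hlen, Literature.Computability.Complexity.flag_false]
      refine (Runs.pop_nil _ _ (by rw [hR₃s2, hd]) (Runs.skip _)).of_eq ?_ (by omega)
      rw [Function.update_eq_self_iff.2 ?_, Function.update_eq_self_iff.2 (by rw [hR₃s2, hd])]
      rw [Function.update_of_ne (Ne.symm hs2f) , hR₃f]  -- f-th of update s2
    · have hlen : (R a).length < (R b).length := by
        by_contra hge
        rw [List.drop_eq_nil_of_le (not_lt.mp hge)] at hd
        simp at hd
      rw [decide_eq_true hlen, Literature.Computability.Complexity.flag_true]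
      have body : Runs (clear s2 ;; push f true) (Function.update R₃ s2 w)
          (Function.update (Function.update R₃ s2 []) f [true]) (2 * w.length + 1 + 1) := by
        have e1 := runs_clear s2 (Function.update R₃ s2 w)
        simp only [Function.update_self, Function.update_idem] at e1
        refine e1.seq (Runs.push' ?_)
        rw [Function.update_of_ne (Ne.symm hs2f), hR₃f]
      have hw : w.length ≤ (R b).length := by
        have := congrArg List.length hd; simp at this; omega
      cases c
      · exact (Runs.pop_false _ _ (by rw [hR₃s2, hd]) body).mono (by omega)
      · exact (Runs.pop_true _ _ (by rw [hR₃s2, hd]) body).mono (by omega)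
  rw [hgoal]
  refine ((c1.seq (c2.seq (c3.seq c4)))).mono ?_
  omega


/-! ### Reading one bit of a table at a unary index -/

/-- `lookupBit T I f s c t u`: `f := flag (T[|I|] = true)` (the bit of the table `T` at the unary
index `I`; `false` beyond the table), `T`, `I` kept (scratch `s c t u` and `f` empty). [folklore] -/
def lookupBit (T I f s c t u : ι) : Literature.Computability.Complexity.Com ι :=
  copy T s t u ;; copy I c t u ;; subFrom s c ;; pop s (push f true) skip skip ;; clear s

/-- Specification of `lookupBit`: `f` receives the flag `T[|I|] = true` (false beyond the table), `T` and `I` are kept; cost linear in `|T| + |I|`. [folklore] -/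
theorem runs_lookupBit {T I f s c t u : ι} (h1 : [T, s, c, f, t, u].Nodup) (h2 : [I, s, c, f, t, u].Nodup)
    (R : Literature.Computability.Complexity.Regs ι) (hs : R s = []) (hc : R c = []) (hf : R f = []) (ht : R t = []) (hu : R u = []) :
    Runs (lookupBit T I f s c t u) R
      (Function.update R f (Literature.Computability.Complexity.flag (decide ((R T)[(R I).length]? = some true))))
      (16 * (R T).length + 14 * (R I).length + 11) := by
  simp only [List.nodup_cons, List.mem_cons, not_or, List.not_mem_nil, not_false_eq_true,
    and_true, List.nodup_nil] at h1 h2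
  obtain ⟨⟨hTs, hTc, hTf, hTt, hTu⟩, ⟨hsc, hsf, hst, hsu⟩, ⟨hcf, hct, hcu⟩, ⟨hft, hfu⟩, htu⟩ := h1
  obtain ⟨⟨hIs, hIc, hIf, hIt, hIu⟩, -⟩ := h2
  have c1 := runs_copy hTs hTt hTu hst hsu htu R ht hu
  rw [hs, List.append_nil] at c1
  set R₁ := Function.update R s (R T) with hR₁
  have c2 := runs_copy hIc hIt hIu hct hcu htu R₁ (by simp [hR₁, Ne.symm hst, ht]) (by simp [hR₁, Ne.symm hsu, hu])
  have hR₁I : R₁ I = R I := by simp [hR₁, hIs]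
  have hR₁c : R₁ c = [] := by simp [hR₁, Ne.symm hsc, hc]
  rw [hR₁I, hR₁c, List.append_nil] at c2
  set R₂ := Function.update R₁ c (R I) with hR₂
  have c3 := runs_subFrom hsc (R I) R₂ (by simp [hR₂])
  have hR₂s : R₂ s = R T := by simp [hR₂, hsc, hR₁]
  rw [hR₂s] at c3
  set R₃ := Function.update (Function.update R₂ c []) s ((R T).drop (R I).length) with hR₃
  have hR₃s : R₃ s = (R T).drop (R I).length := by simp [hR₃]
  have hR₃f : R₃ f = [] := by simp [hR₃, Ne.symm hsf, Ne.symm hcf, hR₂, hR₁, hf]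
  -- pop s and push flag
  set b := decide ((R T)[(R I).length]? = some true) with hb
  have c4 : Runs (pop s (push f true) skip skip) R₃
      (Function.update (Function.update R₃ s ((R T).drop ((R I).length + 1))) f (Literature.Computability.Complexity.flag b)) 3 := by
    rcases hd : (R T).drop (R I).length with _ | ⟨x, w⟩
    · have hnone : (R T)[(R I).length]? = none := by
        rw [List.getElem?_eq_none]
        have : ((R T).drop (R I).length).length = (R T).length - (R I).length := List.length_drop
        rw [hd] at this; simp at this; omega
      have hb' : b = false := by rw [hb, hnone]; rfl
      rw [hb', Literature.Computability.Complexity.flag_false]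
      refine (Runs.pop_nil _ _ (by rw [hR₃s, hd]) (Runs.skip _)).of_eq ?_ (by omega)
      have e1 : (R T).drop ((R I).length + 1) = [] := by
        rw [← List.drop_drop, hd]; rfl
      have e2 : Function.update R₃ s [] = R₃ := Function.update_eq_self_iff.mpr (by rw [hR₃s, hd])
      rw [e1, e2]
      exact (Function.update_eq_self_iff.mpr hR₃f.symm).symm
    · have hsome : (R T)[(R I).length]? = some x := by
        have := List.getElem?_drop (xs := R T) (i := (R I).length) (j := 0)
        rw [hd] at this; simpa using this.symm
      have e1 : (R T).drop ((R I).length + 1) = w := by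
        rw [← List.drop_drop, hd]; rfl
      rw [e1]
      cases x
      · have hb' : b = false := by rw [hb, hsome]; rfl
        rw [hb', Literature.Computability.Complexity.flag_false]
        refine (Runs.pop_false _ _ (by rw [hR₃s, hd]) (Runs.skip _)).of_eq ?_ (by omega)
        exact (Function.update_eq_self_iff.mpr (by rw [Function.update_of_ne (Ne.symm hsf), hR₃f])).symm
      · have hb' : b = true := by rw [hb, hsome]; rfl
        rw [hb', Literature.Computability.Complexity.flag_true]
        refine (Runs.pop_true _ _ (by rw [hR₃s, hd]) (Runs.push' ?_)).of_eq rfl (by omega)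
        rw [Function.update_of_ne (Ne.symm hsf), hR₃f]
  set R₄ := Function.update (Function.update R₃ s ((R T).drop ((R I).length + 1))) f (Literature.Computability.Complexity.flag b) with hR₄
  have c5 := runs_clear s R₄
  have hR₄s : (R₄ s).length ≤ (R T).length := by
    rw [hR₄, Function.update_of_ne hsf, Function.update_self, List.length_drop]; omega
  have hgoal : Function.update R f (Literature.Computability.Complexity.flag b) = Function.update R₄ s [] := by
    ext i : 1
    simp only [hR₄, hR₃, hR₂, hR₁, Function.update_apply]
    split_ifs <;> simp_all
  rw [hgoal]
  refine (c1.seq (c2.seq (c3.seq (c4.seq c5)))).mono ?_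
  omega

/-! ### The index of a tuple of unary digits: Horner in base `N` -/

/-- `idxProg n a a2 t vs`: `a := a · N^{|vs|} + (the number with base-`N` digits the unary values
of the registers `vs`, highest first)`; registers `vs` kept. [folklore] -/
def idxProg (n a a2 t : ι) : List ι → Literature.Computability.Complexity.Com ι
  | [] => skip
  | v :: vs => (mulReg n a a2 t ;; pour a2 a ;; addReg v a t) ;; idxProg n a a2 t vs

/-- One Horner step on unary registers: `a := 1^{A·N + V}` (multiply by `N = |n|`, add the digit `V = |v|`). [folklore] -/
theorem runs_idxStep {n a a2 t v : ι} (hna : n ≠ a) (hna2 : n ≠ a2) (hnt : n ≠ t) (haa2 : a ≠ a2)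
    (hat : a ≠ t) (ha2t : a2 ≠ t) (hva : v ≠ a) (hva2 : v ≠ a2) (hvt : v ≠ t) (N A V : ℕ) (R : Literature.Computability.Complexity.Regs ι)
    (hn : R n = Literature.Computability.Complexity.ones N) (ha : R a = Literature.Computability.Complexity.ones A) (ha2 : R a2 = []) (ht : R t = []) (hv : R v = Literature.Computability.Complexity.ones V) :
    Runs (mulReg n a a2 t ;; pour a2 a ;; addReg v a t) R (Function.update R a (Literature.Computability.Complexity.ones (A * N + V)))
      (A * (7 * N + 4) + 1 + (3 * (A * N) + 1) + (7 * V + 2)) := by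
  have h1 := runs_mulReg hna hna2 hnt haa2 hat ha2t N A R hn ha ht
  rw [ha2, List.append_nil] at h1
  set R₁ := Function.update (Function.update R a []) a2 (Literature.Computability.Complexity.ones (A * N)) with hR₁
  have h2 := runs_pour haa2.symm R₁
  have hR₁a2 : R₁ a2 = Literature.Computability.Complexity.ones (A * N) := by simp [hR₁]
  have hR₁a : R₁ a = [] := by simp [hR₁, Function.update_of_ne haa2]
  rw [hR₁a2, hR₁a, List.append_nil, List.reverse_replicate, List.length_replicate] at h2
  set R₂ := Function.update (Function.update R₁ a2 []) a (Literature.Computability.Complexity.ones (A * N)) with hR₂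
  have hR₂v : R₂ v = Literature.Computability.Complexity.ones V := by simp [hR₂, hva, hR₁, hva2, hv]
  have h3 := runs_addReg hva hvt hat R₂ (by simp [hR₂, Ne.symm hat, hR₁, Ne.symm ha2t, ht])
  rw [hR₂v, List.length_replicate] at h3
  have hR₂a : R₂ a = Literature.Computability.Complexity.ones (A * N) := by simp [hR₂]
  rw [hR₂a, ones_append, Nat.add_comm V] at h3
  refine (h1.seq (h2.seq h3)).of_eq ?_ (by omega)
  ext i : 1
  simp only [hR₂, hR₁, Function.update_apply]
  split_ifs <;> simp_all

/-- **Effect of `idxProg`** with a uniform bound `B` on the digits and on all intermediate Horner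
values (cost `≤ |vs| · (B (10 N + 12) + 4)`): `a := 1^{hornerVal N A digits}`. [folklore] -/
theorem runs_idxProg {n a a2 t : ι} (hna : n ≠ a) (hna2 : n ≠ a2) (hnt : n ≠ t) (haa2 : a ≠ a2)
    (hat : a ≠ t) (ha2t : a2 ≠ t) (N B : ℕ) (val : ι → ℕ) :
    ∀ (vs : List ι) (A : ℕ), (∀ v ∈ vs, v ≠ a ∧ v ≠ a2 ∧ v ≠ t) → A ≤ B → (∀ v ∈ vs, val v ≤ B) →
    hornerVal N A (vs.map val) ≤ B → ∀ (R : Literature.Computability.Complexity.Regs ι), R n = Literature.Computability.Complexity.ones N → R a = Literature.Computability.Complexity.ones A → R a2 = [] → R t = [] →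
    (∀ v ∈ vs, R v = Literature.Computability.Complexity.ones (val v)) →
    Runs (idxProg n a a2 t vs) R (Function.update R a (Literature.Computability.Complexity.ones (hornerVal N A (vs.map val))))
      (vs.length * (B * (10 * N + 12) + 4))
  | [], A, _, _, _, _, R, _, ha, _, _, _ => by
    show Runs skip R _ _
    refine (Runs.skip R).of_eq ?_ (by simp)
    rw [List.map_nil, hornerVal, List.foldl_nil, ← ha, Function.update_eq_self]
  | v :: vs, A, hvs, hA, hval, hF, R, hn, ha, ha2, ht, hR => by
    obtain ⟨hva, hva2, hvt⟩ := hvs v (by simp)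
    have hc : val v ≤ B := hval v (by simp)
    have hA' : A * N + val v ≤ B := by
      rcases Nat.eq_zero_or_pos N with rfl | hN
      · simpa using hc
      · refine le_trans (le_hornerVal hN (vs.map val) _) ?_
        simpa [hornerVal] using hF
    have h1 := runs_idxStep hna hna2 hnt haa2 hat ha2t hva hva2 hvt N A (val v) R hn ha ha2 ht (hR v (by simp))
    have h2 := runs_idxProg hna hna2 hnt haa2 hat ha2t N B val vs (A * N + val v)
      (fun w hw => hvs w (by simp [hw])) hA' (fun w hw => hval w (by simp [hw]))
      (by simpa [hornerVal] using hF)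
      (Function.update R a (Literature.Computability.Complexity.ones (A * N + val v))) (by rw [Function.update_of_ne hna, hn]) (by simp)
      (by rw [Function.update_of_ne haa2.symm, ha2]) (by rw [Function.update_of_ne hat.symm, ht])
      (fun w hw => by rw [Function.update_of_ne (hvs w (by simp [hw])).1, hR w (by simp [hw])])
    rw [Function.update_idem] at h2
    refine (h1.seq h2).of_eq (by simp [hornerVal]) ?_
    have : A * (7 * N + 4) + 1 + (3 * (A * N) + 1) + (7 * val v + 2) ≤ B * (10 * N + 12) + 4 := by nlinarith
    simp only [List.length_cons]
    nlinarith

/-- Little-endian value of a digit list in base `N`. [folklore] -/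
def leVal (N : ℕ) : List ℕ → ℕ
  | [] => 0
  | d :: ds => d + N * leVal N ds

/-- The little-endian value of a concatenation of digit lists. [folklore] -/
theorem leVal_append (N : ℕ) : ∀ (ds es : List ℕ), leVal N (ds ++ es) = leVal N ds + N ^ ds.length * leVal N es
  | [], es => by simp [leVal]
  | d :: ds, es => by rw [List.cons_append, leVal, leVal_append N ds es, leVal, List.length_cons, pow_succ]; ring

/-- The Horner value of digits highest first is the little-endian value of the reversed digits. [folklore] -/
theorem hornerVal_eq_leVal (N : ℕ) : ∀ (ds : List ℕ) (A : ℕ),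
    hornerVal N A ds = A * N ^ ds.length + leVal N ds.reverse
  | [], A => by simp [hornerVal, leVal]
  | d :: ds, A => by
    rw [hornerVal, List.foldl_cons, ← hornerVal, hornerVal_eq_leVal N ds, List.reverse_cons, leVal_append,
      List.length_cons, List.length_reverse, pow_succ]
    simp [leVal]
    ring

/-! ### Powers of `N` in unary -/

/-- `powProg n a a2 t k`: `a := 1^{|a| · N^k}` (so from `a = [true]`: `N ^ k`). [folklore] -/
def powProg (n a a2 t : ι) : ℕ → Literature.Computability.Complexity.Com ι
  | 0 => skip
  | k + 1 => (mulReg n a a2 t ;; pour a2 a) ;; powProg n a a2 t k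

/-- Specification of `powProg`: `a := 1^{A · N^k}` by `k` multiplications by `N = |n|`, with cost bounded through any `B ≥ A · N^k`. [folklore] -/
theorem runs_powProg {n a a2 t : ι} (hna : n ≠ a) (hna2 : n ≠ a2) (hnt : n ≠ t) (haa2 : a ≠ a2)
    (hat : a ≠ t) (ha2t : a2 ≠ t) (N B : ℕ) : ∀ (k A : ℕ) (R : Literature.Computability.Complexity.Regs ι), A ≤ B → A * N ^ k ≤ B →
    R n = Literature.Computability.Complexity.ones N → R a = Literature.Computability.Complexity.ones A → R a2 = [] → R t = [] →
    Runs (powProg n a a2 t k) R (Function.update R a (Literature.Computability.Complexity.ones (A * N ^ k))) (k * (B * (10 * N + 4) + 2))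
  | 0, A, R, _, _, _, ha, _, _ => by
    show Runs skip R _ _
    refine (Runs.skip R).of_eq ?_ (by simp)
    rw [pow_zero, mul_one, ← ha, Function.update_eq_self]
  | k + 1, A, R, hAB, hAk, hn, ha, ha2, ht => by
    have h1 := runs_mulReg hna hna2 hnt haa2 hat ha2t N A R hn ha ht
    rw [ha2, List.append_nil] at h1
    set R₁ := Function.update (Function.update R a []) a2 (Literature.Computability.Complexity.ones (A * N)) with hR₁
    have h2 := runs_pour haa2.symm R₁
    have hR₁a2 : R₁ a2 = Literature.Computability.Complexity.ones (A * N) := by simp [hR₁]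
    have hR₁a : R₁ a = [] := by simp [hR₁, Function.update_of_ne haa2]
    rw [hR₁a2, hR₁a, List.append_nil, List.reverse_replicate, List.length_replicate] at h2
    set R₂ := Function.update (Function.update R₁ a2 []) a (Literature.Computability.Complexity.ones (A * N)) with hR₂
    have hpow : A * N * N ^ k = A * N ^ (k + 1) := by rw [pow_succ]; ring
    have hAN : A * N ≤ B := by
      rcases Nat.eq_zero_or_pos N with rfl | hN
      · simp
      · calc A * N ≤ A * N ^ (k + 1) := Nat.mul_le_mul_left A (by
              calc N = N ^ 1 := (pow_one N).symm
                _ ≤ N ^ (k + 1) := Nat.pow_le_pow_right hN (by omega))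
          _ ≤ B := hAk
    have h3 := runs_powProg hna hna2 hnt haa2 hat ha2t N B k (A * N) R₂ hAN (by rw [hpow]; exact hAk)
      (by simp [hR₂, hna, hR₁, hna2, hn]) (by simp [hR₂])
      (by simp [hR₂, Ne.symm haa2, hR₁]) (by simp [hR₂, Ne.symm hat, hR₁, Ne.symm ha2t, ht])
    rw [hpow] at h3
    refine ((h1.seq h2).seq h3).of_eq ?_ ?_
    · ext i : 1
      simp only [hR₂, hR₁, Function.update_apply]
      split_ifs <;> simp_all
    · have : A * (7 * N + 4) + 1 + (3 * (A * N) + 1) ≤ B * (10 * N + 4) + 2 := by nlinarith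
      have e : (k + 1) * (B * (10 * N + 4) + 2) = k * (B * (10 * N + 4) + 2) + (B * (10 * N + 4) + 2) := by ring
      omega


/-! ### Unary copies of lengths -/

/-- `mkOnes src dst c t u`: `dst := 1^{|src|} ++ dst`, `src` kept (scratch `c t u` empty). [folklore] -/
def mkOnes (src dst c t u : ι) : Literature.Computability.Complexity.Com ι := copy src c t u ;; loop c (push dst true) (push dst true)

/-- The loop pushing one `true` on `dst` per symbol of `c` (consumed): `dst := 1^{|c|} ++ dst`. [folklore] -/
theorem runs_pushLoop {c dst : ι} (hcd : c ≠ dst) : ∀ (w : List Bool) (R : Literature.Computability.Complexity.Regs ι), R c = w →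
    Runs (loop c (push dst true) (push dst true)) R
      (Function.update (Function.update R c []) dst (Literature.Computability.Complexity.ones w.length ++ R dst)) (w.length * 3 + 1)
  | [], R, hc => by
    refine (Runs.loop_nil _ _ hc).of_eq ?_ (by simp)
    have e : Function.update R c [] = R := Function.update_eq_self_iff.mpr hc.symm
    rw [List.length_nil, show Literature.Computability.Complexity.ones 0 = [] from rfl, List.nil_append, e]
    exact (Function.update_eq_self_iff.mpr rfl).symm
  | b :: w, R, hc => by
    have hbody : Runs (push dst true) (Function.update R c w)
        (Function.update (Function.update R c w) dst (true :: R dst)) 1 :=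
      Runs.push' (by rw [Function.update_of_ne hcd.symm])
    have ih := runs_pushLoop hcd w (Function.update (Function.update R c w) dst (true :: R dst))
      (by rw [Function.update_of_ne hcd, Function.update_self])
    rw [show (b :: w).length * 3 + 1 = 1 + 2 + (w.length * 3 + 1) by simp; ring]
    have hfin : Function.update (Function.update (Function.update (Function.update R c w) dst (true :: R dst)) c []) dst
        (Literature.Computability.Complexity.ones w.length ++ Function.update (Function.update R c w) dst (true :: R dst) dst) =
        Function.update (Function.update R c []) dst (Literature.Computability.Complexity.ones (b :: w).length ++ R dst) := by
      ext r : 1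
      simp only [Function.update_apply]
      split_ifs with h1 h2
      · subst h1; rw [List.length_cons, ← ones_append]; simp [Literature.Computability.Complexity.ones]
      · rfl
      · rfl
    cases b
    · exact Runs.loop_false hc hbody (ih.of_eq hfin le_rfl)
    · exact Runs.loop_true hc hbody (ih.of_eq hfin le_rfl)

/-- Specification of `mkOnes`: `dst := 1^{|src|} ++ dst`, `src` kept, cost `13|src| + 4`. [folklore] -/
theorem runs_mkOnes {src dst c t u : ι} (h : [src, dst, c, t, u].Nodup) (R : Literature.Computability.Complexity.Regs ι) (hc : R c = []) (ht : R t = [])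
    (hu : R u = []) :
    Runs (mkOnes src dst c t u) R (Function.update R dst (Literature.Computability.Complexity.ones (R src).length ++ R dst)) (13 * (R src).length + 4) := by
  simp only [List.nodup_cons, List.mem_cons, not_or, List.not_mem_nil, not_false_eq_true, and_true, List.nodup_nil] at h
  obtain ⟨⟨hsd, hsc, hst, hsu⟩, ⟨hdc, hdt, hdu⟩, ⟨hct, hcu⟩, htu⟩ := h
  have c1 := runs_copy hsc hst hsu hct hcu htu R ht hu
  rw [hc, List.append_nil] at c1
  have c2 := runs_pushLoop (Ne.symm hdc) (R src) (Function.update R c (R src)) (by rw [Function.update_self])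
  rw [Function.update_idem, Function.update_of_ne hdc] at c2
  refine (c1.seq c2).of_eq ?_ (by omega)
  have e : Function.update R c [] = R := Function.update_eq_self_iff.mpr hc.symm
  rw [e]

/-! ### Capped binary-to-unary conversion (most significant bit first) -/

/-- The capped Horner recursion on values. [folklore] -/
def cappedVal (cap : ℕ) : ℕ → List Bool → ℕ
  | a, [] => a
  | a, b :: w => cappedVal cap (min cap (2 * a + b.toNat)) w

/-- The (uncapped) most-significant-bit-first value. [folklore] -/
def msbVal : ℕ → List Bool → ℕ
  | a, [] => a
  | a, b :: w => msbVal (2 * a + b.toNat) w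

/-- The most-significant-bit-first value is at least the accumulator. [folklore] -/
theorem le_msbVal : ∀ (a : ℕ) (w : List Bool), a ≤ msbVal a w
  | a, [] => le_rfl
  | a, b :: w => le_trans (by omega) (le_msbVal (2 * a + b.toNat) w)

/-- The most-significant-bit-first value is monotone in the accumulator. [folklore] -/
theorem msbVal_mono : ∀ {a a' : ℕ} (w : List Bool), a ≤ a' → msbVal a w ≤ msbVal a' w
  | _, _, [], h => h
  | a, a', b :: w, h => msbVal_mono w (by omega)

/-- Capping at every Horner step is capping at the end: `cappedVal cap a w = min cap (msbVal a w)` for `a ≤ cap`. [folklore] -/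
theorem cappedVal_eq : ∀ (cap a : ℕ) (w : List Bool), a ≤ cap → cappedVal cap a w = min cap (msbVal a w)
  | cap, a, [], h => by simp [cappedVal, msbVal, Nat.min_eq_right h]
  | cap, a, b :: w, h => by
    rw [cappedVal, msbVal, cappedVal_eq cap _ w (Nat.min_le_left _ _)]
    by_cases hle : 2 * a + b.toNat ≤ cap
    · rw [Nat.min_eq_right hle]
    · have hgt : cap ≤ 2 * a + b.toNat := le_of_lt (not_le.mp hle)
      rw [Nat.min_eq_left hgt, Nat.min_eq_left (le_msbVal cap w),
        Nat.min_eq_left (le_trans hgt (le_msbVal _ w))]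

/-- `bitsToNat` is the most-significant-bit-first value of the reversed string. [folklore] -/
theorem msbVal_reverse (w : List Bool) : ∀ a, msbVal a w.reverse = a * 2 ^ w.length + Literature.Computability.Complexity.bitsToNat w := by
  induction w with
  | nil => intro a; simp [msbVal]
  | cons b w ih =>
    intro a
    rw [List.reverse_cons, show msbVal a (w.reverse ++ [b]) = 2 * msbVal a w.reverse + b.toNat from ?_, ih,
      Literature.Computability.Complexity.bitsToNat_cons, List.length_cons, pow_succ]
    · ring
    · generalize w.reverse = v
      induction v generalizing a with
      | nil => simp [msbVal]
      | cons x v ih2 => simp only [List.cons_append, msbVal]; exact ih2 _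

/-- The body of the capped Horner loop for bit `b`. [folklore] -/
def capBody (ACC ACC2 TMP CAP t u : ι) (b : Bool) : Literature.Computability.Complexity.Com ι :=
  dblReg ACC t ;; (bif b then push ACC true else skip) ;; copy CAP TMP t u ;; takeN TMP ACC ACC2 ;; clear ACC ;; pour ACC2 ACC

/-- `capHorner`: `ACC := 1^{cappedVal cap |ACC| A}` reading the bits of `A` (most significant first). [folklore] -/
def capHorner (A ACC ACC2 TMP CAP t u : ι) : Literature.Computability.Complexity.Com ι :=
  loop A (capBody ACC ACC2 TMP CAP t u true) (capBody ACC ACC2 TMP CAP t u false)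

/-- Specification of `capBody b`: `ACC := 1^{min cap (2·|ACC| + b)}` (double, add the bit, truncate to the cap), cost `≤ 44·cap + 25`. [folklore] -/
theorem runs_capBody {ACC ACC2 TMP CAP t u : ι} (h : [ACC, ACC2, TMP, CAP, t, u].Nodup) (b : Bool) (cap a : ℕ)
    (ha : a ≤ cap) (R : Literature.Computability.Complexity.Regs ι) (hACC : R ACC = Literature.Computability.Complexity.ones a) (hCAP : R CAP = Literature.Computability.Complexity.ones cap) (h2 : R ACC2 = []) (hT : R TMP = [])
    (ht : R t = []) (hu : R u = []) :
    Runs (capBody ACC ACC2 TMP CAP t u b) R (Function.update R ACC (Literature.Computability.Complexity.ones (min cap (2 * a + b.toNat)))) (44 * cap + 25) := by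
  simp only [List.nodup_cons, List.mem_cons, not_or, List.not_mem_nil, not_false_eq_true, and_true, List.nodup_nil] at h
  obtain ⟨⟨h12, h1T, h1C, h1t, h1u⟩, ⟨h2T, h2C, h2t, h2u⟩, ⟨hTC, hTt, hTu⟩, ⟨hCt, hCu⟩, htu⟩ := h
  -- double
  have c1 := runs_dblReg h1t R ht
  rw [hACC, List.length_replicate] at c1
  set R₁ := Function.update R ACC (Literature.Computability.Complexity.ones (2 * a)) with hR₁
  -- add the bit
  have c2 : Runs (bif b then push ACC true else skip) R₁ (Function.update R ACC (Literature.Computability.Complexity.ones (2 * a + b.toNat))) 1 := by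
    cases b
    · refine (Runs.skip R₁).of_eq (by simp [hR₁]) (by omega)
    · refine (Runs.push' ?_).of_eq rfl le_rfl
      rw [hR₁, Function.update_self, Function.update_idem]; rfl
  set x := 2 * a + b.toNat with hx
  set R₂ := Function.update R ACC (Literature.Computability.Complexity.ones x) with hR₂
  -- copy the cap
  have c3 := runs_copy (Ne.symm hTC) hCt hCu hTt hTu htu R₂ (by simp [hR₂, Ne.symm h1t, ht]) (by simp [hR₂, Ne.symm h1u, hu])
  rw [show R₂ CAP = Literature.Computability.Complexity.ones cap by simp [hR₂, Ne.symm h1C, hCAP], show R₂ TMP = [] by simp [hR₂, Ne.symm h1T, hT], List.append_nil] at c3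
  set R₃ := Function.update R₂ TMP (Literature.Computability.Complexity.ones cap) with hR₃
  -- take min
  have c4 := runs_takeN (Ne.symm h1T) (Ne.symm h2T) h12 (Literature.Computability.Complexity.ones cap) R₃ (by simp [hR₃])
  rw [show R₃ ACC = Literature.Computability.Complexity.ones x by simp [hR₃, h1T, hR₂], show R₃ ACC2 = [] by simp [hR₃, h2T, hR₂, Ne.symm h12, h2],
    List.append_nil, List.length_replicate] at c4
  simp only [Literature.Computability.Complexity.ones, List.take_replicate, List.reverse_replicate, List.drop_replicate] at c4
  set R₄ := Function.update (Function.update (Function.update R₃ TMP []) ACC (List.replicate (x - cap) true)) ACC2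
    (List.replicate (min cap x) true) with hR₄
  -- clear the rest and pour back
  have c5 := runs_clear ACC R₄
  rw [show R₄ ACC = List.replicate (x - cap) true by simp [hR₄, h12], List.length_replicate] at c5
  set R₅ := Function.update R₄ ACC [] with hR₅
  have c6 := runs_pour (Ne.symm h12) R₅
  rw [show R₅ ACC2 = List.replicate (min cap x) true by simp [hR₅, Ne.symm h12, hR₄], show R₅ ACC = [] by simp [hR₅],
    List.append_nil, List.reverse_replicate, List.length_replicate] at c6
  have hb : b.toNat ≤ 1 := Bool.toNat_le b
  have hmin : min cap x ≤ cap := Nat.min_le_left _ _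
  have hxle : x ≤ 2 * cap + 1 := by omega
  simp only [Literature.Computability.Complexity.ones, List.length_replicate] at c1 c3 c4 c5 c6
  refine (c1.seq (c2.seq (c3.seq (c4.seq (c5.seq c6))))).of_eq ?_ (by omega)
  ext r : 1
  simp only [hR₅, hR₄, hR₃, hR₂, Function.update_apply, Literature.Computability.Complexity.ones]
  split_ifs <;> simp_all

/-- Specification of `capHorner`: reading the bits of `A` most significant first, `ACC := 1^{cappedVal cap |ACC| A}`; cost linear in `|A| · cap`. [folklore] -/
theorem runs_capHorner {A ACC ACC2 TMP CAP t u : ι} (h : [A, ACC, ACC2, TMP, CAP, t, u].Nodup) (cap : ℕ) :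
    ∀ (w : List Bool) (a : ℕ) (R : Literature.Computability.Complexity.Regs ι), a ≤ cap → R A = w → R ACC = Literature.Computability.Complexity.ones a → R CAP = Literature.Computability.Complexity.ones cap → R ACC2 = [] →
    R TMP = [] → R t = [] → R u = [] →
    Runs (capHorner A ACC ACC2 TMP CAP t u) R (Function.update (Function.update R A []) ACC (Literature.Computability.Complexity.ones (cappedVal cap a w)))
      (w.length * (44 * cap + 27) + 1)
  | [], a, R, _, hA, hACC, _, _, _, _, _ => by
    refine (Runs.loop_nil _ _ hA).of_eq ?_ (by simp)
    have e1 : Function.update R A [] = R := Function.update_eq_self_iff.mpr hA.symm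
    rw [cappedVal, e1]
    exact (Function.update_eq_self_iff.mpr hACC.symm).symm
  | b :: w, a, R, ha, hA, hACC, hCAP, h2, hT, ht, hu => by
    have h' := h
    simp only [List.nodup_cons, List.mem_cons, not_or, List.not_mem_nil, not_false_eq_true, and_true, List.nodup_nil] at h'
    obtain ⟨⟨hA1, hA2, hAT, hAC, hAt, hAu⟩, ⟨h12, h1T, h1C, h1t, h1u⟩, -⟩ := h'
    set S := Function.update R A w with hS
    have hSr : ∀ r, r ≠ A → S r = R r := fun r hr => by rw [hS, Function.update_of_ne hr]
    have hbody := runs_capBody (List.nodup_cons.mp h).2 b cap a ha S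
      (by rw [hSr _ (Ne.symm hA1), hACC]) (by rw [hSr _ (Ne.symm hAC), hCAP]) (by rw [hSr _ (Ne.symm hA2), h2])
      (by rw [hSr _ (Ne.symm hAT), hT]) (by rw [hSr _ (Ne.symm hAt), ht]) (by rw [hSr _ (Ne.symm hAu), hu])
    set S₁ := Function.update S ACC (Literature.Computability.Complexity.ones (min cap (2 * a + b.toNat))) with hS₁
    have hS₁r : ∀ r, r ≠ ACC → S₁ r = S r := fun r hr => by rw [hS₁, Function.update_of_ne hr]
    have ih := runs_capHorner h cap w (min cap (2 * a + b.toNat)) S₁ (Nat.min_le_left _ _)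
      (by rw [hS₁r _ hA1, hS, Function.update_self]) (by rw [hS₁, Function.update_self])
      (by rw [hS₁r _ (Ne.symm h1C), hSr _ (Ne.symm hAC), hCAP]) (by rw [hS₁r _ (Ne.symm h12), hSr _ (Ne.symm hA2), h2])
      (by rw [hS₁r _ (Ne.symm h1T), hSr _ (Ne.symm hAT), hT]) (by rw [hS₁r _ (Ne.symm h1t), hSr _ (Ne.symm hAt), ht])
      (by rw [hS₁r _ (Ne.symm h1u), hSr _ (Ne.symm hAu), hu])
    have hfin : Function.update (Function.update S₁ A []) ACC (Literature.Computability.Complexity.ones (cappedVal cap (min cap (2 * a + b.toNat)) w)) =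
        Function.update (Function.update R A []) ACC (Literature.Computability.Complexity.ones (cappedVal cap a (b :: w))) := by
      rw [cappedVal, hS₁, hS]
      ext r : 1
      simp only [Function.update_apply]
      split_ifs <;> rfl
    rw [hfin] at ih
    rw [show (b :: w).length * (44 * cap + 27) + 1 = (44 * cap + 25) + 2 + (w.length * (44 * cap + 27) + 1) by simp; ring]
    cases b
    · exact Runs.loop_false hA hbody ih
    · exact Runs.loop_true hA hbody ih

/-! ### Emitting the Boolean answer -/

/-- `outProg F res`: `res := [b]` for the flag `b` in `F` (consumed). [folklore] -/
def outProg (F res : ι) : Literature.Computability.Complexity.Com ι := pop F (push res true) (push res true) (push res false)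

/-- Specification of `outProg`: `res := [b]` for the flag `b` held in `F`. [folklore] -/
theorem runs_outProg {F res : ι} (hFr : F ≠ res) (b : Bool) (R : Literature.Computability.Complexity.Regs ι) (hF : R F = Literature.Computability.Complexity.flag b) (hres : R res = []) :
    Runs (outProg F res) R (Function.update (Function.update R F []) res [b]) 3 := by
  unfold outProg
  cases b
  · rw [Literature.Computability.Complexity.flag_false] at hF
    refine (Runs.pop_nil _ _ hF (Runs.push' ?_)).mono (by omega)
    have e : Function.update R F [] = R := Function.update_eq_self_iff.mpr hF.symm
    rw [e, hres]
  · rw [Literature.Computability.Complexity.flag_true] at hF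
    refine (Runs.pop_true _ _ hF (Runs.push' ?_)).mono (by omega)
    rw [Function.update_of_ne hFr.symm, hres]


/-! ### The number of table bits in unary -/

/-- `Σ N ^ a` over a list of arities. [folklore] -/
def arSum (N : ℕ) : List ℕ → ℕ
  | [] => 0
  | a :: as => N ^ a + arSum N as

/-- The cost of `tbitsProg`. [folklore] -/
def tbCost (N : ℕ) (as : List ℕ) : ℕ :=
  as.foldr (fun a acc => 1 + a * ((N ^ a + 1) * (10 * N + 4) + 2) + (3 * N ^ a + 1) + acc) 0

/-- `tbCost` on no arities. [folklore] -/
@[simp] theorem tbCost_nil (N : ℕ) : tbCost N [] = 0 := rfl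
/-- `tbCost` unfolded one arity. [folklore] -/
theorem tbCost_cons (N a : ℕ) (as : List ℕ) :
    tbCost N (a :: as) = 1 + a * ((N ^ a + 1) * (10 * N + 4) + 2) + (3 * N ^ a + 1) + tbCost N as := rfl

/-- `tbitsProg TB TMP t2 t3 n as`: `TB := 1^{Σ_{a ∈ as} N^a} ++ TB` (`n = 1ᴺ` kept; `TMP t2 t3` scratch). [folklore] -/
def tbitsProg (TB TMP t2 t3 n : ι) : List ℕ → Literature.Computability.Complexity.Com ι
  | [] => skip
  | a :: as => (push TMP true ;; powProg n TMP t2 t3 a ;; pour TMP TB) ;; tbitsProg TB TMP t2 t3 n as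

/-- Specification of `tbitsProg`: `TB := 1^{Σ_{a ∈ as} N^a} ++ TB` with cost `tbCost N as`. [folklore] -/
theorem runs_tbitsProg {TB TMP t2 t3 n : ι} (h : [TB, TMP, t2, t3, n].Nodup) (N : ℕ) :
    ∀ (as : List ℕ) (tb : ℕ) (R : Literature.Computability.Complexity.Regs ι), R n = Literature.Computability.Complexity.ones N → R TB = Literature.Computability.Complexity.ones tb → R TMP = [] → R t2 = [] → R t3 = [] →
    Runs (tbitsProg TB TMP t2 t3 n as) R (Function.update R TB (Literature.Computability.Complexity.ones (arSum N as + tb))) (tbCost N as)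
  | [], tb, R, _, hTB, _, _, _ => by
    refine (Runs.skip R).of_eq ?_ (by simp)
    rw [arSum, Nat.zero_add, ← hTB, Function.update_eq_self]
  | a :: as, tb, R, hn, hTB, hTMP, h2, h3 => by
    have h' := h
    simp only [List.nodup_cons, List.mem_cons, not_or, List.not_mem_nil, not_false_eq_true, and_true, List.nodup_nil] at h'
    obtain ⟨⟨hBT, hB2, hB3, hBn⟩, ⟨hT2, hT3, hTn⟩, ⟨h23, h2n⟩, h3n⟩ := h'
    -- TMP := 1
    have c1 : Runs (push TMP true) R (Function.update R TMP (Literature.Computability.Complexity.ones 1)) 1 := Runs.push' (by rw [hTMP]; rfl)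
    set R₁ := Function.update R TMP (Literature.Computability.Complexity.ones 1) with hR₁
    have c2 := runs_powProg (n := n) (a := TMP) (a2 := t2) (t := t3) (Ne.symm hTn) (Ne.symm h2n) (Ne.symm h3n) hT2 hT3 h23
      N (N ^ a + 1) a 1 R₁ (by omega) (by omega) (by rw [hR₁, Function.update_of_ne (Ne.symm hTn), hn])
      (by rw [hR₁, Function.update_self]) (by rw [hR₁, Function.update_of_ne (Ne.symm hT2), h2])
      (by rw [hR₁, Function.update_of_ne (Ne.symm hT3), h3])
    rw [one_mul] at c2
    set R₂ := Function.update R₁ TMP (Literature.Computability.Complexity.ones (N ^ a)) with hR₂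
    have hR₂' : R₂ = Function.update R TMP (Literature.Computability.Complexity.ones (N ^ a)) := by rw [hR₂, hR₁, Function.update_idem]
    have c3 := runs_pour (Ne.symm hBT) R₂
    rw [show R₂ TMP = Literature.Computability.Complexity.ones (N ^ a) by rw [hR₂, Function.update_self],
      show R₂ TB = Literature.Computability.Complexity.ones tb by rw [hR₂', Function.update_of_ne hBT, hTB],
      List.reverse_replicate, ones_append, List.length_replicate] at c3
    set R₃ := Function.update (Function.update R₂ TMP []) TB (Literature.Computability.Complexity.ones (N ^ a + tb)) with hR₃
    have eT : Function.update R TMP [] = R := Function.update_eq_self_iff.mpr hTMP.symm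
    have hR₃' : R₃ = Function.update R TB (Literature.Computability.Complexity.ones (N ^ a + tb)) := by
      rw [hR₃, hR₂', Function.update_idem, eT]
    have ih := runs_tbitsProg h N as (N ^ a + tb) R₃ (by rw [hR₃', Function.update_of_ne (Ne.symm hBn), hn])
      (by rw [hR₃', Function.update_self]) (by rw [hR₃', Function.update_of_ne (Ne.symm hBT), hTMP])
      (by rw [hR₃', Function.update_of_ne (Ne.symm hB2), h2]) (by rw [hR₃', Function.update_of_ne (Ne.symm hB3), h3])
    have hfin : Function.update R₃ TB (Literature.Computability.Complexity.ones (arSum N as + (N ^ a + tb))) =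
        Function.update R TB (Literature.Computability.Complexity.ones (arSum N (a :: as) + tb)) := by
      rw [hR₃', Function.update_idem, arSum, show arSum N as + (N ^ a + tb) = N ^ a + arSum N as + tb by ring]
    rw [hfin] at ih
    rw [tbCost_cons]
    exact ((c1.seq (c2.seq c3)).seq ih).of_eq rfl (by omega)

end Generic

/-! ## The evaluator of a fixed sentence of FO(IFP) with order -/


open Literature.Computability.Cryptography Literature.Computability.Complexity.Com

/-- Registers of the evaluator: input, result, the unary size `nn = 1ᴺ`, a junk register, scratch
`s i`, the input tables `tbl i`, for every variable LEVEL `j` its unary value `xv j` and loop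
counter `lp j`, for every fixed-point LEVEL `m` the table `rvr m` of the relation variable, its
working copy `rvc m`, the builder `rvb m` of the next stage and the stage counter `rvo m`, and
work flags `wk d i` for every node depth `d`. [folklore] -/
inductive ER (A V W P : ℕ) : Type
  | inp | res | nn | junk
  | s (i : Fin 8)
  | tbl (i : Fin A)
  | xv (j : Fin V)
  | lp (j : Fin V)
  | rvr (m : Fin W)
  | rvc (m : Fin W)
  | rvb (m : Fin W)
  | rvo (m : Fin W)
  | wk (d : Fin P) (i : Fin 3)
  deriving DecidableEq, Fintype

variable {A V W P : ℕ}

namespace ER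

/-- Variable register of level `j` (junk out of range). [folklore] -/
def xv' (j : ℕ) : ER A V W P := if h : j < V then xv ⟨j, h⟩ else junk
/-- Loop register of level `j`. [folklore] -/
def lp' (j : ℕ) : ER A V W P := if h : j < V then lp ⟨j, h⟩ else junk
/-- Relation-variable table of level `m`. [folklore] -/
def rvr' (m : ℕ) : ER A V W P := if h : m < W then rvr ⟨m, h⟩ else junk
/-- Its working copy. [folklore] -/
def rvc' (m : ℕ) : ER A V W P := if h : m < W then rvc ⟨m, h⟩ else junk
/-- Its builder. [folklore] -/
def rvb' (m : ℕ) : ER A V W P := if h : m < W then rvb ⟨m, h⟩ else junk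
/-- Its stage counter. [folklore] -/
def rvo' (m : ℕ) : ER A V W P := if h : m < W then rvo ⟨m, h⟩ else junk
/-- Work flag `i` of depth `d`. [folklore] -/
def wk' (d : ℕ) (i : Fin 3) : ER A V W P := if h : d < P then wk ⟨d, h⟩ i else junk
/-- Input table `i`. [folklore] -/
def tbl' (i : ℕ) : ER A V W P := if h : i < A then tbl ⟨i, h⟩ else junk

end ER

open ER

variable {ar : List ℕ}

/-- The digit registers of a tuple of variables, HIGHEST digit first. [folklore] -/
def digitRegs {a n : ℕ} (v : Fin a → Fin n) : List (ER A V W P) :=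
  (List.ofFn fun l : Fin a => xv' (A := A) (V := V) (W := W) (P := P) (v l)).reverse

/-- Consume the child's flag into the parent's: `dst := child` (child emptied). [folklore] -/
def takeFlag (child dst : ER A V W P) : Literature.Computability.Complexity.Com (ER A V W P) := pop child (push dst true) skip skip

/-- Nested enumeration of all values of the variable levels `js` (outermost first), running `body`
innermost. [folklore] -/
def enumLoops (body : Literature.Computability.Complexity.Com (ER A V W P)) : List ℕ → Literature.Computability.Complexity.Com (ER A V W P)
  | [] => body
  | j :: js => copy nn (lp' j) (s 0) (s 1) ;;
      loop (lp' j) (enumLoops body js ;; push (xv' j) true) (enumLoops body js ;; push (xv' j) true) ;;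
      clear (xv' j)

/-- **The compiled evaluator** of a formula at node depth `dp`: leaves the truth value as a flag in
`wk dp 0`. [folklore] -/
def cmp : {rv : List ℕ} → {n : ℕ} → Formula (2 :: ar) rv n → ℕ → Literature.Computability.Complexity.Com (ER A V W P)
  | _, _, .rel ⟨0, _⟩ v, dp =>
      ltTest (xv' (v (⟨0, by decide⟩ : Fin 2))) (xv' (v (⟨1, by decide⟩ : Fin 2))) (s 0) (s 1) (wk' dp 0) (s 2) (s 3)
  | _, _, .rel ⟨i + 1, _⟩ v, dp =>
      idxProg nn (s 4) (s 5) (s 6) (digitRegs v) ;;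
        lookupBit (tbl' i) (s 4) (wk' dp 0) (s 0) (s 1) (s 2) (s 3) ;; clear (s 4)
  | rv, _, .rvar j v, dp =>
      idxProg nn (s 4) (s 5) (s 6) (digitRegs v) ;;
        lookupBit (rvr' (rv.length - 1 - j)) (s 4) (wk' dp 0) (s 0) (s 1) (s 2) (s 3) ;; clear (s 4)
  | _, _, .eq a b, dp =>
      copy (xv' a) (s 0) (s 2) (s 3) ;; copy (xv' b) (s 1) (s 2) (s 3) ;; eqCheck (s 0) (s 1) (wk' dp 0)
  | _, _, .not φ, dp => cmp φ (dp + 1) ;; pop (wk' (dp + 1) 0) skip skip (push (wk' dp 0) true)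
  | _, _, .and φ ψ, dp =>
      cmp φ (dp + 1) ;;
        pop (wk' (dp + 1) 0) (cmp ψ (dp + 1) ;; takeFlag (wk' (dp + 1) 0) (wk' dp 0)) skip skip
  | _, _, .or φ ψ, dp =>
      cmp φ (dp + 1) ;;
        pop (wk' (dp + 1) 0) (push (wk' dp 0) true) skip (cmp ψ (dp + 1) ;; takeFlag (wk' (dp + 1) 0) (wk' dp 0))
  | _, n, .ex φ, dp =>
      copy nn (lp' n) (s 0) (s 1) ;;
        loop (lp' n)
          (cmp φ (dp + 1) ;; pop (wk' (dp + 1) 0) (clear (wk' dp 0) ;; push (wk' dp 0) true) skip skip ;; push (xv' n) true)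
          (cmp φ (dp + 1) ;; pop (wk' (dp + 1) 0) (clear (wk' dp 0) ;; push (wk' dp 0) true) skip skip ;; push (xv' n) true) ;;
        clear (xv' n)
  | _, n, .all φ, dp =>
      -- literally the program of `¬ ∃ ¬ φ` (depths `dp + 1`, `dp + 2`, `dp + 3`)
      (copy nn (lp' n) (s 0) (s 1) ;;
        loop (lp' n)
          ((cmp φ (dp + 3) ;; pop (wk' (dp + 3) 0) skip skip (push (wk' (dp + 2) 0) true)) ;;
            pop (wk' (dp + 2) 0) (clear (wk' (dp + 1) 0) ;; push (wk' (dp + 1) 0) true) skip skip ;; push (xv' n) true)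
          ((cmp φ (dp + 3) ;; pop (wk' (dp + 3) 0) skip skip (push (wk' (dp + 2) 0) true)) ;;
            pop (wk' (dp + 2) 0) (clear (wk' (dp + 1) 0) ;; push (wk' (dp + 1) 0) true) skip skip ;; push (xv' n) true) ;;
        clear (xv' n)) ;;
      pop (wk' (dp + 1) 0) skip skip (push (wk' dp 0) true)
  | rv, n, .fp k φ t, dp =>
      let m := rv.length
      -- rvo m := 1^{N^k}; rvr m := 0^{N^k}
      push (rvo' m) true ;; powProg nn (rvo' m) (s 0) (s 1) k ;;
      copy (rvo' m) (s 0) (s 1) (s 2) ;; loop (s 0) (push (rvr' m) false) (push (rvr' m) false) ;;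
      -- the stages
      loop (rvo' m)
        (copy (rvr' m) (rvc' m) (s 0) (s 1) ;;
          enumLoops
            (pop (rvc' m) (push (wk' dp 1) true) skip skip ;; cmp φ (dp + 1) ;;
              pop (wk' dp 1) (pop (wk' (dp + 1) 0) (push (rvb' m) true) skip (push (rvb' m) true)) skip
                (pop (wk' (dp + 1) 0) (push (rvb' m) true) skip (push (rvb' m) false)))
            ((List.range k).map (fun l => n + l)).reverse ;;
          clear (rvr' m) ;; pour (rvb' m) (rvr' m))
        (copy (rvr' m) (rvc' m) (s 0) (s 1) ;;
          enumLoops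
            (pop (rvc' m) (push (wk' dp 1) true) skip skip ;; cmp φ (dp + 1) ;;
              pop (wk' dp 1) (pop (wk' (dp + 1) 0) (push (rvb' m) true) skip (push (rvb' m) true)) skip
                (pop (wk' (dp + 1) 0) (push (rvb' m) true) skip (push (rvb' m) false)))
            ((List.range k).map (fun l => n + l)).reverse ;;
          clear (rvr' m) ;; pour (rvb' m) (rvr' m)) ;;
      -- read off the result and clean up
      (idxProg nn (s 4) (s 5) (s 6) (digitRegs t) ;;
        lookupBit (rvr' m) (s 4) (wk' dp 0) (s 0) (s 1) (s 2) (s 3) ;; clear (s 4)) ;; clear (rvr' m)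


/-! ### Semantic objects -/

section Semantics

variable {N : ℕ}

/-- A Boolean value of a proposition (classically). [folklore] -/
noncomputable def bv (p : Prop) : Bool := @decide p (Classical.dec p)

/-- `bv p = true ↔ p`. [folklore] -/
theorem bv_eq_true_iff (p : Prop) : bv p = true ↔ p := by
  unfold bv; exact @decide_eq_true_iff p (Classical.dec p)

/-- `bv` agrees with `decide` on decidable propositions. [folklore] -/
theorem bv_eq_decide (p : Prop) [Decidable p] : bv p = decide p := by
  unfold bv; congr

/-- The table of a `k`-ary relation on `Fin N` as a bit string of length `N ^ k`, little-endian
index (`finFunctionFinEquiv`). [folklore] -/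
noncomputable def tableOf {k : ℕ} (S : Set (Fin k → Fin N)) : List Bool :=
  List.ofFn fun i : Fin (N ^ k) => bv (finFunctionFinEquiv.symm i ∈ S)

/-- A `k`-ary table on `Fin N` has `N ^ k` bits. [folklore] -/
@[simp] theorem length_tableOf {k : ℕ} (S : Set (Fin k → Fin N)) : (tableOf S).length = N ^ k := by
  simp [tableOf]

/-- The bit of the table of `S` at the index of the tuple `v` is `[v ∈ S]`. [Gurevich 1984, §3 Proviso 3 (standard array representation)] [folklore] -/
theorem getElem?_tableOf {k : ℕ} (S : Set (Fin k → Fin N)) (v : Fin k → Fin N) :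
    (tableOf S)[(finFunctionFinEquiv v : ℕ)]? = some (bv (v ∈ S)) := by
  rw [tableOf, List.getElem?_ofFn, dif_pos (finFunctionFinEquiv v).2]
  simp only [Fin.eta, Equiv.symm_apply_apply]

/-- The table of the input symbol `i`. [folklore] -/
noncomputable def inTable (Rin : RelTables ar N) (i : Fin ar.length) : List Bool :=
  tableOf {v | Rin i v = true}

/-- The little-endian value of a digit function is `Σᵢ fᵢ Nⁱ`. [folklore] -/
theorem leVal_ofFn (N : ℕ) : ∀ {k : ℕ} (f : Fin k → ℕ), leVal N (List.ofFn f) = ∑ i : Fin k, f i * N ^ (i : ℕ)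
  | 0, f => by simp [leVal]
  | k + 1, f => by
    rw [List.ofFn_succ, leVal, leVal_ofFn N (fun i => f i.succ), Fin.sum_univ_succ]
    simp only [Fin.val_zero, pow_zero, mul_one, Fin.val_succ, pow_succ, Finset.mul_sum]
    congr 1
    apply Finset.sum_congr rfl
    intro i _
    ring

/-- Horner over the digits of a tuple, highest first, is the little-endian index of the tuple. [folklore] -/
theorem hornerVal_digits {k : ℕ} (v : Fin k → Fin N) :
    hornerVal N 0 ((List.ofFn fun l : Fin k => (v l : ℕ)).reverse) = (finFunctionFinEquiv v : ℕ) := by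
  rw [hornerVal_eq_leVal, List.reverse_reverse, leVal_ofFn, finFunctionFinEquiv_apply]
  simp

end Semantics

/-! ### Resource measures of formulas -/

section Measures

variable {L : List ℕ}

/-- Nesting depth of a formula (work-flag depth needed). [folklore] -/
def fdepth : {rv : List ℕ} → {n : ℕ} → Formula L rv n → ℕ
  | _, _, .rel _ _ => 0
  | _, _, .rvar _ _ => 0
  | _, _, .eq _ _ => 0
  | _, _, .not φ => fdepth φ + 1
  | _, _, .and φ ψ => max (fdepth φ) (fdepth ψ) + 1
  | _, _, .or φ ψ => max (fdepth φ) (fdepth ψ) + 1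
  | _, _, .ex φ => fdepth φ + 1
  | _, _, .all φ => fdepth φ + 3
  | _, _, .fp _ φ _ => fdepth φ + 1

/-- Number of element-variable levels used above the context. [folklore] -/
def fvars : {rv : List ℕ} → {n : ℕ} → Formula L rv n → ℕ
  | _, _, .rel _ _ => 0
  | _, _, .rvar _ _ => 0
  | _, _, .eq _ _ => 0
  | _, _, .not φ => fvars φ
  | _, _, .and φ ψ => max (fvars φ) (fvars ψ)
  | _, _, .or φ ψ => max (fvars φ) (fvars ψ)
  | _, _, .ex φ => fvars φ + 1
  | _, _, .all φ => fvars φ + 1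
  | _, _, .fp k φ _ => fvars φ + k

/-- Number of relation-variable levels used above the context. [folklore] -/
def frels : {rv : List ℕ} → {n : ℕ} → Formula L rv n → ℕ
  | _, _, .rel _ _ => 0
  | _, _, .rvar _ _ => 0
  | _, _, .eq _ _ => 0
  | _, _, .not φ => frels φ
  | _, _, .and φ ψ => max (frels φ) (frels ψ)
  | _, _, .or φ ψ => max (frels φ) (frels ψ)
  | _, _, .ex φ => frels φ
  | _, _, .all φ => frels φ
  | _, _, .fp _ φ _ => frels φ + 1

end Measures

/-! ### The invariant and the specification -/

section Spec

variable (N : ℕ) (Rin : RelTables ar N)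

/-- The register invariant before evaluating a formula with `n` element variables (valuation
`σ`), relation variables `rv` (assignment `Vt`), at node depth `dp`. [folklore] -/
structure Inv {rv : List ℕ} {n : ℕ} (Vt : RVAssign rv N) (σ : Fin n → Fin N) (dp : ℕ)
    (R : Literature.Computability.Complexity.Regs (ER A V W P)) : Prop where
  hA : ar.length ≤ A
  nn : R nn = Literature.Computability.Complexity.ones N
  tbl : ∀ i : Fin ar.length, R (tbl' i) = inTable Rin i
  xv : ∀ j : Fin n, R (xv' j) = Literature.Computability.Complexity.ones (σ j)
  xv_hi : ∀ j : ℕ, n ≤ j → R (xv' j) = []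
  lp_hi : ∀ j : ℕ, n ≤ j → R (lp' j) = []
  rvr : ∀ jj : Fin rv.length, R (rvr' (rv.length - 1 - jj)) = tableOf (Vt jj)
  rv_hi : ∀ m : ℕ, rv.length ≤ m → R (rvr' m) = [] ∧ R (rvc' m) = [] ∧ R (rvb' m) = [] ∧ R (rvo' m) = []
  wk : ∀ d : ℕ, dp ≤ d → ∀ i, R (wk' d i) = []
  scratch : ∀ i, R (s i) = []
  junk : R junk = []

/-- The specification of the compiled evaluator of `ψ` at depth `dp` with cost `c`. [folklore] -/
def Spec {rv : List ℕ} {n : ℕ} (ψ : Formula (2 :: ar) rv n) (dp : ℕ) (c : ℕ) : Prop :=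
  ∀ (Vt : RVAssign rv N) (σ : Fin n → Fin N) (R : Literature.Computability.Complexity.Regs (ER A V W P)), Inv (A := A) (V := V) (W := W) (P := P) N Rin Vt σ dp R →
    n + fvars ψ < V → rv.length + frels ψ < W → dp + fdepth ψ < P →
    Runs (cmp ψ dp) R (Function.update R (wk' dp 0) (Literature.Computability.Complexity.flag (bv (ψ.eval (withNatOrder Rin) Vt σ)))) c

end Spec


/-! ### Register bookkeeping -/

section Regs

/-- `xv' j` is the register `xv j` for `j < V`. [folklore] -/
theorem xv'_eq {j : ℕ} (h : j < V) : (xv' j : ER A V W P) = xv ⟨j, h⟩ := dif_pos h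
/-- `lp' j` is the register `lp j` for `j < V`. [folklore] -/
theorem lp'_eq {j : ℕ} (h : j < V) : (lp' j : ER A V W P) = lp ⟨j, h⟩ := dif_pos h
/-- `rvr' m` is the register `rvr m` for `m < W`. [folklore] -/
theorem rvr'_eq {m : ℕ} (h : m < W) : (rvr' m : ER A V W P) = rvr ⟨m, h⟩ := dif_pos h
/-- `rvc' m` is the register `rvc m` for `m < W`. [folklore] -/
theorem rvc'_eq {m : ℕ} (h : m < W) : (rvc' m : ER A V W P) = rvc ⟨m, h⟩ := dif_pos h
/-- `rvb' m` is the register `rvb m` for `m < W`. [folklore] -/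
theorem rvb'_eq {m : ℕ} (h : m < W) : (rvb' m : ER A V W P) = rvb ⟨m, h⟩ := dif_pos h
/-- `rvo' m` is the register `rvo m` for `m < W`. [folklore] -/
theorem rvo'_eq {m : ℕ} (h : m < W) : (rvo' m : ER A V W P) = rvo ⟨m, h⟩ := dif_pos h
/-- `wk' d i` is the register `wk d i` for `d < P`. [folklore] -/
theorem wk'_eq {d : ℕ} (h : d < P) (i : Fin 3) : (wk' d i : ER A V W P) = wk ⟨d, h⟩ i := dif_pos h
/-- `tbl' i` is the register `tbl i` for `i < A`. [folklore] -/
theorem tbl'_eq {i : ℕ} (h : i < A) : (tbl' i : ER A V W P) = tbl ⟨i, h⟩ := dif_pos h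

end Regs

/-! ### Atoms -/

section Atoms

variable (N : ℕ) (Rin : RelTables ar N)

/-- The order atom `x_a < x_b`. [folklore] -/
theorem spec_rel_zero {rv : List ℕ} {n : ℕ} (h0 : 0 < (2 :: ar).length) (v : Fin 2 → Fin n) (dp : ℕ) :
    Spec (A := A) (V := V) (W := W) (P := P) N Rin (.rel ⟨0, h0⟩ v : Formula (2 :: ar) rv n) dp (26 * N + 12) := by
  intro Vt σ R hI hV hW hP
  simp only [fvars, frels, fdepth, Nat.add_zero] at hV hW hP
  have hv0 : (v 0 : ℕ) < V := lt_trans (v 0).2 hV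
  have hv1 : (v 1 : ℕ) < V := lt_trans (v 1).2 hV
  have hrun := runs_ltTest (a := xv' (v 0)) (b := xv' (v 1)) (s1 := s 0) (s2 := s 1) (f := wk' dp 0) (t := s 2)
    (u := s 3) (by rw [xv'_eq hv0, wk'_eq hP]; simp) (by rw [xv'_eq hv1, wk'_eq hP]; simp) R
    (hI.scratch 0) (hI.scratch 1) (hI.wk dp le_rfl 0) (hI.scratch 2) (hI.scratch 3)
  rw [hI.xv (v 0), hI.xv (v 1), List.length_replicate, List.length_replicate] at hrun
  refine hrun.of_eq ?_ ?_
  · congr 2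
    apply Bool.eq_iff_iff.mpr
    rw [bv_eq_true_iff, decide_eq_true_iff]
    show _ ↔ natOrderTable N (σ ∘ v) = true
    simp [natOrderTable]
  · have := (σ (v 0)).2; have := (σ (v 1)).2; omega


/-- The equality atom `x_a = x_b`. [folklore] -/
theorem spec_eq {rv : List ℕ} {n : ℕ} (a b : Fin n) (dp : ℕ) :
    Spec (A := A) (V := V) (W := W) (P := P) N Rin (.eq a b : Formula (2 :: ar) rv n) dp (29 * N + 15) := by
  intro Vt σ R hI hV hW hP
  simp only [fvars, frels, fdepth, Nat.add_zero] at hV hW hP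
  have ha : (a : ℕ) < V := lt_trans a.2 hV
  have hb : (b : ℕ) < V := lt_trans b.2 hV
  -- copy a
  have c1 := runs_copy (a := xv' a) (b := s 0) (t := s 2) (u := s 3) (by rw [xv'_eq ha]; simp) (by rw [xv'_eq ha]; simp)
    (by rw [xv'_eq ha]; simp) (by simp) (by simp) (by simp) R (hI.scratch 2) (hI.scratch 3)
  rw [hI.scratch 0, List.append_nil, hI.xv a] at c1
  set R₁ := Function.update R (s 0) (Literature.Computability.Complexity.ones (σ a)) with hR₁
  have c2 := runs_copy (a := xv' b) (b := s 1) (t := s 2) (u := s 3) (by rw [xv'_eq hb]; simp) (by rw [xv'_eq hb]; simp)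
    (by rw [xv'_eq hb]; simp) (by simp) (by simp) (by simp) R₁ (by simp [hR₁, hI.scratch 2]) (by simp [hR₁, hI.scratch 3])
  have hR₁b : R₁ (xv' b) = Literature.Computability.Complexity.ones (σ b) := by rw [hR₁, Function.update_of_ne (by rw [xv'_eq hb]; simp), hI.xv b]
  rw [hR₁b, show R₁ (s 1) = [] by simp [hR₁, hI.scratch 1], List.append_nil] at c2
  set R₂ := Function.update R₁ (s 1) (Literature.Computability.Complexity.ones (σ b)) with hR₂
  have c3 := runs_eqCheck (a := s 0) (b := s 1) (F := wk' dp 0) (by simp) (by rw [wk'_eq hP]; simp)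
    (by rw [wk'_eq hP]; simp) R₂
  have hR₂0 : R₂ (s 0) = Literature.Computability.Complexity.ones (σ a) := by simp [hR₂, hR₁]
  have hR₂1 : R₂ (s 1) = Literature.Computability.Complexity.ones (σ b) := by simp [hR₂]
  have hR₂F : R₂ (wk' dp 0) = [] := by
    rw [hR₂, hR₁, Function.update_of_ne (by rw [wk'_eq hP]; simp), Function.update_of_ne (by rw [wk'_eq hP]; simp)]
    exact hI.wk dp le_rfl 0
  rw [hR₂0, hR₂1, hR₂F, List.length_nil] at c3
  simp only [Literature.Computability.Complexity.ones, List.length_replicate] at c1 c2 c3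
  refine (c1.seq (c2.seq c3)).of_eq ?_ (by have := (σ a).2; have := (σ b).2; omega)
  have hdec : decide (Literature.Computability.Complexity.ones (σ a) = Literature.Computability.Complexity.ones (σ b)) = bv ((Formula.eq a b : Formula (2 :: ar) rv n).eval (withNatOrder Rin) Vt σ) := by
    apply Bool.eq_iff_iff.mpr
    rw [bv_eq_true_iff, decide_eq_true_iff]
    show Literature.Computability.Complexity.ones (σ a) = Literature.Computability.Complexity.ones (σ b) ↔ σ a = σ b
    constructor
    · intro h; have := congrArg List.length h; simp at this; exact Fin.ext this
    · intro h; rw [h]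
  rw [hdec]
  ext i : 1
  simp only [hR₂, hR₁, Function.update_apply]
  split_ifs <;> simp_all [hI.scratch]

/-- The value of a list of digit registers. [folklore] -/
theorem map_length_digitRegs {a n : ℕ} (v : Fin a → Fin n) (σ : Fin n → Fin N) (R : Literature.Computability.Complexity.Regs (ER A V W P))
    (hR : ∀ j : Fin n, R (xv' j) = Literature.Computability.Complexity.ones (σ j)) :
    (digitRegs (A := A) (V := V) (W := W) (P := P) v).map (fun r => (R r).length) =
      (List.ofFn fun l : Fin a => ((σ (v l) : Fin N) : ℕ)).reverse := by
  rw [digitRegs, List.map_reverse, List.map_ofFn]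
  congr 1
  apply List.ofFn_inj.mpr  -- ext on functions
  funext l
  simp [hR (v l)]

/-- A table atom read from register `T` holding `tableOf S`: index computation, lookup, cleanup. [folklore] -/
theorem runs_tableAtom {n a : ℕ} (σ : Fin n → Fin N) (v : Fin a → Fin n) (T : ER A V W P) (S : Set (Fin a → Fin N))
    (dp : ℕ) (hP : dp < P) (hV : n < V) (R : Literature.Computability.Complexity.Regs (ER A V W P)) (hT : R T = tableOf S)
    (hTne : T ≠ s 4 ∧ T ≠ s 0 ∧ T ≠ s 1 ∧ T ≠ wk' dp 0 ∧ T ≠ s 2 ∧ T ≠ s 3)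
    (hnn : R nn = Literature.Computability.Complexity.ones N) (hxv : ∀ j : Fin n, R (xv' j) = Literature.Computability.Complexity.ones (σ j)) (hs : ∀ i, R (s i) = [])
    (hwk : R (wk' dp 0) = []) :
    Runs (idxProg nn (s 4) (s 5) (s 6) (digitRegs v) ;; lookupBit T (s 4) (wk' dp 0) (s 0) (s 1) (s 2) (s 3) ;; clear (s 4)) R
      (Function.update R (wk' dp 0) (Literature.Computability.Complexity.flag (bv ((σ ∘ v) ∈ S))))
      (a * (N ^ a * (10 * N + 12) + 4) + 32 * N ^ a + 12) := by
  obtain ⟨hT4, hT0, hT1, hTw, hT2, hT3⟩ := hTne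
  have hidx : ((finFunctionFinEquiv (σ ∘ v) : Fin (N ^ a)) : ℕ) < N ^ a := (finFunctionFinEquiv (σ ∘ v)).2
  -- the index
  have c1 := runs_idxProg (n := nn) (a := s 4) (a2 := s 5) (t := s 6) (by simp) (by simp) (by simp) (by simp) (by simp)
    (by simp) N (N ^ a) (fun r => (R r).length) (digitRegs v) 0
    (fun r hr => by
      simp only [digitRegs, List.mem_reverse, List.mem_ofFn] at hr
      obtain ⟨l, rfl⟩ := hr
      rw [xv'_eq (lt_trans (v l).2 hV)]; simp)
    (Nat.zero_le _)
    (fun r hr => by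
      simp only [digitRegs, List.mem_reverse, List.mem_ofFn] at hr
      obtain ⟨l, rfl⟩ := hr
      rw [hxv (v l), List.length_replicate]
      have h1 := (σ (v l)).2
      have h2 : 0 < a := Fin.pos l
      calc (σ (v l) : ℕ) ≤ N := h1.le
        _ = N ^ 1 := (pow_one N).symm
        _ ≤ N ^ a := Nat.pow_le_pow_right (by omega) h2)
    (by rw [map_length_digitRegs N v σ R hxv, hornerVal_digits]; exact hidx.le)
    R hnn (by rw [hs 4]; rfl) (hs 5) (hs 6)
    (fun r hr => by
      simp only [digitRegs, List.mem_reverse, List.mem_ofFn] at hr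
      obtain ⟨l, rfl⟩ := hr
      rw [hxv (v l), List.length_replicate])
  rw [map_length_digitRegs N v σ R hxv, hornerVal_digits] at c1
  set R₁ := Function.update R (s 4) (Literature.Computability.Complexity.ones (finFunctionFinEquiv (σ ∘ v) : ℕ)) with hR₁
  -- the lookup
  have c2 := runs_lookupBit (T := T) (I := s 4) (f := wk' dp 0) (s := s 0) (c := s 1) (t := s 2) (u := s 3)
    (by rw [wk'_eq hP] at hTw ⊢; simp [hT0, hT1, hTw, hT2, hT3]) (by rw [wk'_eq hP]; simp) R₁
    (by simp [hR₁, hs 0]) (by simp [hR₁, hs 1])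
    (by rw [hR₁, Function.update_of_ne (by rw [wk'_eq hP]; simp)]; exact hwk) (by simp [hR₁, hs 2]) (by simp [hR₁, hs 3])
  have hR₁T : R₁ T = tableOf S := by rw [hR₁, Function.update_of_ne hT4, hT]
  have hR₁I : R₁ (s 4) = Literature.Computability.Complexity.ones (finFunctionFinEquiv (σ ∘ v) : ℕ) := by simp [hR₁]
  rw [hR₁T, hR₁I, List.length_replicate, getElem?_tableOf, length_tableOf] at c2
  set R₂ := Function.update R₁ (wk' dp 0) (Literature.Computability.Complexity.flag (decide (some (bv (σ ∘ v ∈ S)) = some true))) with hR₂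
  have c3 := runs_clear (s 4) R₂
  have hR₂4 : R₂ (s 4) = Literature.Computability.Complexity.ones (finFunctionFinEquiv (σ ∘ v) : ℕ) := by
    rw [hR₂, Function.update_of_ne (by rw [wk'_eq hP]; simp), hR₁I]
  rw [hR₂4, List.length_replicate] at c3
  have hdec : decide (some (bv (σ ∘ v ∈ S)) = some true) = bv (σ ∘ v ∈ S) := by
    cases bv (σ ∘ v ∈ S) <;> rfl
  have hw4 : (wk' dp 0 : ER A V W P) ≠ s 4 := by rw [wk'_eq hP]; simp
  refine (c1.seq (c2.seq c3)).of_eq ?_ ?_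
  · rw [hR₂, hR₁, hdec]
    ext i : 1
    by_cases h1 : i = wk' dp 0
    · subst h1
      rw [Function.update_self, Function.update_of_ne hw4, Function.update_self]
    · rw [Function.update_of_ne h1]
      by_cases h2 : i = s 4
      · subst h2; rw [Function.update_self, hs 4]
      · rw [Function.update_of_ne h2, Function.update_of_ne h1, Function.update_of_ne h2]
  · simp only [digitRegs, List.length_reverse, List.length_ofFn]
    nlinarith [hidx]


/-- An input-table atom `R_i(x̄)`. [folklore] -/
theorem spec_rel_succ {rv : List ℕ} {n : ℕ} (i : ℕ) (hi : i + 1 < (2 :: ar).length)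
    (v : Fin ((2 :: ar).get ⟨i + 1, hi⟩) → Fin n) (dp : ℕ) :
    Spec (A := A) (V := V) (W := W) (P := P) N Rin (.rel ⟨i + 1, hi⟩ v : Formula (2 :: ar) rv n) dp
      (ar.get ⟨i, Nat.lt_of_succ_lt_succ hi⟩ * (N ^ ar.get ⟨i, Nat.lt_of_succ_lt_succ hi⟩ * (10 * N + 12) + 4) +
        32 * N ^ ar.get ⟨i, Nat.lt_of_succ_lt_succ hi⟩ + 12) := by
  intro Vt σ R hI hV hW hP
  simp only [fvars, frels, fdepth, Nat.add_zero] at hV hW hP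
  have hi' : i < ar.length := Nat.lt_of_succ_lt_succ hi
  have hiA : i < A := lt_of_lt_of_le hi' hI.hA
  have h := runs_tableAtom N σ v (tbl' i) {w | Rin ⟨i, hi'⟩ w = true} dp hP hV R
    (by rw [hI.tbl ⟨i, hi'⟩]; rfl)
    (by rw [tbl'_eq hiA, wk'_eq hP]; simp) hI.nn hI.xv hI.scratch (hI.wk dp le_rfl 0)
  exact h

/-- A relation-variable atom `X_j(x̄)`. [folklore] -/
theorem spec_rvar {rv : List ℕ} {n : ℕ} (j : Fin rv.length) (v : Fin (rv.get j) → Fin n) (dp : ℕ) :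
    Spec (A := A) (V := V) (W := W) (P := P) N Rin (.rvar j v : Formula (2 :: ar) rv n) dp
      (rv.get j * (N ^ rv.get j * (10 * N + 12) + 4) + 32 * N ^ rv.get j + 12) := by
  intro Vt σ R hI hV hW hP
  simp only [fvars, frels, fdepth, Nat.add_zero] at hV hW hP
  have hm : rv.length - 1 - j < W := lt_of_le_of_lt (by omega) hW
  exact runs_tableAtom N σ v (rvr' (rv.length - 1 - j)) (Vt j) dp hP hV R (hI.rvr j)
    (by rw [rvr'_eq hm, wk'_eq hP]; simp) hI.nn hI.xv hI.scratch (hI.wk dp le_rfl 0)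

end Atoms


/-! ### Connectives -/

section Connectives

variable {N : ℕ} {Rin : RelTables ar N}

/-- The invariant at depth `dp` implies the invariant at depth `dp + 1` (fewer work flags constrained). [folklore] -/
theorem Inv.succ {rv : List ℕ} {n : ℕ} {Vt : RVAssign rv N} {σ : Fin n → Fin N} {dp : ℕ} {R : Literature.Computability.Complexity.Regs (ER A V W P)}
    (h : Inv (A := A) (V := V) (W := W) (P := P) N Rin Vt σ dp R) : Inv N Rin Vt σ (dp + 1) R :=
  { h with wk := fun d hd i => h.wk d (by omega) i }

/-- Moving a flag. [folklore] -/
theorem runs_takeFlag {child dst : ER A V W P} (hcd : child ≠ dst) (b : Bool) (R : Literature.Computability.Complexity.Regs (ER A V W P))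
    (hc : R child = Literature.Computability.Complexity.flag b) (hd : R dst = []) :
    Runs (takeFlag child dst) R (Function.update (Function.update R child []) dst (Literature.Computability.Complexity.flag b)) 3 := by
  unfold takeFlag
  cases b
  · rw [Literature.Computability.Complexity.flag_false] at hc ⊢
    refine (Runs.pop_nil _ _ hc (Runs.skip _)).of_eq ?_ (by simp)
    rw [Function.update_eq_self_iff.mpr (show ([] : List Bool) = Function.update R child [] dst by
      rw [Function.update_of_ne hcd.symm, hd]), Function.update_eq_self_iff.mpr hc.symm]
  · rw [Literature.Computability.Complexity.flag_true] at hc ⊢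
    refine (Runs.pop_true _ _ hc (Runs.push' ?_)).of_eq rfl (by simp)
    rw [Function.update_of_ne hcd.symm, hd]

/-- After a child has run, popping its flag restores the register file. [folklore] -/
theorem update_flag_restore {w : ER A V W P} (R : Literature.Computability.Complexity.Regs (ER A V W P)) (hw : R w = []) (b : Bool) :
    Function.update (Function.update R w (Literature.Computability.Complexity.flag b)) w [] = R := by
  rw [Function.update_idem, Function.update_eq_self_iff, hw]

/-- Negation. [folklore] -/
theorem spec_not {rv : List ℕ} {n : ℕ} (φ : Formula (2 :: ar) rv n) (dp c : ℕ)
    (hφ : Spec (A := A) (V := V) (W := W) (P := P) N Rin φ (dp + 1) c) : Spec (A := A) (V := V) (W := W) (P := P) N Rin (.not φ) dp (c + 3) := by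
  intro Vt σ R hI hV hW hP
  simp only [fvars, frels, fdepth] at hV hW hP
  have hP0 : dp < P := by omega
  have hP1 : dp + 1 < P := by omega
  have h1 := hφ Vt σ R hI.succ hV hW (by omega)
  set b := bv (φ.eval (withNatOrder Rin) Vt σ) with hb
  have hw0 : R (wk' dp 0) = [] := hI.wk dp le_rfl 0
  have hw1 : R (wk' (dp + 1) 0) = [] := hI.wk (dp + 1) (by omega) 0
  have hne : (wk' (dp + 1) 0 : ER A V W P) ≠ wk' dp 0 := by rw [wk'_eq hP0, wk'_eq hP1]; simp
  have hres : bv ((Formula.not φ).eval (withNatOrder Rin) Vt σ) = !b := by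
    rw [hb]; apply Bool.eq_iff_iff.mpr
    rw [bv_eq_true_iff, Bool.not_eq_true', ← Bool.not_eq_true, bv_eq_true_iff]; rfl
  show Runs (cmp φ (dp + 1) ;; pop (wk' (dp + 1) 0) skip skip (push (wk' dp 0) true)) R _ _
  rw [hres]
  have h2 : Runs (pop (wk' (dp + 1) 0) skip skip (push (wk' dp 0) true))
      (Function.update R (wk' (dp + 1) 0) (Literature.Computability.Complexity.flag b)) (Function.update R (wk' dp 0) (Literature.Computability.Complexity.flag (!b))) 3 := by
    cases hb' : b
    · rw [Literature.Computability.Complexity.flag_false, Function.update_eq_self_iff.mpr hw1.symm]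
      refine (Runs.pop_nil _ _ hw1 (Runs.push' ?_)).of_eq rfl (by omega)
      rw [hw0]; rfl
    · refine (Runs.pop_true _ _ (by rw [Function.update_self]; rfl) (Runs.skip _)).of_eq ?_ (by omega)
      rw [update_flag_restore R hw1, Bool.not_true, Literature.Computability.Complexity.flag_false]
      exact (Function.update_eq_self_iff.mpr hw0.symm).symm
  exact h1.seq h2

/-- Conjunction. [folklore] -/
theorem spec_and {rv : List ℕ} {n : ℕ} (φ ψ : Formula (2 :: ar) rv n) (dp c₁ c₂ : ℕ)
    (hφ : Spec (A := A) (V := V) (W := W) (P := P) N Rin φ (dp + 1) c₁) (hψ : Spec (A := A) (V := V) (W := W) (P := P) N Rin ψ (dp + 1) c₂) :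
    Spec (A := A) (V := V) (W := W) (P := P) N Rin (.and φ ψ) dp (c₁ + c₂ + 5) := by
  intro Vt σ R hI hV hW hP
  simp only [fvars, frels, fdepth] at hV hW hP
  have hP0 : dp < P := by omega
  have hP1 : dp + 1 < P := by omega
  have h1 := hφ Vt σ R hI.succ (by omega) (by omega) (by omega)
  set b₁ := bv (φ.eval (withNatOrder Rin) Vt σ) with hb₁
  set b₂ := bv (ψ.eval (withNatOrder Rin) Vt σ) with hb₂
  have hw0 : R (wk' dp 0) = [] := hI.wk dp le_rfl 0
  have hw1 : R (wk' (dp + 1) 0) = [] := hI.wk (dp + 1) (by omega) 0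
  have hne : (wk' (dp + 1) 0 : ER A V W P) ≠ wk' dp 0 := by rw [wk'_eq hP0, wk'_eq hP1]; simp
  have hres : bv ((Formula.and φ ψ).eval (withNatOrder Rin) Vt σ) = (b₁ && b₂) := by
    rw [hb₁, hb₂]; apply Bool.eq_iff_iff.mpr
    rw [bv_eq_true_iff, Bool.and_eq_true, bv_eq_true_iff, bv_eq_true_iff]; rfl
  show Runs (cmp φ (dp + 1) ;; pop (wk' (dp + 1) 0) (cmp ψ (dp + 1) ;; takeFlag (wk' (dp + 1) 0) (wk' dp 0)) skip skip) R _ _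
  rw [hres]
  refine (h1.seq (B₂ := c₂ + 5) ?_).of_eq rfl (by omega)
  cases hb₁' : b₁
  · rw [Literature.Computability.Complexity.flag_false, Function.update_eq_self_iff.mpr hw1.symm, Bool.false_and, Literature.Computability.Complexity.flag_false,
      Function.update_eq_self_iff.mpr hw0.symm]
    exact (Runs.pop_nil _ _ hw1 (Runs.skip _)).mono (by omega)
  · rw [Bool.true_and]
    refine (Runs.pop_true _ _ (by rw [Function.update_self]; rfl) ?_).mono (by omega : c₂ + 3 + 2 ≤ c₂ + 5)
    rw [update_flag_restore R hw1]
    have h2 := hψ Vt σ R hI.succ (by omega) (by omega) (by omega)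
    have h3 := runs_takeFlag hne b₂ (Function.update R (wk' (dp + 1) 0) (Literature.Computability.Complexity.flag b₂)) (by rw [Function.update_self])
      (by rw [Function.update_of_ne hne.symm, hw0])
    rw [update_flag_restore R hw1] at h3
    exact h2.seq h3

/-- Disjunction. [folklore] -/
theorem spec_or {rv : List ℕ} {n : ℕ} (φ ψ : Formula (2 :: ar) rv n) (dp c₁ c₂ : ℕ)
    (hφ : Spec (A := A) (V := V) (W := W) (P := P) N Rin φ (dp + 1) c₁) (hψ : Spec (A := A) (V := V) (W := W) (P := P) N Rin ψ (dp + 1) c₂) :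
    Spec (A := A) (V := V) (W := W) (P := P) N Rin (.or φ ψ) dp (c₁ + c₂ + 5) := by
  intro Vt σ R hI hV hW hP
  simp only [fvars, frels, fdepth] at hV hW hP
  have hP0 : dp < P := by omega
  have hP1 : dp + 1 < P := by omega
  have h1 := hφ Vt σ R hI.succ (by omega) (by omega) (by omega)
  set b₁ := bv (φ.eval (withNatOrder Rin) Vt σ) with hb₁
  set b₂ := bv (ψ.eval (withNatOrder Rin) Vt σ) with hb₂
  have hw0 : R (wk' dp 0) = [] := hI.wk dp le_rfl 0
  have hw1 : R (wk' (dp + 1) 0) = [] := hI.wk (dp + 1) (by omega) 0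
  have hne : (wk' (dp + 1) 0 : ER A V W P) ≠ wk' dp 0 := by rw [wk'_eq hP0, wk'_eq hP1]; simp
  have hres : bv ((Formula.or φ ψ).eval (withNatOrder Rin) Vt σ) = (b₁ || b₂) := by
    rw [hb₁, hb₂]; apply Bool.eq_iff_iff.mpr
    rw [bv_eq_true_iff, Bool.or_eq_true, bv_eq_true_iff, bv_eq_true_iff]; rfl
  show Runs (cmp φ (dp + 1) ;; pop (wk' (dp + 1) 0) (push (wk' dp 0) true) skip
    (cmp ψ (dp + 1) ;; takeFlag (wk' (dp + 1) 0) (wk' dp 0))) R _ _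
  rw [hres]
  refine (h1.seq (B₂ := c₂ + 5) ?_).of_eq rfl (by omega)
  cases hb₁' : b₁
  · rw [Literature.Computability.Complexity.flag_false, Function.update_eq_self_iff.mpr hw1.symm, Bool.false_or]
    refine (Runs.pop_nil _ _ hw1 ?_).mono (by omega : c₂ + 3 + 2 ≤ c₂ + 5)
    have h2 := hψ Vt σ R hI.succ (by omega) (by omega) (by omega)
    have h3 := runs_takeFlag hne b₂ (Function.update R (wk' (dp + 1) 0) (Literature.Computability.Complexity.flag b₂)) (by rw [Function.update_self])
      (by rw [Function.update_of_ne hne.symm, hw0])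
    rw [update_flag_restore R hw1] at h3
    exact h2.seq h3
  · rw [Bool.true_or, Literature.Computability.Complexity.flag_true]
    refine (Runs.pop_true _ _ (by rw [Function.update_self]) (Runs.push' ?_)).mono (by omega)
    have e := update_flag_restore R hw1 true
    rw [Literature.Computability.Complexity.flag_true] at e
    rw [e, hw0]

end Connectives


/-! ### Quantifiers -/

section Quantifiers

variable {N : ℕ} {Rin : RelTables ar N} {rv : List ℕ} {n : ℕ}

/-- The loop body of the existential quantifier. [folklore] -/
def exBody (φ : Formula (2 :: ar) rv (n + 1)) (dp : ℕ) : Literature.Computability.Complexity.Com (ER A V W P) :=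
  cmp φ (dp + 1) ;; pop (wk' (dp + 1) 0) (clear (wk' dp 0) ;; push (wk' dp 0) true) skip skip ;; push (xv' n) true

/-- The accumulated truth value after `j` rounds of the existential loop. [folklore] -/
noncomputable def exAcc (φ : Formula (2 :: ar) rv (n + 1)) (Vt : RVAssign rv N) (σ : Fin n → Fin N) (j : ℕ) : Bool :=
  bv (∃ a : Fin N, (a : ℕ) < j ∧ φ.eval (withNatOrder Rin) Vt (Fin.snoc σ a))

/-- The state after `j` rounds of the existential loop started from `R` (`lp' n` given separately). [folklore] -/
noncomputable def exState (φ : Formula (2 :: ar) rv (n + 1)) (Vt : RVAssign rv N) (σ : Fin n → Fin N) (dp : ℕ)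
    (R : Literature.Computability.Complexity.Regs (ER A V W P)) (j : ℕ) (w : List Bool) : Literature.Computability.Complexity.Regs (ER A V W P) :=
  Function.update (Function.update (Function.update R (lp' n) w) (xv' n) (Literature.Computability.Complexity.ones j)) (wk' dp 0)
    (Literature.Computability.Complexity.flag (exAcc (Rin := Rin) φ Vt σ j))

/-- One round of the existential loop. [folklore] -/
theorem runs_exBody (φ : Formula (2 :: ar) rv (n + 1)) (dp c : ℕ)
    (hφ : Spec (A := A) (V := V) (W := W) (P := P) N Rin φ (dp + 1) c)
    (Vt : RVAssign rv N) (σ : Fin n → Fin N) (R : Literature.Computability.Complexity.Regs (ER A V W P)) (hI : Inv (A := A) (V := V) (W := W) (P := P) N Rin Vt σ dp R)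
    (hV : n + 1 + fvars φ < V) (hW : rv.length + frels φ < W) (hP : dp + 1 + fdepth φ < P)
    (j : ℕ) (hj : j < N) (w : List Bool) :
    Runs (exBody (A := A) (V := V) (W := W) (P := P) φ dp) (exState (Rin := Rin) φ Vt σ dp R j w)
      (exState (Rin := Rin) φ Vt σ dp R (j + 1) w) (c + 7) := by
  have hP0 : dp < P := by omega
  have hP1 : dp + 1 < P := by omega
  have hnV : n < V := by omega
  have hw0 : R (wk' dp 0) = [] := hI.wk dp le_rfl 0
  have hw1 : R (wk' (dp + 1) 0) = [] := hI.wk (dp + 1) (by omega) 0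
  have hne10 : (wk' (dp + 1) 0 : ER A V W P) ≠ wk' dp 0 := by rw [wk'_eq hP0, wk'_eq hP1]; simp
  have hne1x : (wk' (dp + 1) 0 : ER A V W P) ≠ xv' n := by rw [wk'_eq hP1, xv'_eq hnV]; simp
  have hne1l : (wk' (dp + 1) 0 : ER A V W P) ≠ lp' n := by rw [wk'_eq hP1, lp'_eq hnV]; simp
  have hne0x : (wk' dp 0 : ER A V W P) ≠ xv' n := by rw [wk'_eq hP0, xv'_eq hnV]; simp
  have hne0l : (wk' dp 0 : ER A V W P) ≠ lp' n := by rw [wk'_eq hP0, lp'_eq hnV]; simp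
  have hnexl : (xv' n : ER A V W P) ≠ lp' n := by rw [xv'_eq hnV, lp'_eq hnV]; simp
  set S := exState (Rin := Rin) φ Vt σ dp R j w with hS
  -- the child invariant on S
  have hIS : Inv (A := A) (V := V) (W := W) (P := P) N Rin Vt (Fin.snoc σ ⟨j, hj⟩ : Fin (n + 1) → Fin N) (dp + 1) S := by
    refine ⟨hI.hA, ?_, ?_, ?_, ?_, ?_, ?_, ?_, ?_, ?_, ?_⟩
    · rw [hS, exState]; simp only [Function.update_apply]
      rw [if_neg, if_neg, if_neg]; exact hI.nn
      all_goals first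
        | (rw [lp'_eq hnV]; simp)
        | (rw [xv'_eq hnV]; simp)
        | (rw [wk'_eq hP0]; simp)
    · intro i
      have hiA : (i : ℕ) < A := lt_of_lt_of_le i.2 hI.hA
      rw [hS, exState]; simp only [Function.update_apply]
      rw [if_neg (by rw [tbl'_eq hiA, wk'_eq hP0]; simp), if_neg (by rw [tbl'_eq hiA, xv'_eq hnV]; simp),
        if_neg (by rw [tbl'_eq hiA, lp'_eq hnV]; simp)]
      exact hI.tbl i
    · intro j'
      rw [hS, exState]
      rcases Fin.eq_castSucc_or_eq_last j' with ⟨j', rfl⟩ | rfl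
      · have hj'V : (j' : ℕ) < V := by omega
        rw [Fin.snoc_castSucc, Fin.val_castSucc, Function.update_of_ne (by rw [xv'_eq hj'V, wk'_eq hP0]; simp),
          Function.update_of_ne (by rw [xv'_eq hj'V, xv'_eq hnV]; simp [Fin.ext_iff]; omega),
          Function.update_of_ne (by rw [xv'_eq hj'V, lp'_eq hnV]; simp)]
        exact hI.xv j'
      · rw [Fin.snoc_last, Fin.val_last, Function.update_of_ne hne0x.symm, Function.update_self]
    · intro j' hj'
      have : n ≤ j' := by omega
      rw [hS, exState]
      by_cases hj'V : j' < V
      · rw [Function.update_of_ne (by rw [xv'_eq hj'V, wk'_eq hP0]; simp),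
          Function.update_of_ne (by rw [xv'_eq hj'V, xv'_eq hnV]; simp [Fin.ext_iff]; omega),
          Function.update_of_ne (by rw [xv'_eq hj'V, lp'_eq hnV]; simp)]
        exact hI.xv_hi j' this
      · have hjunk : (xv' j' : ER A V W P) = junk := dif_neg hj'V
        rw [hjunk, Function.update_of_ne (by rw [wk'_eq hP0]; simp), Function.update_of_ne (by rw [xv'_eq hnV]; simp),
          Function.update_of_ne (by rw [lp'_eq hnV]; simp)]
        exact hI.junk
    · intro j' hj'
      have : n ≤ j' := by omega
      rw [hS, exState]
      by_cases hj'V : j' < V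
      · rw [Function.update_of_ne (by rw [lp'_eq hj'V, wk'_eq hP0]; simp),
          Function.update_of_ne (by rw [lp'_eq hj'V, xv'_eq hnV]; simp),
          Function.update_of_ne (by rw [lp'_eq hj'V, lp'_eq hnV]; simp [Fin.ext_iff]; omega)]
        exact hI.lp_hi j' this
      · have hjunk : (lp' j' : ER A V W P) = junk := dif_neg hj'V
        rw [hjunk, Function.update_of_ne (by rw [wk'_eq hP0]; simp), Function.update_of_ne (by rw [xv'_eq hnV]; simp),
          Function.update_of_ne (by rw [lp'_eq hnV]; simp)]
        exact hI.junk
    · intro jj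
      have hm : rv.length - 1 - jj < W := by omega
      rw [hS, exState, Function.update_of_ne (by rw [rvr'_eq hm, wk'_eq hP0]; simp),
        Function.update_of_ne (by rw [rvr'_eq hm, xv'_eq hnV]; simp), Function.update_of_ne (by rw [rvr'_eq hm, lp'_eq hnV]; simp)]
      exact hI.rvr jj
    · intro m hm
      rw [hS, exState]
      by_cases hmW : m < W
      · simp only [Function.update_apply]
        rw [if_neg (by rw [rvr'_eq hmW, wk'_eq hP0]; simp), if_neg (by rw [rvr'_eq hmW, xv'_eq hnV]; simp),
          if_neg (by rw [rvr'_eq hmW, lp'_eq hnV]; simp), if_neg (by rw [rvc'_eq hmW, wk'_eq hP0]; simp),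
          if_neg (by rw [rvc'_eq hmW, xv'_eq hnV]; simp), if_neg (by rw [rvc'_eq hmW, lp'_eq hnV]; simp),
          if_neg (by rw [rvb'_eq hmW, wk'_eq hP0]; simp), if_neg (by rw [rvb'_eq hmW, xv'_eq hnV]; simp),
          if_neg (by rw [rvb'_eq hmW, lp'_eq hnV]; simp), if_neg (by rw [rvo'_eq hmW, wk'_eq hP0]; simp),
          if_neg (by rw [rvo'_eq hmW, xv'_eq hnV]; simp), if_neg (by rw [rvo'_eq hmW, lp'_eq hnV]; simp)]
        exact hI.rv_hi m hm
      · have e1 : (rvr' m : ER A V W P) = junk := dif_neg hmW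
        have e2 : (rvc' m : ER A V W P) = junk := dif_neg hmW
        have e3 : (rvb' m : ER A V W P) = junk := dif_neg hmW
        have e4 : (rvo' m : ER A V W P) = junk := dif_neg hmW
        rw [e1, e2, e3, e4, Function.update_of_ne (by rw [wk'_eq hP0]; simp), Function.update_of_ne (by rw [xv'_eq hnV]; simp),
          Function.update_of_ne (by rw [lp'_eq hnV]; simp)]
        exact ⟨hI.junk, hI.junk, hI.junk, hI.junk⟩
    · intro d hd i
      have hdP' : d < P ∨ ¬ d < P := em _
      rw [hS, exState]
      rcases hdP' with hdP | hdP
      · rw [Function.update_of_ne (by rw [wk'_eq hdP, wk'_eq hP0]; intro h; cases h; omega),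
          Function.update_of_ne (by rw [wk'_eq hdP, xv'_eq hnV]; simp), Function.update_of_ne (by rw [wk'_eq hdP, lp'_eq hnV]; simp)]
        exact hI.wk d (by omega) i
      · have e : (wk' d i : ER A V W P) = junk := dif_neg hdP
        rw [e, Function.update_of_ne (by rw [wk'_eq hP0]; simp), Function.update_of_ne (by rw [xv'_eq hnV]; simp),
          Function.update_of_ne (by rw [lp'_eq hnV]; simp)]
        exact hI.junk
    · intro i
      rw [hS, exState, Function.update_of_ne (by rw [wk'_eq hP0]; simp), Function.update_of_ne (by rw [xv'_eq hnV]; simp),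
        Function.update_of_ne (by rw [lp'_eq hnV]; simp)]
      exact hI.scratch i
    · rw [hS, exState, Function.update_of_ne (by rw [wk'_eq hP0]; simp), Function.update_of_ne (by rw [xv'_eq hnV]; simp),
        Function.update_of_ne (by rw [lp'_eq hnV]; simp)]
      exact hI.junk
  -- run the child
  have h1 := hφ Vt (Fin.snoc σ ⟨j, hj⟩) S hIS (by omega) hW (by omega)
  set b := bv (φ.eval (withNatOrder Rin) Vt (Fin.snoc σ ⟨j, hj⟩)) with hb
  have hSw0 : S (wk' dp 0) = Literature.Computability.Complexity.flag (exAcc (Rin := Rin) φ Vt σ j) := by rw [hS, exState, Function.update_self]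
  have hSw1 : S (wk' (dp + 1) 0) = [] := hIS.wk (dp + 1) le_rfl 0
  have hSx : S (xv' n) = Literature.Computability.Complexity.ones j := by rw [hS, exState, Function.update_of_ne hne0x.symm, Function.update_self]
  -- the new accumulator
  have hacc : exAcc (Rin := Rin) φ Vt σ (j + 1) = (exAcc (Rin := Rin) φ Vt σ j || b) := by
    rw [exAcc, exAcc, hb]
    apply Bool.eq_iff_iff.mpr
    rw [bv_eq_true_iff, Bool.or_eq_true, bv_eq_true_iff, bv_eq_true_iff]
    constructor
    · rintro ⟨a, ha, h⟩
      rcases Nat.lt_succ_iff_lt_or_eq.mp ha with ha | ha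
      · exact Or.inl ⟨a, ha, h⟩
      · right; have : a = ⟨j, hj⟩ := Fin.ext ha; rw [← this]; exact h
    · rintro (⟨a, ha, h⟩ | h)
      · exact ⟨a, by omega, h⟩
      · exact ⟨⟨j, hj⟩, by simp, h⟩
  -- target state
  have htarget : exState (Rin := Rin) φ Vt σ dp R (j + 1) w =
      Function.update (Function.update (Function.update S (wk' (dp + 1) 0) []) (wk' dp 0)
        (Literature.Computability.Complexity.flag (exAcc (Rin := Rin) φ Vt σ j || b))) (xv' n) (Literature.Computability.Complexity.ones (j + 1)) := by
    rw [← hacc]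
    ext i : 1
    by_cases h1 : i = xv' n
    · subst h1
      rw [Function.update_self, exState, Function.update_of_ne hne0x.symm, Function.update_self]
    rw [Function.update_of_ne h1]
    by_cases h2 : i = wk' dp 0
    · subst h2; rw [Function.update_self, exState, Function.update_self]
    rw [Function.update_of_ne h2]
    by_cases h3 : i = wk' (dp + 1) 0
    · subst h3
      rw [Function.update_self, exState, Function.update_of_ne hne10, Function.update_of_ne hne1x,
        Function.update_of_ne hne1l, hw1]
    rw [Function.update_of_ne h3, hS, exState, exState, Function.update_of_ne h2, Function.update_of_ne h1,
      Function.update_of_ne h2, Function.update_of_ne h1]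
  rw [htarget]
  unfold exBody
  refine (h1.seq (B₂ := 7) ?_).of_eq rfl (by omega)
  have hpush : ∀ T : Literature.Computability.Complexity.Regs (ER A V W P), T (xv' n) = Literature.Computability.Complexity.ones j →
      Runs (push (xv' n) true) T (Function.update T (xv' n) (Literature.Computability.Complexity.ones (j + 1))) 1 := by
    intro T hT; exact Runs.push' (by rw [hT]; rfl)
  cases hb' : b
  · -- child false: flag empty
    rw [Literature.Computability.Complexity.flag_false, Bool.or_false]
    have e1 : Function.update S (wk' (dp + 1) 0) [] = S := Function.update_eq_self_iff.mpr hSw1.symm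
    rw [e1]
    have e2 : Function.update S (wk' dp 0) (Literature.Computability.Complexity.flag (exAcc (Rin := Rin) φ Vt σ j)) = S :=
      Function.update_eq_self_iff.mpr hSw0.symm
    rw [e2]
    refine ((Runs.pop_nil _ _ hSw1 (Runs.skip _)).seq (hpush S hSx)).mono (by omega)
  · rw [Literature.Computability.Complexity.flag_true, Bool.or_true]
    have e1 : Function.update S (wk' (dp + 1) 0) [] = S := Function.update_eq_self_iff.mpr hSw1.symm
    refine ((Runs.pop_true _ _ (by rw [Function.update_self]) ?_).seq (hpush _ ?_)).mono (by omega : (3 + 1) + 2 + 1 ≤ 7)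
    · rw [Function.update_idem, e1]
      have c1 := runs_clear_flag (wk' dp 0) (R := S) (by rw [hSw0]; cases exAcc (Rin := Rin) φ Vt σ j <;> simp)
      refine c1.seq (Runs.push' ?_)
      rw [Function.update_idem, Function.update_self]; rfl
    · rw [Function.update_of_ne hne0x.symm, Function.update_of_ne hne1x.symm, hSx]


/-- Updating the loop register of the `∃`-loop state. [folklore] -/
theorem exState_update_lp (φ : Formula (2 :: ar) rv (n + 1)) (Vt : RVAssign rv N) (σ : Fin n → Fin N) (dp : ℕ)
    (R : Literature.Computability.Complexity.Regs (ER A V W P)) (j : ℕ) (w w' : List Bool) (hnV : n < V) (hP0 : dp < P) :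
    Function.update (exState (Rin := Rin) φ Vt σ dp R j w) (lp' n) w' = exState (Rin := Rin) φ Vt σ dp R j w' := by
  have hne0l : (wk' dp 0 : ER A V W P) ≠ lp' n := by rw [wk'_eq hP0, lp'_eq hnV]; simp
  have hnexl : (xv' n : ER A V W P) ≠ lp' n := by rw [xv'_eq hnV, lp'_eq hnV]; simp
  unfold exState
  ext i : 1
  by_cases h1 : i = lp' n
  · subst h1
    rw [Function.update_self, Function.update_of_ne hne0l.symm, Function.update_of_ne hnexl.symm,
      Function.update_self]
  · rw [Function.update_of_ne h1]
    simp only [Function.update_apply, if_neg h1]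

/-- The existential loop. [folklore] -/
theorem runs_exLoop (φ : Formula (2 :: ar) rv (n + 1)) (dp c : ℕ)
    (hφ : Spec (A := A) (V := V) (W := W) (P := P) N Rin φ (dp + 1) c)
    (Vt : RVAssign rv N) (σ : Fin n → Fin N) (R : Literature.Computability.Complexity.Regs (ER A V W P)) (hI : Inv (A := A) (V := V) (W := W) (P := P) N Rin Vt σ dp R)
    (hV : n + 1 + fvars φ < V) (hW : rv.length + frels φ < W) (hP : dp + 1 + fdepth φ < P) :
    ∀ (m j : ℕ), j + m = N →
    Runs (loop (lp' n) (exBody (A := A) (V := V) (W := W) (P := P) φ dp) (exBody φ dp))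
      (exState (Rin := Rin) φ Vt σ dp R j (Literature.Computability.Complexity.ones m)) (exState (Rin := Rin) φ Vt σ dp R (j + m) []) (m * (c + 9) + 1)
  | 0, j, hjm => by
    refine (Runs.loop_nil _ _ ?_).of_eq (by simp) (by simp)
    rw [exState, Function.update_of_ne (by rw [wk'_eq (by omega : dp < P), lp'_eq (by omega : n < V)]; simp),
      Function.update_of_ne (by rw [xv'_eq (by omega : n < V), lp'_eq (by omega : n < V)]; simp), Function.update_self]
    rfl
  | m + 1, j, hjm => by
    have hnV : n < V := by omega
    have hP0 : dp < P := by omega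
    have hbody := runs_exBody φ dp c hφ Vt σ R hI hV hW hP j (by omega) (Literature.Computability.Complexity.ones m)
    have ih := runs_exLoop φ dp c hφ Vt σ R hI hV hW hP m (j + 1) (by omega)
    rw [show j + 1 + m = j + (m + 1) by omega] at ih
    rw [show (m + 1) * (c + 9) + 1 = (c + 7) + 2 + (m * (c + 9) + 1) by ring]
    refine Runs.loop_true (w := Literature.Computability.Complexity.ones m) ?_ ?_ ih
    · rw [exState, Function.update_of_ne (by rw [wk'_eq hP0, lp'_eq hnV]; simp),
        Function.update_of_ne (by rw [xv'_eq hnV, lp'_eq hnV]; simp), Function.update_self]; rfl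
    · rw [exState_update_lp φ Vt σ dp R j _ _ hnV hP0]; exact hbody

/-- The existential quantifier. [folklore] -/
theorem spec_ex (φ : Formula (2 :: ar) rv (n + 1)) (dp c : ℕ)
    (hφ : Spec (A := A) (V := V) (W := W) (P := P) N Rin φ (dp + 1) c) :
    Spec (A := A) (V := V) (W := W) (P := P) N Rin (.ex φ) dp (N * (c + 9) + 12 * N + 5) := by
  intro Vt σ R hI hV hW hP
  simp only [fvars, frels, fdepth] at hV hW hP
  have hnV : n < V := by omega
  have hP0 : dp < P := by omega
  have hne0x : (wk' dp 0 : ER A V W P) ≠ xv' n := by rw [wk'_eq hP0, xv'_eq hnV]; simp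
  have hne0l : (wk' dp 0 : ER A V W P) ≠ lp' n := by rw [wk'_eq hP0, lp'_eq hnV]; simp
  have hnexl : (xv' n : ER A V W P) ≠ lp' n := by rw [xv'_eq hnV, lp'_eq hnV]; simp
  have hx : R (xv' n) = [] := hI.xv_hi n le_rfl
  have hl : R (lp' n) = [] := hI.lp_hi n le_rfl
  have hw0 : R (wk' dp 0) = [] := hI.wk dp le_rfl 0
  -- copy the counter
  have c1 := runs_copy (a := nn) (b := lp' n) (t := s 0) (u := s 1) (by rw [lp'_eq hnV]; simp) (by simp) (by simp)
    (by rw [lp'_eq hnV]; simp) (by rw [lp'_eq hnV]; simp) (by simp) R (hI.scratch 0) (hI.scratch 1)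
  rw [hI.nn, hl, List.append_nil] at c1
  have e0 : Function.update R (lp' n) (Literature.Computability.Complexity.ones N) = exState (Rin := Rin) φ Vt σ dp R 0 (Literature.Computability.Complexity.ones N) := by
    rw [exState, exAcc]
    have : bv (∃ a : Fin N, (a : ℕ) < 0 ∧ φ.eval (withNatOrder Rin) Vt (Fin.snoc σ a)) = false := by
      rw [Bool.eq_false_iff, ne_eq, bv_eq_true_iff]; rintro ⟨a, ha, -⟩; omega
    rw [this, Literature.Computability.Complexity.flag_false, show Literature.Computability.Complexity.ones 0 = [] from rfl]
    symm
    rw [Function.update_eq_self_iff.mpr (by rw [Function.update_of_ne hne0x, Function.update_of_ne hne0l, hw0]),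
      Function.update_eq_self_iff.mpr (by rw [Function.update_of_ne hnexl, hx])]
  rw [e0] at c1
  have c2 := runs_exLoop φ dp c hφ Vt σ R hI (by omega) hW (by omega) N 0 (by omega)
  rw [Nat.zero_add] at c2
  have c3 := runs_clear (xv' n) (exState (Rin := Rin) φ Vt σ dp R N [])
  have hxN : exState (Rin := Rin) φ Vt σ dp R N [] (xv' n) = Literature.Computability.Complexity.ones N := by
    rw [exState, Function.update_of_ne hne0x.symm, Function.update_self]
  rw [hxN] at c3
  simp only [Literature.Computability.Complexity.ones, List.length_replicate] at c1 c3
  show Runs (copy nn (lp' n) (s 0) (s 1) ;; loop (lp' n) (exBody φ dp) (exBody φ dp) ;; clear (xv' n)) R _ _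
  refine (c1.seq (c2.seq c3)).of_eq ?_ (by ring_nf; omega)
  have hres : exAcc (Rin := Rin) φ Vt σ N = bv ((Formula.ex φ).eval (withNatOrder Rin) Vt σ) := by
    rw [exAcc]; apply Bool.eq_iff_iff.mpr
    rw [bv_eq_true_iff, bv_eq_true_iff]
    exact ⟨fun ⟨a, _, h⟩ => ⟨a, h⟩, fun ⟨a, h⟩ => ⟨a, a.2, h⟩⟩
  rw [exState, hres]
  ext i : 1
  by_cases h1 : i = xv' n
  · subst h1; rw [Function.update_self, Function.update_of_ne hne0x.symm, hx]
  rw [Function.update_of_ne h1]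
  by_cases h2 : i = wk' dp 0
  · subst h2; rw [Function.update_self, Function.update_self]
  rw [Function.update_of_ne h2, Function.update_of_ne h1, Function.update_of_ne h2]
  by_cases h3 : i = lp' n
  · subst h3; rw [Function.update_self, hl]
  rw [Function.update_of_ne h3]


/-- The universal quantifier is compiled as `¬ ∃ ¬`. [folklore] -/
theorem cmp_all (φ : Formula (2 :: ar) rv (n + 1)) (dp : ℕ) :
    cmp (A := A) (V := V) (W := W) (P := P) (.all φ) dp = cmp (.not (.ex (.not φ))) dp := rfl

/-- The universal quantifier. [folklore] -/
theorem spec_all (φ : Formula (2 :: ar) rv (n + 1)) (dp c : ℕ)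
    (hφ : Spec (A := A) (V := V) (W := W) (P := P) N Rin φ (dp + 3) c) :
    Spec (A := A) (V := V) (W := W) (P := P) N Rin (.all φ) dp (N * (c + 3 + 9) + 12 * N + 5 + 3) := by
  have h := spec_not _ dp _ (spec_ex _ (dp + 1) _ (spec_not φ (dp + 2) c hφ))
  intro Vt σ R hI hV hW hP
  simp only [fvars, frels, fdepth] at hV hW hP
  have h' := h Vt σ R hI (by simp only [fvars]; omega) (by simp only [frels]; omega) (by simp only [fdepth]; omega)
  rw [cmp_all]
  refine h'.of_eq ?_ le_rfl
  congr 2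
  apply Bool.eq_iff_iff.mpr
  rw [bv_eq_true_iff, bv_eq_true_iff]
  simp only [Formula.eval, not_exists, not_not]

end Quantifiers


/-! ### The fixed point -/

section FixedPoint

variable {N : ℕ} {Rin : RelTables ar N} {rv : List ℕ} {n : ℕ}

/-- The operator of a fixed-point node. [folklore] -/
def fpOp (k : ℕ) (φ : Formula (2 :: ar) (k :: rv) (n + k)) (Vt : RVAssign rv N) (σ : Fin n → Fin N)
    (S : Set (Fin k → Fin N)) : Set (Fin k → Fin N) :=
  {a | φ.eval (withNatOrder Rin) (RVAssign.cons S Vt) (Fin.append σ a)}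

/-- The table of stage `s`. [folklore] -/
noncomputable def stT (k : ℕ) (φ : Formula (2 :: ar) (k :: rv) (n + k)) (Vt : RVAssign rv N) (σ : Fin n → Fin N) (s : ℕ) :
    List Bool :=
  tableOf (ifpStages (fpOp (Rin := Rin) k φ Vt σ) s)

omit N Rin in
/-- Merging the old bit (flag in `wk' dp 1`) with the child's flag into a new bit pushed on the builder. [folklore] -/
def fpMerge (rv : List ℕ) (dp : ℕ) : Literature.Computability.Complexity.Com (ER A V W P) :=
  pop (wk' dp 1) (pop (wk' (dp + 1) 0) (push (rvb' rv.length) true) skip (push (rvb' rv.length) true)) skip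
    (pop (wk' (dp + 1) 0) (push (rvb' rv.length) true) skip (push (rvb' rv.length) false))

/-- The body run for one tuple. [folklore] -/
def fpBody (k : ℕ) (φ : Formula (2 :: ar) (k :: rv) (n + k)) (dp : ℕ) : Literature.Computability.Complexity.Com (ER A V W P) :=
  pop (rvc' rv.length) (push (wk' dp 1) true) skip skip ;; cmp φ (dp + 1) ;; fpMerge rv dp

/-- The variable levels of the new tuple, highest first. [folklore] -/
def fpLevels (n k : ℕ) : List ℕ := ((List.range k).map (fun l => n + l)).reverse

/-- One stage. [folklore] -/
def fpStage (k : ℕ) (φ : Formula (2 :: ar) (k :: rv) (n + k)) (dp : ℕ) : Literature.Computability.Complexity.Com (ER A V W P) :=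
  copy (rvr' rv.length) (rvc' rv.length) (s 0) (s 1) ;; enumLoops (fpBody (A := A) (V := V) (W := W) (P := P) k φ dp) (fpLevels n k) ;;
    clear (rvr' rv.length) ;; pour (rvb' rv.length) (rvr' rv.length)

/-- The compiled program of a fixed-point node, with the stage body named `fpStage`. [folklore] -/
theorem cmp_fp (k : ℕ) (φ : Formula (2 :: ar) (k :: rv) (n + k)) (t : Fin k → Fin n) (dp : ℕ) :
    cmp (A := A) (V := V) (W := W) (P := P) (.fp k φ t) dp =
      (push (rvo' rv.length) true ;; powProg nn (rvo' rv.length) (s 0) (s 1) k ;;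
      copy (rvo' rv.length) (s 0) (s 1) (s 2) ;; loop (s 0) (push (rvr' rv.length) false) (push (rvr' rv.length) false) ;;
      loop (rvo' rv.length) (fpStage k φ dp) (fpStage k φ dp) ;;
      (idxProg nn (s 4) (s 5) (s 6) (digitRegs t) ;;
        lookupBit (rvr' rv.length) (s 4) (wk' dp 0) (s 0) (s 1) (s 2) (s 3) ;; clear (s 4)) ;; clear (rvr' rv.length)) := rfl

/-- **The canonical register file of the fixed-point machinery** (a view): the new variable levels
hold `a`, their loop registers `c`, the node's relation registers hold the stage table, the
working copy `xc`, the builder `xb` and the stage counter `w`; everything else as in `R`. [folklore] -/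
noncomputable def fpSt (k : ℕ) (φ : Formula (2 :: ar) (k :: rv) (n + k)) (R : Literature.Computability.Complexity.Regs (ER A V W P)) (Vt : RVAssign rv N)
    (σ : Fin n → Fin N) (st : ℕ) (w xc xb : List Bool) (a : ℕ → ℕ) (c : ℕ → List Bool) : Literature.Computability.Complexity.Regs (ER A V W P) :=
  fun r => match r with
  | .xv j => if n ≤ (j : ℕ) ∧ (j : ℕ) < n + k then Literature.Computability.Complexity.ones (a (j - n)) else R (.xv j)
  | .lp j => if n ≤ (j : ℕ) ∧ (j : ℕ) < n + k then c (j - n) else R (.lp j)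
  | .rvo m' => if (m' : ℕ) = rv.length then w else R (.rvo m')
  | .rvr m' => if (m' : ℕ) = rv.length then stT (Rin := Rin) k φ Vt σ st else R (.rvr m')
  | .rvc m' => if (m' : ℕ) = rv.length then xc else R (.rvc m')
  | .rvb m' => if (m' : ℕ) = rv.length then xb else R (.rvb m')
  | r => R r


section FpSt

variable (k : ℕ) (φ : Formula (2 :: ar) (k :: rv) (n + k)) (R : Literature.Computability.Complexity.Regs (ER A V W P)) (Vt : RVAssign rv N)
  (σ : Fin n → Fin N) (st : ℕ) (w xc xb : List Bool) (a : ℕ → ℕ) (c : ℕ → List Bool)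
  (hV : n + k ≤ V) (hW : rv.length < W)

local notation "FS" => fpSt (A := A) (V := V) (W := W) (P := P) (Rin := Rin) k φ R Vt σ

include hV in
/-- View of the fixed-point state: the variable register of a new level `n + l` holds the digit `a l`. [folklore] -/
theorem fpSt_xv_mid {l : ℕ} (hl : l < k) : FS st w xc xb a c (xv' (n + l)) = Literature.Computability.Complexity.ones (a l) := by
  rw [xv'_eq (by omega)]; simp [fpSt, hl]

/-- View of the fixed-point state: variable registers below level `n` are untouched. [folklore] -/
theorem fpSt_xv_lo {j : ℕ} (hj : j < n) : FS st w xc xb a c (xv' j) = R (xv' j) := by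
  by_cases hjV : j < V
  · rw [xv'_eq hjV]; simp [fpSt]; intro h; omega
  · rw [show (xv' j : ER A V W P) = junk from dif_neg hjV]; rfl

/-- View of the fixed-point state: variable registers from level `n + k` on are untouched. [folklore] -/
theorem fpSt_xv_hi {j : ℕ} (hj : n + k ≤ j) : FS st w xc xb a c (xv' j) = R (xv' j) := by
  by_cases hjV : j < V
  · rw [xv'_eq hjV]; simp [fpSt]; intro; omega
  · rw [show (xv' j : ER A V W P) = junk from dif_neg hjV]; rfl

include hV in
/-- View of the fixed-point state: the loop register of a new level `n + l` holds `c l`. [folklore] -/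
theorem fpSt_lp_mid {l : ℕ} (hl : l < k) : FS st w xc xb a c (lp' (n + l)) = c l := by
  rw [lp'_eq (by omega)]; simp [fpSt, hl]

/-- View of the fixed-point state: loop registers from level `n + k` on are untouched. [folklore] -/
theorem fpSt_lp_hi {j : ℕ} (hj : n + k ≤ j) : FS st w xc xb a c (lp' j) = R (lp' j) := by
  by_cases hjV : j < V
  · rw [lp'_eq hjV]; simp [fpSt]; intro; omega
  · rw [show (lp' j : ER A V W P) = junk from dif_neg hjV]; rfl

/-- View of the fixed-point state: loop registers below level `n` are untouched. [folklore] -/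
theorem fpSt_lp_lo {j : ℕ} (hj : j < n) : FS st w xc xb a c (lp' j) = R (lp' j) := by
  by_cases hjV : j < V
  · rw [lp'_eq hjV]; simp [fpSt]; intro h; omega
  · rw [show (lp' j : ER A V W P) = junk from dif_neg hjV]; rfl

include hW in
/-- View of the fixed-point state: the stage counter. [folklore] -/
theorem fpSt_rvo : FS st w xc xb a c (rvo' rv.length) = w := by rw [rvo'_eq hW]; simp [fpSt]
include hW in
/-- View of the fixed-point state: the table of the current stage. [folklore] -/
theorem fpSt_rvr : FS st w xc xb a c (rvr' rv.length) = stT (Rin := Rin) k φ Vt σ st := by rw [rvr'_eq hW]; simp [fpSt]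
include hW in
/-- View of the fixed-point state: the working copy. [folklore] -/
theorem fpSt_rvc : FS st w xc xb a c (rvc' rv.length) = xc := by rw [rvc'_eq hW]; simp [fpSt]
include hW in
/-- View of the fixed-point state: the builder of the next stage. [folklore] -/
theorem fpSt_rvb : FS st w xc xb a c (rvb' rv.length) = xb := by rw [rvb'_eq hW]; simp [fpSt]

/-- View of the fixed-point state: stage counters of other levels are untouched. [folklore] -/
theorem fpSt_rvo_ne {m' : ℕ} (hm : m' ≠ rv.length) : FS st w xc xb a c (rvo' m') = R (rvo' m') := by
  by_cases h : m' < W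
  · rw [rvo'_eq h]; simp [fpSt, hm]
  · rw [show (rvo' m' : ER A V W P) = junk from dif_neg h]; rfl
/-- View of the fixed-point state: relation tables of other levels are untouched. [folklore] -/
theorem fpSt_rvr_ne {m' : ℕ} (hm : m' ≠ rv.length) : FS st w xc xb a c (rvr' m') = R (rvr' m') := by
  by_cases h : m' < W
  · rw [rvr'_eq h]; simp [fpSt, hm]
  · rw [show (rvr' m' : ER A V W P) = junk from dif_neg h]; rfl
/-- View of the fixed-point state: working copies of other levels are untouched. [folklore] -/
theorem fpSt_rvc_ne {m' : ℕ} (hm : m' ≠ rv.length) : FS st w xc xb a c (rvc' m') = R (rvc' m') := by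
  by_cases h : m' < W
  · rw [rvc'_eq h]; simp [fpSt, hm]
  · rw [show (rvc' m' : ER A V W P) = junk from dif_neg h]; rfl
/-- View of the fixed-point state: builders of other levels are untouched. [folklore] -/
theorem fpSt_rvb_ne {m' : ℕ} (hm : m' ≠ rv.length) : FS st w xc xb a c (rvb' m') = R (rvb' m') := by
  by_cases h : m' < W
  · rw [rvb'_eq h]; simp [fpSt, hm]
  · rw [show (rvb' m' : ER A V W P) = junk from dif_neg h]; rfl

/-- View of the fixed-point state: `nn` is untouched. [folklore] -/
@[simp] theorem fpSt_nn : FS st w xc xb a c nn = R nn := rfl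
/-- View of the fixed-point state: `junk` is untouched. [folklore] -/
@[simp] theorem fpSt_junk : FS st w xc xb a c junk = R junk := rfl
/-- View of the fixed-point state: scratch registers are untouched. [folklore] -/
@[simp] theorem fpSt_s (i : Fin 8) : FS st w xc xb a c (s i) = R (s i) := rfl
/-- View of the fixed-point state: input tables are untouched. [folklore] -/
theorem fpSt_tbl' (i : ℕ) : FS st w xc xb a c (tbl' i) = R (tbl' i) := by
  by_cases h : i < A
  · rw [tbl'_eq h]; rfl
  · rw [show (tbl' i : ER A V W P) = junk from dif_neg h]; rfl
/-- View of the fixed-point state: work flags are untouched. [folklore] -/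
theorem fpSt_wk' (d : ℕ) (i : Fin 3) : FS st w xc xb a c (wk' d i) = R (wk' d i) := by
  by_cases h : d < P
  · rw [wk'_eq h]; rfl
  · rw [show (wk' d i : ER A V W P) = junk from dif_neg h]; rfl

/-! #### Updates of the view -/

include hV in
/-- Writing a digit register of a new level updates the digit view `a`. [folklore] -/
theorem fpSt_update_xv {l : ℕ} (hl : l < k) (v : ℕ) :
    Function.update (FS st w xc xb a c) (xv' (n + l)) (Literature.Computability.Complexity.ones v) = FS st w xc xb (Function.update a l v) c := by
  ext r : 1
  by_cases h : r = xv' (n + l)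
  · subst h; rw [Function.update_self, fpSt_xv_mid k φ R Vt σ _ _ _ _ _ _ hV hl, Function.update_self]
  · rw [Function.update_of_ne h]
    cases r <;> (simp only [fpSt]; try rfl)
    rename_i j
    split_ifs with hj
    · congr 2
      rw [Function.update_of_ne]
      intro he
      apply h
      rw [xv'_eq (by omega)]; congr 1; ext; simp; omega
    · rfl

include hV in
/-- Clearing a digit register of a new level sets the digit to `0`. [folklore] -/
theorem fpSt_update_xv_nil {l : ℕ} (hl : l < k) :
    Function.update (FS st w xc xb a c) (xv' (n + l)) [] = FS st w xc xb (Function.update a l 0) c :=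
  fpSt_update_xv k φ R Vt σ st w xc xb a c hV hl 0

include hV in
/-- Writing a loop register of a new level updates the counter view `c`. [folklore] -/
theorem fpSt_update_lp {l : ℕ} (hl : l < k) (x : List Bool) :
    Function.update (FS st w xc xb a c) (lp' (n + l)) x = FS st w xc xb a (Function.update c l x) := by
  ext r : 1
  by_cases h : r = lp' (n + l)
  · subst h; rw [Function.update_self, fpSt_lp_mid k φ R Vt σ _ _ _ _ _ _ hV hl, Function.update_self]
  · rw [Function.update_of_ne h]
    cases r <;> (simp only [fpSt]; try rfl)
    rename_i j
    split_ifs with hj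
    · rw [Function.update_of_ne]
      intro he
      apply h
      rw [lp'_eq (by omega)]; congr 1; ext; simp; omega
    · rfl

include hW in
/-- Writing the stage counter. [folklore] -/
theorem fpSt_update_rvo (w' : List Bool) :
    Function.update (FS st w xc xb a c) (rvo' rv.length) w' = FS st w' xc xb a c := by
  ext r : 1
  by_cases h : r = rvo' rv.length
  · subst h; rw [Function.update_self, fpSt_rvo k φ R Vt σ _ _ _ _ _ _ hW]
  · rw [Function.update_of_ne h]
    cases r <;> (simp only [fpSt]; try rfl)
    rename_i m'
    split_ifs with hm
    · exfalso; apply h; rw [rvo'_eq hW]; congr 1; ext; exact hm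
    · rfl

include hW in
/-- Writing the working copy. [folklore] -/
theorem fpSt_update_rvc (x : List Bool) :
    Function.update (FS st w xc xb a c) (rvc' rv.length) x = FS st w x xb a c := by
  ext r : 1
  by_cases h : r = rvc' rv.length
  · subst h; rw [Function.update_self, fpSt_rvc k φ R Vt σ _ _ _ _ _ _ hW]
  · rw [Function.update_of_ne h]
    cases r <;> (simp only [fpSt]; try rfl)
    rename_i m'
    split_ifs with hm
    · exfalso; apply h; rw [rvc'_eq hW]; congr 1; ext; exact hm
    · rfl

include hW in
/-- Writing the builder. [folklore] -/
theorem fpSt_update_rvb (x : List Bool) :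
    Function.update (FS st w xc xb a c) (rvb' rv.length) x = FS st w xc x a c := by
  ext r : 1
  by_cases h : r = rvb' rv.length
  · subst h; rw [Function.update_self, fpSt_rvb k φ R Vt σ _ _ _ _ _ _ hW]
  · rw [Function.update_of_ne h]
    cases r <;> (simp only [fpSt]; try rfl)
    rename_i m'
    split_ifs with hm
    · exfalso; apply h; rw [rvb'_eq hW]; congr 1; ext; exact hm
    · rfl

/-- Updating a pass-through register (work flags) updates the base. [folklore] -/
theorem fpSt_update_wk' (d : ℕ) (i : Fin 3) (x : List Bool) :
    Function.update (FS st w xc xb a c) (wk' d i) x = fpSt (Rin := Rin) k φ (Function.update R (wk' d i) x) Vt σ st w xc xb a c := by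
  ext r : 1
  by_cases h : r = wk' d i
  · subst h; rw [Function.update_self, fpSt_wk', Function.update_self]
  · rw [Function.update_of_ne h]
    cases r <;> simp only [fpSt, Function.update_of_ne h]

end FpSt


section FpBody

variable (k : ℕ) (φ : Formula (2 :: ar) (k :: rv) (n + k)) (R : Literature.Computability.Complexity.Regs (ER A V W P)) (Vt : RVAssign rv N)
  (σ : Fin n → Fin N) (dp : ℕ)

/-- The digits of a tuple as a function on levels. [folklore] -/
def digitsOf (a : Fin k → Fin N) : ℕ → ℕ := fun l => if h : l < k then (a ⟨l, h⟩ : ℕ) else 0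

local notation "FS" => fpSt (A := A) (V := V) (W := W) (P := P) (Rin := Rin) k φ

/-- **The child invariant** inside the fixed-point machinery: on the canonical register file (with
any contents of the transient flag `wk' dp 1` in the base) the body's subformula sees the extended
valuation `σ ⧺ a` and the current stage as relation variable `0`. [folklore] -/
theorem inv_fpChild (hI : Inv (A := A) (V := V) (W := W) (P := P) N Rin Vt σ dp R) (hV : n + k < V) (hW : rv.length < W)
    (hP : dp + 1 < P) (f1 : List Bool) (a : Fin k → Fin N) (st : ℕ) (w xc xb : List Bool) (c : ℕ → List Bool) :
    Inv (A := A) (V := V) (W := W) (P := P) N Rin (RVAssign.cons (ifpStages (fpOp (Rin := Rin) k φ Vt σ) st) Vt)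
      (Fin.append σ a) (dp + 1)
      (fpSt (Rin := Rin) k φ (Function.update R (wk' dp 1) f1) Vt σ st w xc xb (digitsOf k a) c) := by
  have hP0 : dp < P := by omega
  have hbase : ∀ r : ER A V W P, r ≠ wk' dp 1 → Function.update R (wk' dp 1) f1 r = R r :=
    fun r hr => Function.update_of_ne hr _ _
  refine ⟨hI.hA, ?_, ?_, ?_, ?_, ?_, ?_, ?_, ?_, ?_, ?_⟩
  · rw [fpSt_nn, hbase _ (by rw [wk'_eq hP0]; simp)]; exact hI.nn
  · intro i
    have hiA : (i : ℕ) < A := lt_of_lt_of_le i.2 hI.hA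
    rw [fpSt_tbl', hbase _ (by rw [tbl'_eq hiA, wk'_eq hP0]; simp)]; exact hI.tbl i
  · intro j
    by_cases hj : (j : ℕ) < n
    · rw [fpSt_xv_lo k φ _ Vt σ _ _ _ _ _ _ hj, hbase _ (by rw [xv'_eq (by omega), wk'_eq hP0]; simp)]
      have := hI.xv ⟨j, hj⟩
      rw [this]; congr 1
      have e : j = Fin.castAdd k ⟨j, hj⟩ := Fin.ext rfl
      conv_rhs => rw [e, Fin.append_left]
    · obtain ⟨l, hl⟩ : ∃ l, (j : ℕ) = n + l := ⟨j - n, by omega⟩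
      have hlk : l < k := by have := j.2; omega
      rw [show (xv' (j : ℕ) : ER A V W P) = xv' (n + l) by rw [hl], fpSt_xv_mid k φ _ Vt σ _ _ _ _ _ _ (by omega) hlk]
      congr 1
      have e : j = Fin.natAdd n ⟨l, hlk⟩ := Fin.ext (by simp [hl])
      rw [e, Fin.append_right]; simp [digitsOf, hlk]
  · intro j hj
    rw [fpSt_xv_hi k φ _ Vt σ _ _ _ _ _ _ hj]
    by_cases hjV : j < V
    · rw [hbase _ (by rw [xv'_eq hjV, wk'_eq hP0]; simp)]; exact hI.xv_hi j (by omega)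
    · rw [show (xv' j : ER A V W P) = junk from dif_neg hjV, hbase _ (by rw [wk'_eq hP0]; simp)]; exact hI.junk
  · intro j hj
    rw [fpSt_lp_hi k φ _ Vt σ _ _ _ _ _ _ hj]
    by_cases hjV : j < V
    · rw [hbase _ (by rw [lp'_eq hjV, wk'_eq hP0]; simp)]; exact hI.lp_hi j (by omega)
    · rw [show (lp' j : ER A V W P) = junk from dif_neg hjV, hbase _ (by rw [wk'_eq hP0]; simp)]; exact hI.junk
  · intro jj
    rcases jj with ⟨jj, hjj⟩
    cases jj with
    | zero =>
      show fpSt k φ _ Vt σ st w xc xb _ c (rvr' ((k :: rv).length - 1 - 0)) = _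
      rw [show (k :: rv).length - 1 - 0 = rv.length by simp, fpSt_rvr k φ _ Vt σ _ _ _ _ _ _ hW]
      rfl
    | succ j =>
      have hj : j < rv.length := by simpa using hjj
      show fpSt k φ _ Vt σ st w xc xb _ c (rvr' ((k :: rv).length - 1 - (j + 1))) = _
      rw [show (k :: rv).length - 1 - (j + 1) = rv.length - 1 - j by simp; omega,
        fpSt_rvr_ne k φ _ Vt σ _ _ _ _ _ _ (by omega),
        hbase _ (by rw [rvr'_eq (by omega), wk'_eq hP0]; simp)]
      exact hI.rvr ⟨j, hj⟩
  · intro m hm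
    have hm' : m ≠ rv.length := by simp at hm; omega
    rw [fpSt_rvr_ne k φ _ Vt σ _ _ _ _ _ _ hm', fpSt_rvc_ne k φ _ Vt σ _ _ _ _ _ _ hm',
      fpSt_rvb_ne k φ _ Vt σ _ _ _ _ _ _ hm', fpSt_rvo_ne k φ _ Vt σ _ _ _ _ _ _ hm']
    by_cases hmW : m < W
    · rw [hbase _ (by rw [rvr'_eq hmW, wk'_eq hP0]; simp), hbase _ (by rw [rvc'_eq hmW, wk'_eq hP0]; simp),
        hbase _ (by rw [rvb'_eq hmW, wk'_eq hP0]; simp), hbase _ (by rw [rvo'_eq hmW, wk'_eq hP0]; simp)]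
      exact hI.rv_hi m (by simp at hm; omega)
    · rw [show (rvr' m : ER A V W P) = junk from dif_neg hmW, show (rvc' m : ER A V W P) = junk from dif_neg hmW,
        show (rvb' m : ER A V W P) = junk from dif_neg hmW, show (rvo' m : ER A V W P) = junk from dif_neg hmW,
        hbase _ (by rw [wk'_eq hP0]; simp)]
      exact ⟨hI.junk, hI.junk, hI.junk, hI.junk⟩
  · intro d hd i
    rw [fpSt_wk']
    by_cases hdP : d < P
    · rw [hbase _ (by rw [wk'_eq hdP, wk'_eq hP0]; intro h; cases h; omega)]; exact hI.wk d (by omega) i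
    · rw [show (wk' d i : ER A V W P) = junk from dif_neg hdP, hbase _ (by rw [wk'_eq hP0]; simp)]; exact hI.junk
  · intro i; rw [fpSt_s, hbase _ (by rw [wk'_eq hP0]; simp)]; exact hI.scratch i
  · rw [fpSt_junk, hbase _ (by rw [wk'_eq hP0]; simp)]; exact hI.junk


variable {k φ R Vt σ dp}

/-- Merging the two flags into the new bit. [folklore] -/
theorem runs_fpMerge (hW : rv.length < W) (hP : dp + 1 < P) (hw1 : R (wk' dp 1) = []) (hw0 : R (wk' (dp + 1) 0) = [])
    (b₀ b₁ : Bool) (st : ℕ) (w xc xb : List Bool) (a : ℕ → ℕ) (c : ℕ → List Bool) :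
    Runs (fpMerge (A := A) (V := V) (W := W) (P := P) rv dp)
      (FS (Function.update (Function.update R (wk' dp 1) (Literature.Computability.Complexity.flag b₀)) (wk' (dp + 1) 0) (Literature.Computability.Complexity.flag b₁)) Vt σ st w xc xb a c)
      (FS R Vt σ st w xc ((b₀ || b₁) :: xb) a c) 5 := by
  have hP0 : dp < P := by omega
  have hne : (wk' (dp + 1) 0 : ER A V W P) ≠ wk' dp 1 := by rw [wk'_eq hP0, wk'_eq hP]; simp
  have hneb1 : (rvb' rv.length : ER A V W P) ≠ wk' dp 1 := by rw [rvb'_eq hW, wk'_eq hP0]; simp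
  have hneb0 : (rvb' rv.length : ER A V W P) ≠ wk' (dp + 1) 0 := by rw [rvb'_eq hW, wk'_eq hP]; simp
  set R₂ := Function.update (Function.update R (wk' dp 1) (Literature.Computability.Complexity.flag b₀)) (wk' (dp + 1) 0) (Literature.Computability.Complexity.flag b₁) with hR₂
  have r1 : FS R₂ Vt σ st w xc xb a c (wk' dp 1) = Literature.Computability.Complexity.flag b₀ := by
    rw [fpSt_wk', hR₂, Function.update_of_ne hne.symm, Function.update_self]
  have r0 : FS R₂ Vt σ st w xc xb a c (wk' (dp + 1) 0) = Literature.Computability.Complexity.flag b₁ := by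
    rw [fpSt_wk', hR₂, Function.update_self]
  -- popping both flags returns to the base `R`
  have hpop1 : Function.update R₂ (wk' dp 1) [] = Function.update R (wk' (dp + 1) 0) (Literature.Computability.Complexity.flag b₁) := by
    rw [hR₂, Function.update_comm hne, Function.update_idem, Function.update_comm hne.symm,
      Function.update_eq_self_iff.mpr]
    rw [Function.update_of_ne hne.symm, hw1]
  have hpop0 : ∀ T : Literature.Computability.Complexity.Regs (ER A V W P), T (wk' (dp + 1) 0) = [] →
      Function.update (Function.update T (wk' (dp + 1) 0) (Literature.Computability.Complexity.flag b₁)) (wk' (dp + 1) 0) [] = T := by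
    intro T hT; rw [Function.update_idem, Function.update_eq_self_iff, hT]
  -- the inner pop-and-push, from base `update R (wk' (dp+1) 0) (flag b₁)` (flag `wk' dp 1` already gone)
  have inner : ∀ (bt bf : Bool),
      Runs (pop (wk' (dp + 1) 0) (push (rvb' rv.length) true) skip (push (rvb' rv.length) bf))
        (FS (Function.update R (wk' (dp + 1) 0) (Literature.Computability.Complexity.flag b₁)) Vt σ st w xc xb a c)
        (FS R Vt σ st w xc ((if b₁ then true else bf) :: xb) a c) 3 := by
    intro bt bf
    have rr : FS (Function.update R (wk' (dp + 1) 0) (Literature.Computability.Complexity.flag b₁)) Vt σ st w xc xb a c (wk' (dp + 1) 0) = Literature.Computability.Complexity.flag b₁ := by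
      rw [fpSt_wk', Function.update_self]
    cases b₁
    · rw [Literature.Computability.Complexity.flag_false] at rr ⊢
      simp only [Bool.false_eq_true, if_false]
      refine (Runs.pop_nil _ _ rr (Runs.push' ?_)).mono (by omega)
      rw [fpSt_rvb k φ _ Vt σ _ _ _ _ _ _ hW, fpSt_update_rvb k φ _ Vt σ _ _ _ _ _ _ hW,
        Function.update_eq_self_iff.mpr hw0.symm]
    · rw [Literature.Computability.Complexity.flag_true] at rr ⊢
      simp only [if_true]
      refine (Runs.pop_true _ _ rr (Runs.push' ?_)).mono (by omega)
      have e := hpop0 R hw0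
      rw [Literature.Computability.Complexity.flag_true] at e
      rw [fpSt_update_wk', e, fpSt_rvb k φ _ Vt σ _ _ _ _ _ _ hW, fpSt_update_rvb k φ _ Vt σ _ _ _ _ _ _ hW]
  unfold fpMerge
  cases b₀
  · rw [Literature.Computability.Complexity.flag_false] at r1
    rw [Bool.false_or]
    refine (Runs.pop_nil _ _ r1 ?_).mono (by omega : 3 + 2 ≤ 5)
    have e : R₂ = Function.update R (wk' (dp + 1) 0) (Literature.Computability.Complexity.flag b₁) := by
      rw [hR₂, Literature.Computability.Complexity.flag_false]
      congr 1
      exact Function.update_eq_self_iff.mpr hw1.symm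
    rw [e]
    have := inner true false
    cases b₁ <;> simpa using this
  · rw [Literature.Computability.Complexity.flag_true] at r1
    rw [Bool.true_or]
    refine (Runs.pop_true _ _ r1 ?_).mono (by omega : 3 + 2 ≤ 5)
    rw [fpSt_update_wk', hpop1]
    have := inner true true
    cases b₁ <;> simpa using this


/-- The index of a tuple. [folklore] -/
abbrev idxOf (a : Fin k → Fin N) : ℕ := (finFunctionFinEquiv a : ℕ)

/-- The bit of the stage table at the index of a tuple is membership in the stage. [Gurevich 1984, §4 Claim 2] [folklore] -/
theorem stT_getElem? (st : ℕ) (a : Fin k → Fin N) :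
    (stT (Rin := Rin) k φ Vt σ st)[idxOf a]? = some (bv (a ∈ ifpStages (fpOp (Rin := Rin) k φ Vt σ) st)) :=
  getElem?_tableOf _ a

/-- The stage table from the index of a tuple on starts with the membership bit of the tuple. [folklore] -/
theorem stT_drop_idx (st : ℕ) (a : Fin k → Fin N) :
    (stT (Rin := Rin) k φ Vt σ st).drop (idxOf a) =
      bv (a ∈ ifpStages (fpOp (Rin := Rin) k φ Vt σ) st) :: (stT (Rin := Rin) k φ Vt σ st).drop (idxOf a + 1) := by
  apply List.ext_getElem?
  intro i
  rcases i with _ | i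
  · rw [List.getElem?_drop, Nat.add_zero, stT_getElem?]; rfl
  · rw [List.getElem?_drop, List.getElem?_cons_succ, List.getElem?_drop]; congr 1; omega

/-- The next (inflationary) stage at a tuple: old bit OR the body at the tuple. [Gurevich 1984, §4 (IFP: `X ∪ F(X)`), Claim 2] [folklore] -/
theorem stT_succ_getElem? (st : ℕ) (a : Fin k → Fin N) :
    (stT (Rin := Rin) k φ Vt σ (st + 1))[idxOf a]? =
      some (bv (a ∈ ifpStages (fpOp (Rin := Rin) k φ Vt σ) st) ||
        bv (φ.eval (withNatOrder Rin) (RVAssign.cons (ifpStages (fpOp (Rin := Rin) k φ Vt σ) st) Vt) (Fin.append σ a))) := by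
  rw [stT_getElem?]
  congr 1
  apply Bool.eq_iff_iff.mpr
  rw [bv_eq_true_iff, Bool.or_eq_true, bv_eq_true_iff, bv_eq_true_iff]
  rfl

/-- `(l.take (i+1)).reverse = l[i] :: (l.take i).reverse`. [folklore] -/
theorem take_succ_reverse {α : Type} (l : List α) (i : ℕ) (x : α) (h : l[i]? = some x) :
    (l.take (i + 1)).reverse = x :: (l.take i).reverse := by
  rw [List.take_add_one, h]; simp

/-- **One body run**: from count `i = idx a` to count `i + 1`. [folklore] -/
theorem runs_fpBody (hI : Inv (A := A) (V := V) (W := W) (P := P) N Rin Vt σ dp R) (hV : n + k + fvars φ < V)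
    (hW : rv.length + 1 + frels φ < W) (hP : dp + 1 + fdepth φ < P) (cφ : ℕ)
    (hφ : Spec (A := A) (V := V) (W := W) (P := P) N Rin φ (dp + 1) cφ)
    (a : Fin k → Fin N) (st : ℕ) (w : List Bool) (c : ℕ → List Bool) :
    Runs (fpBody (A := A) (V := V) (W := W) (P := P) k φ dp)
      (FS R Vt σ st w ((stT (Rin := Rin) k φ Vt σ st).drop (idxOf a))
        (((stT (Rin := Rin) k φ Vt σ (st + 1)).take (idxOf a)).reverse) (digitsOf k a) c)
      (FS R Vt σ st w ((stT (Rin := Rin) k φ Vt σ st).drop (idxOf a + 1))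
        (((stT (Rin := Rin) k φ Vt σ (st + 1)).take (idxOf a + 1)).reverse) (digitsOf k a) c) (cφ + 9) := by
  have hP0 : dp < P := by omega
  have hP1 : dp + 1 < P := by omega
  have hWm : rv.length < W := by omega
  have hw1 : R (wk' dp 1) = [] := hI.wk dp le_rfl 1
  have hw0 : R (wk' (dp + 1) 0) = [] := hI.wk (dp + 1) (by omega) 0
  set S₀ := ifpStages (fpOp (Rin := Rin) k φ Vt σ) st with hS₀
  set b₀ := bv (a ∈ S₀) with hb₀
  set b₁ := bv (φ.eval (withNatOrder Rin) (RVAssign.cons S₀ Vt) (Fin.append σ a)) with hb₁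
  set T := stT (Rin := Rin) k φ Vt σ st with hT
  set T' := stT (Rin := Rin) k φ Vt σ (st + 1) with hT'
  set xb := ((T'.take (idxOf a)).reverse) with hxb
  -- step 1: pop the old bit into `wk' dp 1`
  have s1 : Runs (pop (rvc' rv.length) (push (wk' dp 1) true) skip skip)
      (FS R Vt σ st w (T.drop (idxOf a)) xb (digitsOf k a) c)
      (FS (Function.update R (wk' dp 1) (Literature.Computability.Complexity.flag b₀)) Vt σ st w (T.drop (idxOf a + 1)) xb (digitsOf k a) c) 3 := by
    have hd : FS R Vt σ st w (T.drop (idxOf a)) xb (digitsOf k a) c (rvc' rv.length) = b₀ :: T.drop (idxOf a + 1) := by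
      rw [fpSt_rvc k φ _ Vt σ _ _ _ _ _ _ hWm, hT, hb₀, hS₀, stT_drop_idx]
    cases hb : b₀
    · rw [hb] at hd
      refine (Runs.pop_false _ _ hd (Runs.skip _)).of_eq ?_ (by omega)
      rw [fpSt_update_rvc k φ _ Vt σ _ _ _ _ _ _ hWm, Literature.Computability.Complexity.flag_false, Function.update_eq_self_iff.mpr hw1.symm]
    · rw [hb] at hd
      refine (Runs.pop_true _ _ hd (Runs.push' ?_)).of_eq rfl (by omega)
      rw [fpSt_update_rvc k φ _ Vt σ _ _ _ _ _ _ hWm, fpSt_wk', hw1, fpSt_update_wk', Literature.Computability.Complexity.flag_true]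
  -- step 2: the child
  have hIc := inv_fpChild k φ R Vt σ dp hI (by omega) hWm hP1 (Literature.Computability.Complexity.flag b₀) a st w (T.drop (idxOf a + 1)) xb c
  have s2 := hφ _ _ _ hIc (by omega) (by simp; omega) (by omega)
  rw [fpSt_update_wk'] at s2
  -- step 3: merge
  have s3 := runs_fpMerge (Rin := Rin) (k := k) (φ := φ) (R := R) (Vt := Vt) (σ := σ) (dp := dp) hWm hP1 hw1 hw0 b₀ b₁ st w
    (T.drop (idxOf a + 1)) xb (digitsOf k a) c
  have hxb' : ((T'.take (idxOf a + 1)).reverse) = (b₀ || b₁) :: xb := by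
    rw [hxb, take_succ_reverse T' (idxOf a) (b₀ || b₁)]
    rw [hT', hb₀, hb₁, hS₀, stT_succ_getElem?]
  rw [hxb']
  unfold fpBody
  exact (s1.seq (s2.seq s3)).of_eq rfl (by omega : 3 + (cφ + 5) ≤ cφ + 9)


/-! #### Enumerating all tuples -/

/-- The index of a `k`-tuple over `Fin N` is `< N ^ k`. [folklore] -/
theorem idxOf_lt (a : Fin k → Fin N) : idxOf a < N ^ k := (finFunctionFinEquiv a).2

/-- Setting a zero digit `d` to `r` adds `r · N^d` to the index. [folklore] -/
theorem idxOf_update_of_zero (a : Fin k → Fin N) (d : Fin k) (hd : (a d : ℕ) = 0) (r : Fin N) :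
    idxOf (Function.update a d r) = idxOf a + r * N ^ (d : ℕ) := by
  simp only [idxOf, finFunctionFinEquiv_apply]
  rw [← Finset.add_sum_erase Finset.univ _ (Finset.mem_univ d), ← Finset.add_sum_erase Finset.univ _ (Finset.mem_univ d),
    Function.update_self, hd, zero_mul, zero_add, add_comm]
  congr 1
  apply Finset.sum_congr rfl
  intro x hx
  rw [Function.update_of_ne (Finset.ne_of_mem_erase hx)]

/-- The digit view commutes with updating one digit. [folklore] -/
theorem digitsOf_update (a : Fin k → Fin N) (d : Fin k) (r : Fin N) :
    digitsOf k (Function.update a d r) = Function.update (digitsOf k a) d r := by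
  funext l
  by_cases hld : l = (d : ℕ)
  · subst hld
    rw [Function.update_self]
    simp only [digitsOf, dif_pos d.2]
    rw [show (⟨(d : ℕ), d.2⟩ : Fin k) = d from Fin.ext rfl, Function.update_self]
  · rw [Function.update_of_ne hld]
    simp only [digitsOf]
    by_cases hl : l < k
    · rw [dif_pos hl, dif_pos hl, Function.update_of_ne]
      intro h; apply hld; rw [← h]
    · rw [dif_neg hl, dif_neg hl]

/-- The cost of enumerating `d` digits. [folklore] -/
def enumCost (N cb : ℕ) : ℕ → ℕ
  | 0 => cb
  | d + 1 => 10 * N + 3 + (N * (enumCost N cb d + 1 + 2) + 1) + (2 * N + 1)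

/-- `(map f (range (d+1))).reverse = f d :: (map f (range d)).reverse`. [folklore] -/
theorem range_map_succ_reverse (f : ℕ → ℕ) (d : ℕ) :
    ((List.range (d + 1)).map f).reverse = f d :: ((List.range d).map f).reverse := by
  rw [List.range_succ, List.map_append, List.reverse_append]; simp

/-- **Enumeration of the `d` lowest digits**: the count advances by `N ^ d`; digits and loop
registers return to their initial values. [folklore] -/
theorem runs_enum (hI : Inv (A := A) (V := V) (W := W) (P := P) N Rin Vt σ dp R) (hV : n + k + fvars φ < V)
    (hW : rv.length + 1 + frels φ < W) (hP : dp + 1 + fdepth φ < P) (cφ : ℕ)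
    (hφ : Spec (A := A) (V := V) (W := W) (P := P) N Rin φ (dp + 1) cφ) (st : ℕ) (w : List Bool) :
    ∀ (d : ℕ) (_ : d ≤ k) (a : Fin k → Fin N) (_ : ∀ l : Fin k, (l : ℕ) < d → (a l : ℕ) = 0)
      (c : ℕ → List Bool) (_ : ∀ l, l < d → c l = []),
    Runs (enumLoops (fpBody (A := A) (V := V) (W := W) (P := P) k φ dp) (((List.range d).map (fun l => n + l)).reverse))
      (FS R Vt σ st w ((stT (Rin := Rin) k φ Vt σ st).drop (idxOf a))
        (((stT (Rin := Rin) k φ Vt σ (st + 1)).take (idxOf a)).reverse) (digitsOf k a) c)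
      (FS R Vt σ st w ((stT (Rin := Rin) k φ Vt σ st).drop (idxOf a + N ^ d))
        (((stT (Rin := Rin) k φ Vt σ (st + 1)).take (idxOf a + N ^ d)).reverse) (digitsOf k a) c)
      (enumCost N (cφ + 9) d)
  | 0, _, a, _, c, _ => by
    simp only [List.range_zero, List.map_nil, List.reverse_nil, enumLoops, pow_zero, enumCost]
    exact runs_fpBody (Rin := Rin) hI hV hW hP cφ hφ a st w c
  | d + 1, hd, a, ha, c, hc => by
    have hnV : n + k ≤ V := by omega
    have hWm : rv.length < W := by omega
    have hdV : n + d < V := by omega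
    set T := stT (Rin := Rin) k φ Vt σ st with hT
    set T' := stT (Rin := Rin) k φ Vt σ (st + 1) with hT'
    rw [range_map_succ_reverse]
    simp only [enumLoops]
    -- the inner loop, by induction on the remaining count
    have inner : ∀ (rem r : ℕ) (hr : r + rem = N) (hrN : r ≤ N),
        Runs (loop (lp' (n + d)) (enumLoops (fpBody (A := A) (V := V) (W := W) (P := P) k φ dp)
            ((List.range d).map (fun l => n + l)).reverse ;; push (xv' (n + d)) true)
          (enumLoops (fpBody k φ dp) ((List.range d).map (fun l => n + l)).reverse ;; push (xv' (n + d)) true))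
          (FS R Vt σ st w (T.drop (idxOf a + r * N ^ d)) ((T'.take (idxOf a + r * N ^ d)).reverse)
            (Function.update (digitsOf k a) d r) (Function.update c d (Literature.Computability.Complexity.ones rem)))
          (FS R Vt σ st w (T.drop (idxOf a + N * N ^ d)) ((T'.take (idxOf a + N * N ^ d)).reverse)
            (Function.update (digitsOf k a) d N) (Function.update c d []))
          (rem * (enumCost N (cφ + 9) d + 1 + 2) + 1) := by
      intro rem
      induction rem with
      | zero =>
        intro r hr _
        have hrN : r = N := by omega
        subst hrN
        refine (Runs.loop_nil _ _ ?_).of_eq (by rw [show Literature.Computability.Complexity.ones 0 = [] from rfl]) (by simp)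
        rw [fpSt_lp_mid k φ _ Vt σ _ _ _ _ _ _ hnV (by omega), Function.update_self]; rfl
      | succ rem ih =>
        intro r hr hrN
        have hrlt : r < N := by omega
        -- the tuple with digit `d` set to `r`
        let a' : Fin k → Fin N := Function.update a ⟨d, by omega⟩ ⟨r, hrlt⟩
        have ha' : digitsOf k a' = Function.update (digitsOf k a) d r := digitsOf_update a _ _
        have hidx : idxOf a' = idxOf a + r * N ^ d := idxOf_update_of_zero a ⟨d, by omega⟩ (ha _ (by simp)) ⟨r, hrlt⟩
        have hbody := runs_enum hI hV hW hP cφ hφ st w d (by omega) a'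
          (fun l hl => by
            show ((Function.update a ⟨d, _⟩ ⟨r, hrlt⟩ l : Fin N) : ℕ) = 0
            rw [Function.update_of_ne (by intro h; subst h; simp at hl)]; exact ha l (by omega))
          (Function.update c d (Literature.Computability.Complexity.ones rem)) (fun l hl => by rw [Function.update_of_ne (by omega)]; exact hc l (by omega))
        rw [ha', hidx] at hbody
        have hpush : Runs (push (xv' (n + d)) true)
            (FS R Vt σ st w (T.drop (idxOf a + r * N ^ d + N ^ d)) ((T'.take (idxOf a + r * N ^ d + N ^ d)).reverse)
              (Function.update (digitsOf k a) d r) (Function.update c d (Literature.Computability.Complexity.ones rem)))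
            (FS R Vt σ st w (T.drop (idxOf a + (r + 1) * N ^ d)) ((T'.take (idxOf a + (r + 1) * N ^ d)).reverse)
              (Function.update (digitsOf k a) d (r + 1)) (Function.update c d (Literature.Computability.Complexity.ones rem))) 1 := by
          refine Runs.push' ?_
          rw [fpSt_xv_mid k φ _ Vt σ _ _ _ _ _ _ hnV (by omega), Function.update_self, ← ones_succ,
            fpSt_update_xv k φ _ Vt σ _ _ _ _ _ _ hnV (by omega), Function.update_idem,
            show idxOf a + r * N ^ d + N ^ d = idxOf a + (r + 1) * N ^ d by ring]
        have ih' := ih (r + 1) (by omega) (by omega)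
        rw [show (rem + 1) * (enumCost N (cφ + 9) d + 1 + 2) + 1 =
          (enumCost N (cφ + 9) d + 1) + 2 + (rem * (enumCost N (cφ + 9) d + 1 + 2) + 1) by ring]
        refine Runs.loop_true (w := Literature.Computability.Complexity.ones rem) ?_ ?_ ih'
        · rw [fpSt_lp_mid k φ _ Vt σ _ _ _ _ _ _ hnV (by omega), Function.update_self]; rfl
        · rw [fpSt_update_lp k φ _ Vt σ _ _ _ _ _ _ hnV (by omega), Function.update_idem]
          exact hbody.seq hpush
    -- copy the counter
    have c1 := runs_copy (a := nn) (b := lp' (n + d)) (t := s 0) (u := s 1) (by rw [lp'_eq hdV]; simp) (by simp) (by simp)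
      (by rw [lp'_eq hdV]; simp) (by rw [lp'_eq hdV]; simp) (by simp)
      (FS R Vt σ st w (T.drop (idxOf a)) ((T'.take (idxOf a)).reverse) (digitsOf k a) c)
      (by rw [fpSt_s]; exact hI.scratch 0) (by rw [fpSt_s]; exact hI.scratch 1)
    rw [fpSt_nn, hI.nn, fpSt_lp_mid k φ _ Vt σ _ _ _ _ _ _ hnV (by omega), hc d (by omega), List.append_nil,
      fpSt_update_lp k φ _ Vt σ _ _ _ _ _ _ hnV (by omega)] at c1
    -- the loop
    have c2 := inner N 0 (by omega) (Nat.zero_le _)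
    rw [zero_mul, Nat.add_zero] at c2
    have e0 : Function.update (digitsOf k a) d 0 = digitsOf k a := by
      apply Function.update_eq_self_iff.mpr
      simp only [digitsOf, dif_pos (show d < k by omega)]; exact (ha ⟨d, by omega⟩ (by simp)).symm
    rw [e0] at c2
    -- clear the digit
    have c3 := runs_clear (xv' (n + d))
      (FS R Vt σ st w (T.drop (idxOf a + N * N ^ d)) ((T'.take (idxOf a + N * N ^ d)).reverse)
        (Function.update (digitsOf k a) d N) (Function.update c d []))
    rw [fpSt_xv_mid k φ _ Vt σ _ _ _ _ _ _ hnV (by omega), Function.update_self,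
      fpSt_update_xv_nil k φ _ Vt σ _ _ _ _ _ _ hnV (by omega), Function.update_idem, e0] at c3
    have ec : Function.update c d [] = c := Function.update_eq_self_iff.mpr (hc d (by omega)).symm
    rw [ec] at c2 c3
    simp only [Literature.Computability.Complexity.ones, List.length_replicate] at c1 c3
    rw [show N * N ^ d = N ^ (d + 1) by rw [pow_succ]; ring] at c3
    rw [show N * N ^ d = N ^ (d + 1) by rw [pow_succ]; ring] at c2
    refine (c1.seq (c2.seq c3)).of_eq rfl ?_
    simp only [enumCost]; omega


/-! #### One stage -/

/-- The all-zero tuple has index `0`. [folklore] -/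
theorem idxOf_zero (a₀ : Fin k → Fin N) (h0 : ∀ l, (a₀ l : ℕ) = 0) : idxOf a₀ = 0 := by
  simp only [idxOf, finFunctionFinEquiv_apply]
  apply Finset.sum_eq_zero
  intro l _; rw [h0 l, zero_mul]

/-- A stage table has `N ^ k` bits. [folklore] -/
@[simp] theorem length_stT (st : ℕ) : (stT (Rin := Rin) k φ Vt σ st).length = N ^ k := length_tableOf _

/-- Registers other than the stage table do not depend on the stage parameter of the view. [folklore] -/
theorem fpSt_st_irrel {r : ER A V W P} (hr : r ≠ rvr' rv.length) (hW : rv.length < W) (st st' : ℕ) (w xc xb : List Bool)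
    (a : ℕ → ℕ) (c : ℕ → List Bool) : FS R Vt σ st w xc xb a c r = FS R Vt σ st' w xc xb a c r := by
  cases r <;> simp only [fpSt]
  rename_i m'
  split_ifs with hm
  · exfalso; apply hr; rw [rvr'_eq hW]; congr 1; ext; exact hm
  · rfl

/-- The cost of one stage. [folklore] -/
def stageCost (N k cφ : ℕ) : ℕ := 10 * N ^ k + 3 + enumCost N (cφ + 9) k + (2 * N ^ k + 1) + (3 * N ^ k + 1)

/-- **One stage** of the fixed-point iteration: the table of stage `st + 1` replaces that of stage `st`. [folklore] -/
theorem runs_fpStage (hI : Inv (A := A) (V := V) (W := W) (P := P) N Rin Vt σ dp R) (hV : n + k + fvars φ < V)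
    (hW : rv.length + 1 + frels φ < W) (hP : dp + 1 + fdepth φ < P) (cφ : ℕ)
    (hφ : Spec (A := A) (V := V) (W := W) (P := P) N Rin φ (dp + 1) cφ)
    (a₀ : Fin k → Fin N) (h0 : ∀ l, (a₀ l : ℕ) = 0) (c : ℕ → List Bool) (hc : ∀ l, l < k → c l = [])
    (st : ℕ) (w : List Bool) :
    Runs (fpStage (A := A) (V := V) (W := W) (P := P) k φ dp) (FS R Vt σ st w [] [] (digitsOf k a₀) c)
      (FS R Vt σ (st + 1) w [] [] (digitsOf k a₀) c) (stageCost N k cφ) := by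
  have hnV : n + k ≤ V := by omega
  have hWm : rv.length < W := by omega
  have hP0 : dp < P := by omega
  set T := stT (Rin := Rin) k φ Vt σ st with hT
  set T' := stT (Rin := Rin) k φ Vt σ (st + 1) with hT'
  have hi0 : idxOf a₀ = 0 := idxOf_zero a₀ h0
  -- copy the table
  have c1 := runs_copy (a := rvr' rv.length) (b := rvc' rv.length) (t := s 0) (u := s 1)
    (by rw [rvr'_eq hWm, rvc'_eq hWm]; simp) (by rw [rvr'_eq hWm]; simp) (by rw [rvr'_eq hWm]; simp)
    (by rw [rvc'_eq hWm]; simp) (by rw [rvc'_eq hWm]; simp) (by simp)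
    (FS R Vt σ st w [] [] (digitsOf k a₀) c) (by rw [fpSt_s]; exact hI.scratch 0) (by rw [fpSt_s]; exact hI.scratch 1)
  rw [fpSt_rvr k φ _ Vt σ _ _ _ _ _ _ hWm, fpSt_rvc k φ _ Vt σ _ _ _ _ _ _ hWm, List.append_nil,
    fpSt_update_rvc k φ _ Vt σ _ _ _ _ _ _ hWm] at c1
  -- enumerate
  have c2 := runs_enum (Rin := Rin) hI hV hW hP cφ hφ st w k le_rfl a₀ (fun l _ => h0 l) c hc
  rw [hi0, Nat.zero_add, List.drop_zero, List.take_zero, List.reverse_nil, ← hT, ← hT',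
    List.drop_eq_nil_of_le (by rw [hT, length_stT]), List.take_of_length_le (by rw [hT', length_stT])] at c2
  change Runs _ (FS R Vt σ st w T [] (digitsOf k a₀) c) (FS R Vt σ st w [] T'.reverse (digitsOf k a₀) c) _ at c2
  -- clear and pour
  have c3 := runs_clear (rvr' rv.length) (FS R Vt σ st w [] T'.reverse (digitsOf k a₀) c)
  rw [fpSt_rvr k φ _ Vt σ _ _ _ _ _ _ hWm, ← hT, show T.length = N ^ k by rw [hT, length_stT]] at c3
  set X := Function.update (FS R Vt σ st w [] T'.reverse (digitsOf k a₀) c) (rvr' rv.length) [] with hX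
  have c4 := runs_pour (a := rvb' rv.length) (b := rvr' rv.length) (by rw [rvb'_eq hWm, rvr'_eq hWm]; simp) X
  have hXb : X (rvb' rv.length) = T'.reverse := by
    rw [hX, Function.update_of_ne (by rw [rvb'_eq hWm, rvr'_eq hWm]; simp), fpSt_rvb k φ _ Vt σ _ _ _ _ _ _ hWm]
  have hXr : X (rvr' rv.length) = [] := by rw [hX, Function.update_self]
  rw [hXb, hXr, List.append_nil, List.reverse_reverse, List.length_reverse, show T'.length = N ^ k by rw [hT', length_stT]] at c4
  have hfin : Function.update (Function.update X (rvb' rv.length) []) (rvr' rv.length) T' =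
      FS R Vt σ (st + 1) w [] [] (digitsOf k a₀) c := by
    ext r : 1
    by_cases h1 : r = rvr' rv.length
    · subst h1; rw [Function.update_self, fpSt_rvr k φ _ Vt σ _ _ _ _ _ _ hWm]
    rw [Function.update_of_ne h1]
    by_cases h2 : r = rvb' rv.length
    · subst h2; rw [Function.update_self, fpSt_rvb k φ _ Vt σ _ _ _ _ _ _ hWm]
    rw [Function.update_of_ne h2, hX, Function.update_of_ne h1]
    rw [show FS R Vt σ st w [] T'.reverse (digitsOf k a₀) c r = FS R Vt σ st w [] [] (digitsOf k a₀) c r by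
      rw [← fpSt_update_rvb k φ _ Vt σ st w [] [] (digitsOf k a₀) c hWm T'.reverse, Function.update_of_ne h2]]
    exact fpSt_st_irrel (Rin := Rin) h1 hWm st (st + 1) w [] [] _ c
  rw [hfin] at c4
  unfold fpStage fpLevels
  refine (c1.seq (c2.seq (c3.seq c4))).of_eq rfl ?_
  rw [length_stT]; unfold stageCost; omega


/-! #### All stages, and the fixed-point node -/

/-- The stage loop. [folklore] -/
theorem runs_fpStages (hI : Inv (A := A) (V := V) (W := W) (P := P) N Rin Vt σ dp R) (hV : n + k + fvars φ < V)
    (hW : rv.length + 1 + frels φ < W) (hP : dp + 1 + fdepth φ < P) (cφ : ℕ)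
    (hφ : Spec (A := A) (V := V) (W := W) (P := P) N Rin φ (dp + 1) cφ)
    (a₀ : Fin k → Fin N) (h0 : ∀ l, (a₀ l : ℕ) = 0) (c : ℕ → List Bool) (hc : ∀ l, l < k → c l = []) :
    ∀ (rem st : ℕ),
    Runs (loop (rvo' rv.length) (fpStage (A := A) (V := V) (W := W) (P := P) k φ dp) (fpStage k φ dp))
      (FS R Vt σ st (Literature.Computability.Complexity.ones rem) [] [] (digitsOf k a₀) c) (FS R Vt σ (st + rem) [] [] [] (digitsOf k a₀) c)
      (rem * (stageCost N k cφ + 2) + 1)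
  | 0, st => by
    have hWm : rv.length < W := by omega
    refine (Runs.loop_nil _ _ ?_).of_eq rfl (by simp)
    rw [fpSt_rvo k φ _ Vt σ _ _ _ _ _ _ hWm]; rfl
  | rem + 1, st => by
    have hWm : rv.length < W := by omega
    have hbody := runs_fpStage (Rin := Rin) hI hV hW hP cφ hφ a₀ h0 c hc st (Literature.Computability.Complexity.ones rem)
    have ih := runs_fpStages hI hV hW hP cφ hφ a₀ h0 c hc rem (st + 1)
    rw [show st + 1 + rem = st + (rem + 1) by omega] at ih
    rw [show (rem + 1) * (stageCost N k cφ + 2) + 1 = stageCost N k cφ + 2 + (rem * (stageCost N k cφ + 2) + 1) by ring]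
    refine Runs.loop_true (w := Literature.Computability.Complexity.ones rem) ?_ ?_ ih
    · rw [fpSt_rvo k φ _ Vt σ _ _ _ _ _ _ hWm]; rfl
    · rw [fpSt_update_rvo k φ _ Vt σ _ _ _ _ _ _ hWm]; exact hbody

/-- Filling a register with `false`s under a unary counter. [folklore] -/
theorem runs_fill {q d : ER A V W P} (hqd : q ≠ d) : ∀ (m : ℕ) (T : Literature.Computability.Complexity.Regs (ER A V W P)), T q = Literature.Computability.Complexity.ones m →
    Runs (loop q (push d false) (push d false)) T
      (Function.update (Function.update T q []) d (List.replicate m false ++ T d)) (m * 3 + 1)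
  | 0, T, hq => by
    refine (Runs.loop_nil _ _ hq).of_eq ?_ (by simp)
    rw [List.replicate_zero, List.nil_append]
    have e1 : Function.update T q [] = T := Function.update_eq_self_iff.mpr hq.symm
    rw [e1]
    exact (Function.update_eq_self_iff.mpr rfl).symm
  | m + 1, T, hq => by
    have hbody : Runs (push d false) (Function.update T q (Literature.Computability.Complexity.ones m))
        (Function.update (Function.update T q (Literature.Computability.Complexity.ones m)) d (false :: T d)) 1 :=
      Runs.push' (by rw [Function.update_of_ne hqd.symm])
    have ih := runs_fill hqd m (Function.update (Function.update T q (Literature.Computability.Complexity.ones m)) d (false :: T d))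
      (by rw [Function.update_of_ne hqd, Function.update_self])
    rw [show (m + 1) * 3 + 1 = 1 + 2 + (m * 3 + 1) by ring]
    refine Runs.loop_true (w := Literature.Computability.Complexity.ones m) (by rw [hq]; rfl) hbody (ih.of_eq ?_ le_rfl)
    ext r : 1
    simp only [Function.update_apply]
    split_ifs with h1 h2
    · subst h1
      rw [List.replicate_succ', List.append_assoc]; rfl
    · rfl
    · rfl

/-- **Gurevich's Claim 2**: on a universe of size `N` the inflationary stages of a `k`-ary operator close after `N ^ k` steps, `X_{N^k} = IFP`. [Gurevich 1984, §4 Claim 2 (PDF p. 201)] [cite: Gurevich1984, §4 Claim 2] -/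
theorem ifpStages_pow_eq_ifp (F : Set (Fin k → Fin N) → Set (Fin k → Fin N)) : ifpStages F (N ^ k) = ifp F := by
  obtain ⟨m, hm, h1, h2⟩ := exists_ifp_eq_ifpStages F
  have hcard : Nat.card (Fin k → Fin N) = N ^ k := by
    rw [Nat.card_eq_fintype_card, Fintype.card_fun, Fintype.card_fin, Fintype.card_fin]
  rw [hcard] at hm
  rw [h1, ifpStages_eq_of_eq h2 (N ^ k) hm]

/-- The initial canonical state of the fixed-point machinery. [folklore] -/
theorem fpSt_init (hI : Inv (A := A) (V := V) (W := W) (P := P) N Rin Vt σ dp R) (hW : rv.length < W)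
    (a₀ : Fin k → Fin N) (h0 : ∀ l, (a₀ l : ℕ) = 0) :
    Function.update (Function.update R (rvo' rv.length) (Literature.Computability.Complexity.ones (N ^ k))) (rvr' rv.length) (List.replicate (N ^ k) false) =
      FS R Vt σ 0 (Literature.Computability.Complexity.ones (N ^ k)) [] [] (digitsOf k a₀) (fun _ => []) := by
  have hst0 : stT (Rin := Rin) k φ Vt σ 0 = List.replicate (N ^ k) false := by
    rw [stT, tableOf]
    apply List.ext_getElem?; intro i
    by_cases hi : i < N ^ k
    · rw [List.getElem?_ofFn, dif_pos hi, List.getElem?_replicate, if_pos hi]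
      simp only [ifpStages, Set.mem_empty_iff_false, Option.some.injEq]
      rw [Bool.eq_false_iff, ne_eq, bv_eq_true_iff]; exact id
    · rw [List.getElem?_eq_none (by simp; omega), List.getElem?_eq_none (by simp; omega)]
  ext r : 1
  by_cases h1 : r = rvr' rv.length
  · subst h1; rw [Function.update_self, fpSt_rvr k φ _ Vt σ _ _ _ _ _ _ hW, hst0]
  rw [Function.update_of_ne h1]
  by_cases h2 : r = rvo' rv.length
  · subst h2; rw [Function.update_self, fpSt_rvo k φ _ Vt σ _ _ _ _ _ _ hW]
  rw [Function.update_of_ne h2]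
  cases r with
  | xv j =>
    simp only [fpSt]
    split_ifs with hj
    · rw [show (xv j : ER A V W P) = xv' (j : ℕ) by rw [xv'_eq j.2], hI.xv_hi j (by omega)]
      simp [digitsOf, show (j : ℕ) - n < k by omega, h0]
    · rfl
  | lp j =>
    simp only [fpSt]
    split_ifs with hj
    · rw [show (lp j : ER A V W P) = lp' (j : ℕ) by rw [lp'_eq j.2], hI.lp_hi j (by omega)]
    · rfl
  | rvo m' =>
    simp only [fpSt]
    split_ifs with hm
    · exfalso; apply h2; rw [rvo'_eq hW]; congr 1; ext; exact hm
    · rfl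
  | rvr m' =>
    simp only [fpSt]
    split_ifs with hm
    · exfalso; apply h1; rw [rvr'_eq hW]; congr 1; ext; exact hm
    · rfl
  | rvc m' =>
    simp only [fpSt]
    split_ifs with hm
    · rw [show (rvc m' : ER A V W P) = rvc' rv.length by rw [rvc'_eq hW]; congr 1; ext; exact hm]
      exact (hI.rv_hi rv.length le_rfl).2.1
    · rfl
  | rvb m' =>
    simp only [fpSt]
    split_ifs with hm
    · rw [show (rvb m' : ER A V W P) = rvb' rv.length by rw [rvb'_eq hW]; congr 1; ext; exact hm]
      exact (hI.rv_hi rv.length le_rfl).2.2.1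
    · rfl
  | _ => rfl

/-- The final canonical state of the fixed-point machinery is the base, up to the node's table register. [folklore] -/
theorem fpSt_final (hI : Inv (A := A) (V := V) (W := W) (P := P) N Rin Vt σ dp R) (hW : rv.length < W)
    (a₀ : Fin k → Fin N) (h0 : ∀ l, (a₀ l : ℕ) = 0) (st : ℕ) :
    Function.update (FS R Vt σ st [] [] [] (digitsOf k a₀) (fun _ => [])) (rvr' rv.length) [] = R := by
  ext r : 1
  by_cases h1 : r = rvr' rv.length
  · subst h1; rw [Function.update_self]; exact (hI.rv_hi rv.length le_rfl).1.symm
  rw [Function.update_of_ne h1]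
  cases r with
  | xv j =>
    simp only [fpSt]
    split_ifs with hj
    · rw [show (xv j : ER A V W P) = xv' (j : ℕ) by rw [xv'_eq j.2], hI.xv_hi j (by omega)]
      simp [digitsOf, show (j : ℕ) - n < k by omega, h0]
    · rfl
  | lp j =>
    simp only [fpSt]
    split_ifs with hj
    · rw [show (lp j : ER A V W P) = lp' (j : ℕ) by rw [lp'_eq j.2], hI.lp_hi j (by omega)]
    · rfl
  | rvo m' =>
    simp only [fpSt]
    split_ifs with hm
    · rw [show (rvo m' : ER A V W P) = rvo' rv.length by rw [rvo'_eq hW]; congr 1; ext; exact hm]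
      exact (hI.rv_hi rv.length le_rfl).2.2.2.symm
    · rfl
  | rvr m' =>
    simp only [fpSt]
    split_ifs with hm
    · exfalso; apply h1; rw [rvr'_eq hW]; congr 1; ext; exact hm
    · rfl
  | rvc m' =>
    simp only [fpSt]
    split_ifs with hm
    · rw [show (rvc m' : ER A V W P) = rvc' rv.length by rw [rvc'_eq hW]; congr 1; ext; exact hm]
      exact (hI.rv_hi rv.length le_rfl).2.1.symm
    · rfl
  | rvb m' =>
    simp only [fpSt]
    split_ifs with hm
    · rw [show (rvb m' : ER A V W P) = rvb' rv.length by rw [rvb'_eq hW]; congr 1; ext; exact hm]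
      exact (hI.rv_hi rv.length le_rfl).2.2.1.symm
    · rfl
  | _ => rfl


/-- The cost of a fixed-point node. [folklore] -/
def fpCost (N k cφ : ℕ) : ℕ :=
  1 + k * ((N ^ k + 1) * (10 * N + 4) + 2) + (10 * N ^ k + 3) + (N ^ k * 3 + 1) +
    (N ^ k * (stageCost N k cφ + 2) + 1) + (k * (N ^ k * (10 * N + 12) + 4) + 32 * N ^ k + 12) + (2 * N ^ k + 1)

variable (k φ dp) in
/-- **The fixed-point node.** [folklore] -/
theorem spec_fp (t : Fin k → Fin n) (cφ : ℕ) (hφ : Spec (A := A) (V := V) (W := W) (P := P) N Rin φ (dp + 1) cφ) :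
    Spec (A := A) (V := V) (W := W) (P := P) N Rin (.fp k φ t) dp (fpCost N k cφ) := by
  intro Vt σ R hI hV hW hP
  simp only [fvars, frels, fdepth] at hV hW hP
  have hnV : n + k ≤ V := by omega
  have hnV' : n < V := by omega
  have hWm : rv.length < W := by omega
  have hP0 : dp < P := by omega
  -- the zero tuple
  obtain ⟨a₀, h0⟩ : ∃ a₀ : Fin k → Fin N, ∀ l, (a₀ l : ℕ) = 0 := by
    rcases Nat.eq_zero_or_pos N with hN | hN
    · subst hN
      rcases Nat.eq_zero_or_pos k with hk | hk
      · subst hk; exact ⟨Fin.elim0, fun l => l.elim0⟩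
      · exfalso
        rcases Nat.eq_zero_or_pos n with hn | hn
        · subst hn; exact (t ⟨0, hk⟩).elim0
        · exact (σ ⟨0, hn⟩).elim0
    · exact ⟨fun _ => ⟨0, hN⟩, fun _ => rfl⟩
  set F := fpOp (Rin := Rin) k φ Vt σ with hF
  -- P1: the stage counter
  have hrvo : R (rvo' rv.length) = [] := (hI.rv_hi rv.length le_rfl).2.2.2
  have hrvr : R (rvr' rv.length) = [] := (hI.rv_hi rv.length le_rfl).1
  have p1 : Runs (push (rvo' rv.length) true) R (Function.update R (rvo' rv.length) (Literature.Computability.Complexity.ones 1)) 1 :=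
    Runs.push' (by rw [hrvo]; rfl)
  set R₁ := Function.update R (rvo' rv.length) (Literature.Computability.Complexity.ones 1) with hR₁
  have p2 := runs_powProg (n := nn) (a := rvo' rv.length) (a2 := s 0) (t := s 1) (by rw [rvo'_eq hWm]; simp)
    (by simp) (by simp) (by rw [rvo'_eq hWm]; simp) (by rw [rvo'_eq hWm]; simp) (by simp) N (N ^ k + 1) k 1 R₁
    (by omega) (by omega) (by rw [hR₁, Function.update_of_ne (by rw [rvo'_eq hWm]; simp), hI.nn]) (by rw [hR₁, Function.update_self])
    (by rw [hR₁, Function.update_of_ne (by rw [rvo'_eq hWm]; simp), hI.scratch 0])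
    (by rw [hR₁, Function.update_of_ne (by rw [rvo'_eq hWm]; simp), hI.scratch 1])
  rw [hR₁, Function.update_idem, one_mul] at p2
  set R₂ := Function.update R (rvo' rv.length) (Literature.Computability.Complexity.ones (N ^ k)) with hR₂
  -- P2: the table of stage 0
  have p3 := runs_copy (a := rvo' rv.length) (b := s 0) (t := s 1) (u := s 2) (by rw [rvo'_eq hWm]; simp)
    (by rw [rvo'_eq hWm]; simp) (by rw [rvo'_eq hWm]; simp) (by simp) (by simp) (by simp) R₂
    (by rw [hR₂, Function.update_of_ne (by rw [rvo'_eq hWm]; simp), hI.scratch 1])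
    (by rw [hR₂, Function.update_of_ne (by rw [rvo'_eq hWm]; simp), hI.scratch 2])
  rw [show R₂ (rvo' rv.length) = Literature.Computability.Complexity.ones (N ^ k) by rw [hR₂, Function.update_self],
    show R₂ (s 0) = [] by rw [hR₂, Function.update_of_ne (by rw [rvo'_eq hWm]; simp), hI.scratch 0], List.append_nil] at p3
  set R₃ := Function.update R₂ (s 0) (Literature.Computability.Complexity.ones (N ^ k)) with hR₃
  have p4 := runs_fill (q := s 0) (d := rvr' rv.length) (by rw [rvr'_eq hWm]; simp) (N ^ k) R₃ (by rw [hR₃, Function.update_self])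
  have hR₃r : R₃ (rvr' rv.length) = [] := by
    rw [hR₃, Function.update_of_ne (by rw [rvr'_eq hWm]; simp), hR₂, Function.update_of_ne (by rw [rvr'_eq hWm, rvo'_eq hWm]; simp), hrvr]
  rw [hR₃r, List.append_nil] at p4
  have e4 : Function.update (Function.update R₃ (s 0) []) (rvr' rv.length) (List.replicate (N ^ k) false) =
      FS R Vt σ 0 (Literature.Computability.Complexity.ones (N ^ k)) [] [] (digitsOf k a₀) (fun _ => []) := by
    have e3 : Function.update R₃ (s 0) [] = R₂ := by
      rw [hR₃, Function.update_idem]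
      exact Function.update_eq_self_iff.mpr (by
        rw [hR₂, Function.update_of_ne (by rw [rvo'_eq hWm]; simp), hI.scratch 0])
    rw [e3, hR₂, fpSt_init (Rin := Rin) (k := k) (φ := φ) hI hWm a₀ h0]
  rw [e4] at p4
  -- P3: the stages
  have p5 := runs_fpStages (Rin := Rin) hI (by omega) (by omega) (by omega) cφ hφ a₀ h0 (fun _ => []) (fun _ _ => rfl) (N ^ k) 0
  rw [Nat.zero_add] at p5
  set Sf := FS R Vt σ (N ^ k) [] [] [] (digitsOf k a₀) (fun _ => []) with hSf
  -- P4: read off the result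
  have p6 := runs_tableAtom N σ t (rvr' rv.length) (ifp F) dp hP0 hnV' Sf
    (by rw [hSf, fpSt_rvr k φ _ Vt σ _ _ _ _ _ _ hWm, stT, ← hF, ifpStages_pow_eq_ifp])
    (by rw [rvr'_eq hWm, wk'_eq hP0]; simp)
    (by rw [hSf, fpSt_nn]; exact hI.nn)
    (fun j => by rw [hSf, fpSt_xv_lo k φ _ Vt σ _ _ _ _ _ _ j.2]; exact hI.xv j)
    (fun i => by rw [hSf, fpSt_s]; exact hI.scratch i)
    (by rw [hSf, fpSt_wk']; exact hI.wk dp le_rfl 0)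
  set bres := bv ((σ ∘ t) ∈ ifp F) with hbres
  have p7 := runs_clear (rvr' rv.length) (Function.update Sf (wk' dp 0) (Literature.Computability.Complexity.flag bres))
  rw [Function.update_of_ne (by rw [rvr'_eq hWm, wk'_eq hP0]; simp), hSf, fpSt_rvr k φ _ Vt σ _ _ _ _ _ _ hWm,
    length_stT, ← hSf] at p7
  have efin : Function.update (Function.update Sf (wk' dp 0) (Literature.Computability.Complexity.flag bres)) (rvr' rv.length) [] =
      Function.update R (wk' dp 0) (Literature.Computability.Complexity.flag bres) := by
    rw [Function.update_comm (by rw [rvr'_eq hWm, wk'_eq hP0]; simp), hSf,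
      fpSt_final (Rin := Rin) (k := k) (φ := φ) hI hWm a₀ h0]
  rw [efin] at p7
  have hres : bres = bv ((Formula.fp k φ t).eval (withNatOrder Rin) Vt σ) := by
    rw [hbres]; rfl
  rw [hres] at p7
  rw [cmp_fp]
  simp only [Literature.Computability.Complexity.ones, List.length_replicate] at p1 p2 p3 p4 p5 p6 p7
  refine (p1.seq (p2.seq (p3.seq (p4.seq (p5.seq (p6.seq p7)))))).of_eq rfl ?_
  unfold fpCost; omega

end FpBody

end FixedPoint


/-! ### The evaluator is correct: all cases assembled -/

section Master

variable (N : ℕ) (Rin : RelTables ar N)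

/-- The cost of evaluating a formula on a structure of size `N`. [folklore] -/
noncomputable def fcost (N : ℕ) : {rv : List ℕ} → {n : ℕ} → Formula (2 :: ar) rv n → ℕ
  | _, _, .rel ⟨0, _⟩ _ => 26 * N + 12
  | _, _, .rel ⟨i + 1, hi⟩ _ =>
      ar.get ⟨i, Nat.lt_of_succ_lt_succ hi⟩ * (N ^ ar.get ⟨i, Nat.lt_of_succ_lt_succ hi⟩ * (10 * N + 12) + 4) +
        32 * N ^ ar.get ⟨i, Nat.lt_of_succ_lt_succ hi⟩ + 12
  | rv, _, .rvar j _ => rv.get j * (N ^ rv.get j * (10 * N + 12) + 4) + 32 * N ^ rv.get j + 12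
  | _, _, .eq _ _ => 29 * N + 15
  | _, _, .not φ => fcost N φ + 3
  | _, _, .and φ ψ => fcost N φ + fcost N ψ + 5
  | _, _, .or φ ψ => fcost N φ + fcost N ψ + 5
  | _, _, .ex φ => N * (fcost N φ + 9) + 12 * N + 5
  | _, _, .all φ => N * (fcost N φ + 3 + 9) + 12 * N + 5 + 3
  | _, _, .fp k φ _ => fpCost N k (fcost N φ)

/-- **Correctness and cost of the compiled evaluator** (all formulas, all depths). [folklore] -/
theorem spec_cmp : ∀ {rv : List ℕ} {n : ℕ} (ψ : Formula (2 :: ar) rv n) (dp : ℕ),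
    Spec (A := A) (V := V) (W := W) (P := P) N Rin ψ dp (fcost N ψ)
  | _, _, .rel ⟨0, h0⟩ v, dp => spec_rel_zero N Rin h0 v dp
  | _, _, .rel ⟨i + 1, hi⟩ v, dp => spec_rel_succ N Rin i hi v dp
  | _, _, .rvar j v, dp => spec_rvar N Rin j v dp
  | _, _, .eq a b, dp => spec_eq N Rin a b dp
  | _, _, .not φ, dp => spec_not φ dp _ (spec_cmp φ (dp + 1))
  | _, _, .and φ ψ, dp => spec_and φ ψ dp _ _ (spec_cmp φ (dp + 1)) (spec_cmp ψ (dp + 1))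
  | _, _, .or φ ψ, dp => spec_or φ ψ dp _ _ (spec_cmp φ (dp + 1)) (spec_cmp ψ (dp + 1))
  | _, _, .ex φ, dp => spec_ex φ dp _ (spec_cmp φ (dp + 1))
  | _, _, .all φ, dp => spec_all φ dp _ (spec_cmp φ (dp + 3))
  | _, _, .fp k φ t, dp => spec_fp k φ dp t _ (spec_cmp φ (dp + 1))

end Master


/-! ### Polynomial bounds on the cost -/

section PolyBound

/-- `f` is bounded by a polynomial `C · (N + 1) ^ e`. [folklore] -/
def PolyBd (f : ℕ → ℕ) : Prop := ∃ C e : ℕ, ∀ N, f N ≤ C * (N + 1) ^ e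

/-- Constants are polynomially bounded. [folklore] -/
theorem PolyBd.const (c : ℕ) : PolyBd fun _ => c := ⟨c, 0, fun N => by simp⟩

/-- The identity is polynomially bounded. [folklore] -/
theorem PolyBd.id : PolyBd fun N => N := ⟨1, 1, fun N => by simp⟩

/-- Powers are polynomially bounded. [folklore] -/
theorem PolyBd.pow (k : ℕ) : PolyBd fun N => N ^ k :=
  ⟨1, k, fun N => by rw [one_mul]; exact Nat.pow_le_pow_left (Nat.le_succ N) k⟩

/-- Sums of polynomially bounded functions are polynomially bounded. [folklore] -/
theorem PolyBd.add {f g : ℕ → ℕ} (hf : PolyBd f) (hg : PolyBd g) : PolyBd fun N => f N + g N := by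
  obtain ⟨C₁, e₁, h₁⟩ := hf
  obtain ⟨C₂, e₂, h₂⟩ := hg
  refine ⟨C₁ + C₂, max e₁ e₂, fun N => ?_⟩
  have p1 : (N + 1) ^ e₁ ≤ (N + 1) ^ max e₁ e₂ := Nat.pow_le_pow_right (Nat.succ_pos N) (le_max_left _ _)
  have p2 : (N + 1) ^ e₂ ≤ (N + 1) ^ max e₁ e₂ := Nat.pow_le_pow_right (Nat.succ_pos N) (le_max_right _ _)
  have := h₁ N; have := h₂ N
  nlinarith

/-- Products of polynomially bounded functions are polynomially bounded. [folklore] -/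
theorem PolyBd.mul {f g : ℕ → ℕ} (hf : PolyBd f) (hg : PolyBd g) : PolyBd fun N => f N * g N := by
  obtain ⟨C₁, e₁, h₁⟩ := hf
  obtain ⟨C₂, e₂, h₂⟩ := hg
  refine ⟨C₁ * C₂, e₁ + e₂, fun N => ?_⟩
  rw [pow_add]
  have := Nat.mul_le_mul (h₁ N) (h₂ N)
  nlinarith

/-- A function below a polynomially bounded function is polynomially bounded. [folklore] -/
theorem PolyBd.of_le {f g : ℕ → ℕ} (hg : PolyBd g) (h : ∀ N, f N ≤ g N) : PolyBd f := by
  obtain ⟨C, e, hC⟩ := hg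
  exact ⟨C, e, fun N => (h N).trans (hC N)⟩

/-- The cost of the nested enumeration loops is polynomial if the body cost is. [folklore] -/
theorem PolyBd.enumCost {cb : ℕ → ℕ} (hcb : PolyBd cb) : ∀ d : ℕ, PolyBd fun N => enumCost N (cb N) d
  | 0 => by simpa [_root_.Literature.ModelTheory.FiniteModelTheory.LFPEval.enumCost] using hcb
  | d + 1 => by
    have ih := PolyBd.enumCost hcb d
    simp only [_root_.Literature.ModelTheory.FiniteModelTheory.LFPEval.enumCost]
    exact (((((PolyBd.const 10).mul PolyBd.id).add (PolyBd.const 3)).add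
      ((PolyBd.id.mul ((ih.add (PolyBd.const 1)).add (PolyBd.const 2))).add (PolyBd.const 1))).add
      (((PolyBd.const 2).mul PolyBd.id).add (PolyBd.const 1)))

/-- The cost of one fixed-point stage is polynomial if the body cost is. [Gurevich 1984, §4 Thm. 3 (3)→(1)] [folklore] -/
theorem PolyBd.stageCost (k : ℕ) {cb : ℕ → ℕ} (hcb : PolyBd cb) : PolyBd fun N => stageCost N k (cb N) := by
  simp only [_root_.Literature.ModelTheory.FiniteModelTheory.LFPEval.stageCost]
  exact (((((PolyBd.const 10).mul (PolyBd.pow k)).add (PolyBd.const 3)).add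
    (PolyBd.enumCost (hcb.add (PolyBd.const 9)) k)).add (((PolyBd.const 2).mul (PolyBd.pow k)).add (PolyBd.const 1))).add
    (((PolyBd.const 3).mul (PolyBd.pow k)).add (PolyBd.const 1))

/-- The cost of a fixed-point node (`N ^ k` stages) is polynomial if the body cost is. [Gurevich 1984, §4 Claim 2, Thm. 3 (3)→(1)] [folklore] -/
theorem PolyBd.fpCost (k : ℕ) {cb : ℕ → ℕ} (hcb : PolyBd cb) : PolyBd fun N => fpCost N k (cb N) := by
  simp only [_root_.Literature.ModelTheory.FiniteModelTheory.LFPEval.fpCost]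
  refine ((((((PolyBd.const 1).add ((PolyBd.const k).mul ((((PolyBd.pow k).add (PolyBd.const 1)).mul
    (((PolyBd.const 10).mul PolyBd.id).add (PolyBd.const 4))).add (PolyBd.const 2)))).add
    (((PolyBd.const 10).mul (PolyBd.pow k)).add (PolyBd.const 3))).add (((PolyBd.pow k).mul (PolyBd.const 3)).add
    (PolyBd.const 1))).add ((((PolyBd.pow k).mul ((PolyBd.stageCost k hcb).add (PolyBd.const 2))).add
    (PolyBd.const 1)))).add ((((PolyBd.const k).mul (((PolyBd.pow k).mul (((PolyBd.const 10).mul PolyBd.id).add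
    (PolyBd.const 12))).add (PolyBd.const 4))).add ((PolyBd.const 32).mul (PolyBd.pow k))).add (PolyBd.const 12))).add
    (((PolyBd.const 2).mul (PolyBd.pow k)).add (PolyBd.const 1))

/-- The cost of evaluating a fixed formula is polynomial in the size of the universe. [folklore] -/
theorem polyBd_fcost : ∀ {rv : List ℕ} {n : ℕ} (ψ : Formula (2 :: ar) rv n), PolyBd fun N => fcost N ψ
  | _, _, .rel ⟨0, _⟩ _ => by
    simp only [fcost]; exact ((PolyBd.const 26).mul PolyBd.id).add (PolyBd.const 12)
  | _, _, .rel ⟨i + 1, hi⟩ _ => by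
    simp only [fcost]
    exact (((PolyBd.const _).mul (((PolyBd.pow _).mul (((PolyBd.const 10).mul PolyBd.id).add (PolyBd.const 12))).add
      (PolyBd.const 4))).add ((PolyBd.const 32).mul (PolyBd.pow _))).add (PolyBd.const 12)
  | rv, _, .rvar j _ => by
    simp only [fcost]
    exact (((PolyBd.const _).mul (((PolyBd.pow _).mul (((PolyBd.const 10).mul PolyBd.id).add (PolyBd.const 12))).add
      (PolyBd.const 4))).add ((PolyBd.const 32).mul (PolyBd.pow _))).add (PolyBd.const 12)
  | _, _, .eq _ _ => by simp only [fcost]; exact ((PolyBd.const 29).mul PolyBd.id).add (PolyBd.const 15)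
  | _, _, .not φ => by simp only [fcost]; exact (polyBd_fcost φ).add (PolyBd.const 3)
  | _, _, .and φ ψ => by simp only [fcost]; exact ((polyBd_fcost φ).add (polyBd_fcost ψ)).add (PolyBd.const 5)
  | _, _, .or φ ψ => by simp only [fcost]; exact ((polyBd_fcost φ).add (polyBd_fcost ψ)).add (PolyBd.const 5)
  | _, _, .ex φ => by
    simp only [fcost]
    exact ((PolyBd.id.mul ((polyBd_fcost φ).add (PolyBd.const 9))).add ((PolyBd.const 12).mul PolyBd.id)).add
      (PolyBd.const 5)
  | _, _, .all φ => by
    simp only [fcost]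
    exact (((PolyBd.id.mul (((polyBd_fcost φ).add (PolyBd.const 3)).add (PolyBd.const 9))).add
      ((PolyBd.const 12).mul PolyBd.id)).add (PolyBd.const 5)).add (PolyBd.const 3)
  | _, _, .fp k φ _ => by simp only [fcost]; exact PolyBd.fpCost k (polyBd_fcost φ)

end PolyBound

end LFPEval

end Literature.ModelTheory.FiniteModelTheory
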